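import Summits.HodgeConjecture.HodgeConjecture.Cruxes.BlochSeedDiscOne.DiamondLevelLaws

/-!
# CeilingPair — `h`-uniform ABSENT families of ◇_h (`h = 2m+4`) over the twin fork `{c·ℓ_φ, 2I + m·ℓ_u}`, the ceiling∕sub-ceiling lines and
# (§14) the A2I⁻ interface at the origin — the controlling structure of the round-1 stratum of the hsemireg peel census and of ≈ 45 % of
# its round-2 stratum (control lens, g20, v1.6).  ALL TABLES, NUMBERS, RESIDUE AND TOOLS: memo `CEILING-PAIR-g20.md` beside this file.

`line stmt-HodgeConjecture-18881 Cruxes/BlochSeedDiscOne/Lines/birth.lean 814a6a70c14e831a stub_rung_pad4_seedAt` — crux-chain WORKFILE of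
`BlochSeedDiscOne` (route `EightfoldBlochSeeds`, FRONTIER); planner seat `plan-lens-HodgeAV-control-g20` (lens «control»; director-hodge req-36).

HONEST FRAMING.  Nothing here proves HC, HC_CM, HC_AV, the hinge H2 = `stmt-18881`, `(T_h)`, `KAbsent_h` or touches `stub_rung_pad4_seedAt`.
This is kernel arithmetic about the typed ENCODER MODEL of the hsemireg experiment (`Summits/Ventures/HSemireg/Pad4Tower*.lean`: two-level
designs `C : MConfig` in the diamond ◇_h obeying RULE D (`RuleDMu4N/P`), the X⁺ law (`XPlusClosed`), from §14 on also the A2I⁻ law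
(`A2IMinusClosed`), and the `G₁ = ⟨S₄, Δ⟩` symmetry (`PermClosed`, `DeltaClosed`)).  CENSUS-NEUTRAL: every family is checked against the
peel census of record (gs-eng-2 g54 j318002: ◇₈ peel table sha16 a459e02921a60310, ◇₁₀ 74004db439790926; ◇₄/◇₆ control g19 kspeel
`ks4_C`/`ks6_C`; bc5-plan g8 ◇₈ r3 j305149; ◇₁₀ G₁ j308425) and agrees with it on every orbit — 0 counterexamples, no member is a census
survivor or of peel round ≥ 3; it re-derives census facts inside the kernel and adds no SAT/UNSAT row.

WHAT IS PROVED (sorry-free; every `h : ℤ`, no parity, no `h ≤ 10`, no level law; hypotheses ◇_h = `C.InDiamond h`, RULE D on both levels, X⁺,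
and where stated `PermClosed` ∕ `DeltaClosed C.upper` ∕ (§14 only) `A2IMinusClosed`; `_static` versions and one ◇₈ representative per family over
`MConfig.G1Closed`, `MConfig.StaticH1`).  Letters: `c·ℓ_φ = floorLetter φ c`, `2I + n·ℓ_u = nodeTwoLetter u n`, `cu_χ = ceilingUnit h χ`, `hI`,
the ceiling line `y_d = ceilLetter h v d` (`y_{−1} = hI`, `y_0 = cu`), the sub-ceiling line `s_k = subCeilLetter m v k` (top `h−2`), `t_k =
subSubLetter m v k` (top `h−4`); slots listed in the order 0,1,2,3.  Families by section (statements in the theorem docstrings, tables in the memo):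
§2–§3 pair forks A1 A2 A4 A5 and the lone-unit chain B1 B2 B3 · §7 TN0 TP1 TP2 TN1 TN2 · §9 free slot TN3 TP3 TP5 · §10 TN4 TP6 TP7 TN5 ·
§11 twin frame TN6 TN8 TN9 TN10 TN11 TP8–TP12 · §12 two ceiling-line letters TP13 TP13F TN12 TP14 · §13 `y_1`-frame TP15 TP16 TP17a TP17b
TN13 TN14 TN15 · §14 A2I⁻ origin interface B4 TP18 TN17 TP20 TN16 and law-free TP19 TN18 TP21.

BUILD NOTE. §0 restates VERBATIM (credited) the lemmas of `CeilingFork.lean` (control g18) and `CeilingUnitApex.lean` (g19) that are called,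
because only `DiamondLevelLaws` is importable on the farm; §6 restates the g18 twin fork.  `lean check`: rc 0 · 0 sorry · 0 error · 0 warning.
-/

set_option linter.dupNamespace false
set_option linter.unusedSimpArgs false

namespace Summit.HodgeConjecture.HodgeConjecture.Cruxes.BlochSeedDiscOne.CeilingPair

open Finset Summit.Ventures.HSemireg.Pad4Tower
open Summit.HodgeConjecture.HodgeConjecture.Cruxes.BlochSeedDiscOne.DiamondLevelLaws

/-! ## §0 Restated verbatim from `CeilingFork.lean` (control g18) and `CeilingUnitApex.lean` (control g19) — credited, not new -/

/-- [g18 `CeilingFork.xplus_unit_fork`] the X⁺ fork at a ceiling apex with two UNIT children needs no side condition. -/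
theorem xplus_unit_fork {h : ℤ} {C : MConfig} (hU : C.InDiamond h) (hX : XPlusClosed C) {Z : MCell} (hZ : Z ∈ C.lower)
    {g f : Fin 4} (hfg : f ≠ g) (hg : Z g = (h, 0, 0)) (hf : Z f = (h, 0, 0)) {P₁ P₂ : MCell}
    (hP₁ : P₁ ∈ C.upper) (hP₂ : P₂ ∈ C.upper) {r₁ r₂ : Fin 4} (hr : r₂ ≠ r₁) (h1 : UPartner Z P₁ g r₁) (h2 : UPartner Z P₂ g r₂)
    (hd₁ : (P₁ g).1 = h - 1) (hd₂ : (P₂ g).1 = h - 1) : False := by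
  have hZg1 : (Z g).1 = h := by rw [hg]
  have h1ray : ((h, 0, 0) : BPoint) = ray (P₁ g) r₁ (h - (P₁ g).1) := by have := h1.2.2; rw [hg] at this; exact this
  refine hX (dualCell 0 P₁) (dualCell_mem_dual_lower hP₁) (dualCell 0 Z) (dualCell_mem_dual_upper hZ) (dualCell 0 P₂)
    (dualCell_mem_dual_lower hP₂) g r₁ r₂ f ⟨?_, hfg, (uPartner_dual 0 Z P₁ g r₁).mpr h1, ?_, hr, ?_, ?_, ?_, ?_, ?_⟩
  · exact fun hap => not_isApex_below_apex (by omega) h1ray ((isApex_dual 0 (P₁ g)).mp hap)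
  · intro P hP hPu
    obtain ⟨X, hXl, rfl⟩ := Finset.mem_image.mp hP
    have hu : UPartner X P₁ g r₁ := (uPartner_dual 0 X P₁ g r₁).mp hPu
    show 0 - (X g).1 ≤ 0 - (Z g).1
    have hlt : (P₁ g).1 < (X g).1 := hu.2.1
    have hle : (X g).1 ≤ h := fst_le_of_inDiamond (hU.1 X hXl g)
    omega
  · exact ⟨magree_dual.mpr (fun j hj => (h2.1 j hj).symm), (ray_dual_iff 0 (Z g) (P₂ g) r₂).mpr ⟨h2.2.1, h2.2.2⟩⟩
  · intro P hP _ hlt1 hlt2 _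
    obtain ⟨X, hXl, rfl⟩ := Finset.mem_image.mp hP
    exfalso
    change 0 - (Z g).1 < 0 - (X g).1 at hlt1
    change 0 - (X g).1 < 0 - (P₂ g).1 at hlt2
    have hle : (X g).1 ≤ h := fst_le_of_inDiamond (hU.1 X hXl g)
    omega
  · intro P hP _ _ _ _
    obtain ⟨X, hXl, rfl⟩ := Finset.mem_image.mp hP
    show Effective (bsub (dualPt 0 (X g)) (dualPt 0 (Z g)))
    rw [bsub_dualPt0, hg]
    exact effective_ceilingApex_sub (hU.1 X hXl g)
  · intro P hP _ hnb _
    obtain ⟨X, hXl, rfl⟩ := Finset.mem_image.mp hP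
    exfalso
    have e1 : (P₁ f).1 = h := by rw [(h1.1 f hfg).trans hf]
    have := hnb.1
    change 0 - (X f).1 < 0 - (P₁ f).1 at this
    have hle := fst_le_of_inDiamond (hU.1 X hXl f)
    omega
  · intro P hP hnb
    obtain ⟨X, hXl, rfl⟩ := Finset.mem_image.mp hP
    exfalso
    have e1 : (P₁ f).1 = h := by rw [(h1.1 f hfg).trans hf]
    have := hnb.1
    change 0 - (X f).1 < 0 - (P₁ f).1 at this
    have hle := fst_le_of_inDiamond (hU.1 X hXl f)
    omega

/-- [g18] the unit floor letter `ℓ_φ = O + n_φ`. -/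
abbrev floorUnit (φ : Fin 4) : BPoint := ray ((0, 0, 0) : BPoint) φ 1

/-- [g18] the unit ceiling letter `(h−2)I + ℓ_χ`. -/
abbrev ceilingUnit (h : ℤ) (χ : Fin 4) : BPoint := ray ((h - 2, 0, 0) : BPoint) χ 1

/-- [g18] the floor letter `c·ℓ_φ` (node `0`, top `2c`). -/
abbrev floorLetter (φ : Fin 4) (c : ℤ) : BPoint := ray ((0, 0, 0) : BPoint) φ c

/-- [g18] the letter `2I + n·ℓ_u` (node `2`, top `2 + 2n`). -/
abbrev nodeTwoLetter (u : Fin 4) (n : ℤ) : BPoint := ray ((2, 0, 0) : BPoint) u n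

theorem floorUnit_not_isApex (φ : Fin 4) : ¬ isApex (floorUnit φ) := by
  fin_cases φ <;> simp [ray, isApex]

theorem floorUnit_fst (φ : Fin 4) : (floorUnit φ).1 = 1 := by
  fin_cases φ <;> simp [ray]

theorem floorUnit_node (φ : Fin 4) : Adapted (floorUnit φ) (φ + 2) ∧ coord (floorUnit φ) (φ + 2) = 0 := by
  fin_cases φ <;> simp [ray, coord, Adapted]

theorem floorUnit_top (φ : Fin 4) : Adapted (floorUnit φ) φ ∧ coord (floorUnit φ) φ = 2 := by
  fin_cases φ <;> simp [ray, coord, Adapted]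

theorem ceilingUnit_not_isApex (h : ℤ) (χ : Fin 4) : ¬ isApex (ceilingUnit h χ) := by
  fin_cases χ <;> simp [ray, isApex]

theorem ceilingUnit_fst (h : ℤ) (χ : Fin 4) : (ceilingUnit h χ).1 = h - 1 := by
  fin_cases χ <;> simp [ray] <;> omega

theorem ceilingUnit_node (h : ℤ) (χ : Fin 4) : Adapted (ceilingUnit h χ) (χ + 2) ∧ coord (ceilingUnit h χ) (χ + 2) = h - 2 := by
  fin_cases χ <;> simp [ray, coord, Adapted]

theorem ceilingApex_eq_ray_ceilingUnit (h : ℤ) (χ : Fin 4) : ((h, 0, 0) : BPoint) = ray (ceilingUnit h χ) (χ + 2) 1 := by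
  fin_cases χ <;> simp [ray] <;> omega

/-- [g18] below a unit floor letter there is only `O`, along the letter's own ray. -/
theorem below_floorUnit {h : ℤ} {y : BPoint} (hy : InDiamond h y) {φ r : Fin 4} {d : ℤ} (hd : 0 < d)
    (he : floorUnit φ = ray y r d) : r = φ ∧ y = (0, 0, 0) := by
  obtain ⟨α, a, b⟩ := y
  obtain ⟨hax, h1, -, -⟩ := hy
  simp only [AxisPt, absCharge, chargeOf, ray, Prod.mk.injEq] at hax h1 he
  fin_cases φ <;> fin_cases r <;> simp at he hax ⊢ <;>
    (simp only [abs_eq_max_neg, max_def] at h1; split_ifs at h1 <;> omega)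

/-- [g18] above a unit ceiling letter there is only `hI`, along the node direction. -/
theorem above_ceilingUnit {h : ℤ} {y : BPoint} (hy : InDiamond h y) {χ r : Fin 4} {e : ℤ} (he0 : 0 < e)
    (he : y = ray (ceilingUnit h χ) r e) : r = χ + 2 ∧ y = (h, 0, 0) := by
  subst he
  obtain ⟨hax, h1, -, h3⟩ := hy
  simp only [AxisPt, absCharge, chargeOf, ray, Prod.mk.injEq] at hax h1 h3 ⊢
  fin_cases χ <;> fin_cases r <;> simp at hax h1 h3 ⊢ <;>
    (simp only [abs_eq_max_neg, max_def] at h1 h3; split_ifs at h1 h3 <;> omega)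

theorem deltaPt_floorUnit (φ : Fin 4) : deltaPt (floorUnit φ) = floorUnit (φ + 3) := by
  fin_cases φ <;> simp [ray, deltaPt]

theorem deltaPt_ceilingUnit (h : ℤ) (χ : Fin 4) : deltaPt (ceilingUnit h χ) = ceilingUnit h (χ + 3) := by
  fin_cases χ <;> simp [ray, deltaPt]

theorem deltaPt_apex (a : ℤ) : deltaPt ((a, 0, 0) : BPoint) = (a, 0, 0) := by
  simp [deltaPt]

theorem floorUnit_inj {φ ψ : Fin 4} (e : floorUnit φ = floorUnit ψ) : φ = ψ :=
  ray_apex_dir_inj one_ne_zero e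

theorem fin4_add3_ne (χ : Fin 4) : χ + 3 ≠ χ := by fin_cases χ <;> decide
theorem fin4_add33_ne (χ : Fin 4) : χ + 3 + 3 ≠ χ := by fin_cases χ <;> decide
theorem fin4_add333_ne (χ : Fin 4) : χ + 3 + 3 + 3 ≠ χ := by fin_cases χ <;> decide

theorem floorLetter_not_isApex (φ : Fin 4) {c : ℤ} (hc : c ≠ 0) : ¬ isApex (floorLetter φ c) := by
  fin_cases φ <;> simp [ray, isApex, hc]

theorem nodeTwoLetter_not_isApex (u : Fin 4) {n : ℤ} (hn : n ≠ 0) : ¬ isApex (nodeTwoLetter u n) := by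
  fin_cases u <;> simp [ray, isApex, hn]

theorem floorLetter_node (φ : Fin 4) (c : ℤ) : Adapted (floorLetter φ c) (φ + 2) ∧ coord (floorLetter φ c) (φ + 2) = 0 :=
  ⟨(adapted_ray_apex 0 φ c).2, coord_ray_apex_antip 0 φ c⟩

theorem nodeTwoLetter_node (u : Fin 4) (n : ℤ) : Adapted (nodeTwoLetter u n) (u + 2) ∧ coord (nodeTwoLetter u n) (u + 2) = 2 :=
  ⟨(adapted_ray_apex 2 u n).2, coord_ray_apex_antip 2 u n⟩

theorem nodeTwoLetter_fst (u : Fin 4) (n : ℤ) : (nodeTwoLetter u n).1 = 2 + n := by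
  fin_cases u <;> simp [ray]

theorem floorLetter_fst (φ : Fin 4) (c : ℤ) : (floorLetter φ c).1 = c := by
  fin_cases φ <;> simp [ray]

/-- [g18] below a floor-node letter `c·ℓ_φ` (`c ≥ 0`) only its own ray. -/
theorem below_floorLetter {h c d : ℤ} {z : BPoint} (hz : InDiamond h z) {φ r : Fin 4} (hc : 0 ≤ c) (hd : 0 < d)
    (he : floorLetter φ c = ray z r d) : r = φ := by
  obtain ⟨α, a, b⟩ := z
  obtain ⟨hax, h1, -, -⟩ := hz
  simp only [AxisPt, absCharge, chargeOf, ray, Prod.mk.injEq] at hax h1 he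
  fin_cases φ <;> fin_cases r <;> simp at hax h1 he ⊢ <;>
    (simp only [abs_eq_max_neg, max_def] at h1; split_ifs at h1 <;> omega)

/-- [g18 `descent_of_floorUnitPair`] two unit floor letters force the descent `Z(c ↦ O)`. -/
theorem descent_of_floorUnitPair {h : ℤ} {C : MConfig} (hU : C.InDiamond h) {Z : MCell} (hD : RuleDMu4N C Z)
    {b c : Fin 4} (hbc : b ≠ c) {φ ψ : Fin 4} (hb : Z b = floorUnit φ) (hc : Z c = floorUnit ψ) :
    ∃ P ∈ C.upper, MAgree P Z c ∧ P c = (0, 0, 0) := by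
  have hk : Adapted (Z b) (φ + 2) := by rw [hb]; exact (floorUnit_node φ).1
  have hk0 : coord (Z b) (φ + 2) = 0 := by rw [hb]; exact (floorUnit_node φ).2
  have hk' : Adapted (Z c) ψ := by rw [hc]; exact (floorUnit_top ψ).1
  have hk'2 : coord (Z c) ψ = 2 := by rw [hc]; exact (floorUnit_top ψ).2
  have hne : coord (Z b) (φ + 2) ≠ coord (Z c) ψ := by rw [hk0, hk'2]; decide
  have nob : ∀ P ∈ C.upper, ∀ r : Fin 4, UPartner Z P b r → r = φ ∧ P b = (0, 0, 0) := fun P hP r hZP => by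
    have hd : 0 < (Z b).1 - (P b).1 := by have := hZP.2.1; omega
    have e : floorUnit φ = ray (P b) r ((Z b).1 - (P b).1) := by rw [← hb]; exact hZP.2.2
    exact below_floorUnit (hU.2 P hP b) hd e
  rcases hD b c hbc (φ + 2) ψ hk hk' hne with ⟨r, hr, P, hP, hZP⟩ | ⟨r, hr, P, hP, hZP⟩ | ⟨a, a', ha, -, P, hP, -, hb1, hb2, -, -⟩
  · exact absurd ((nob P hP r hZP).1.trans (fin4_add_two_add_two φ).symm) hr
  · have hd : 0 < (Z c).1 - (P c).1 := by have := hZP.2.1; omega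
    have e : floorUnit ψ = ray (P c) r ((Z c).1 - (P c).1) := by rw [← hc]; exact hZP.2.2
    exact ⟨P, hP, hZP.1, (below_floorUnit (hU.2 P hP c) hd e).2⟩
  · have ha' : a = φ + 2 := by
      rcases ha with e | ⟨hap, _⟩
      · exact e
      · exact absurd hap (by rw [hb]; exact floorUnit_not_isApex φ)
    have hd : 0 < (Z b).1 - (P b).1 := by omega
    have e : floorUnit φ = ray (P b) a ((Z b).1 - (P b).1) := by rw [← hb]; exact hb2
    have := (below_floorUnit (hU.2 P hP b) hd e).1
    rw [ha'] at this
    exact absurd (this.trans (fin4_add_two_add_two φ).symm) (by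
      intro h4; have := congrArg (· + 2) h4; simp at this)

/-- [g18 `lift_of_ceilingUnit`] a unit ceiling letter next to a ceiling letter forces the lift `P(d ↦ hI)`, as a `(χ+2)`-partner. -/
theorem lift_of_ceilingUnit {h : ℤ} {C : MConfig} (hU : C.InDiamond h) {P : MCell} (hP : P ∈ C.upper) (hD : RuleDMu4P C P)
    {a d : Fin 4} (had : a ≠ d) (hac : OnCeiling h (P a)) {χ : Fin 4} (hd : P d = ceilingUnit h χ) :
    ∃ N ∈ C.lower, UPartner N P d (χ + 2) ∧ N d = (h, 0, 0) := by
  have hna : ¬ isApex (P d) := by rw [hd]; exact ceilingUnit_not_isApex h χ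
  have hk : Adapted (P d) (χ + 2) := by rw [hd]; exact (ceilingUnit_node h χ).1
  have hkh : coord (P d) (χ + 2) ≠ h := by rw [hd, (ceilingUnit_node h χ).2]; omega
  obtain ⟨N, hN, hNP⟩ := upLine_of_ruleDMu4P hU hP hD had hac hna hk hkh
  have he0 : 0 < (N d).1 - (P d).1 := by have := hNP.2.1; omega
  have e : N d = ray (ceilingUnit h χ) (χ + 2) ((N d).1 - (P d).1) := by rw [← hd]; exact hNP.2.2
  exact ⟨N, hN, hNP, (above_ceilingUnit (hU.1 N hN d) he0 e).2⟩

/-- [g18 `fork_core`] `X = N{·, ·, hI, hI}` (slots 2, 3 apices) with two `P`-children `X(2 ↦ cu_χ)`, `X(2 ↦ cu_χ')`, `χ ≠ χ'` ⇒ X⁺ violated. -/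
theorem fork_core {h : ℤ} {C : MConfig} (hU : C.InDiamond h) (hX : XPlusClosed C) {X : MCell} (hXl : X ∈ C.lower)
    (hX2 : X 2 = (h, 0, 0)) (hX3 : X 3 = (h, 0, 0)) {P₁ P₂ : MCell} (hP₁ : P₁ ∈ C.upper) (hP₂ : P₂ ∈ C.upper)
    {χ χ' : Fin 4} (hχ : χ' ≠ χ) (h1 : MAgree P₁ X 2) (hP₁2 : P₁ 2 = ceilingUnit h χ) (h2 : MAgree P₂ X 2) (hP₂2 : P₂ 2 = ceilingUnit h χ') :
    False := by
  have u1 : UPartner X P₁ 2 (χ + 2) := by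
    refine ⟨h1, by rw [hP₁2, hX2, ceilingUnit_fst]; omega, ?_⟩
    rw [hX2, hP₁2, ceilingUnit_fst, show h - (h - 1) = 1 by ring]
    exact ceilingApex_eq_ray_ceilingUnit h χ
  have u2 : UPartner X P₂ 2 (χ' + 2) := by
    refine ⟨h2, by rw [hP₂2, hX2, ceilingUnit_fst]; omega, ?_⟩
    rw [hX2, hP₂2, ceilingUnit_fst, show h - (h - 1) = 1 by ring]
    exact ceilingApex_eq_ray_ceilingUnit h χ'
  have hr : χ' + 2 ≠ χ + 2 := fun e => hχ (add_right_cancel e)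
  exact xplus_unit_fork hU hX hXl (g := 2) (f := 3) (by decide) hX2 hX3 hP₁ hP₂ hr u1 u2
    (by rw [hP₁2, ceilingUnit_fst]) (by rw [hP₂2, ceilingUnit_fst])

/-- [g18 `ceilingForkFamily_absent`] THE CEILING FORK `N{ℓ_φ, ℓ_ψ, cu_χ, hI}`, `φ ≠ ψ`, is absent. -/
theorem ceilingForkFamily_absent {h : ℤ} {C : MConfig} (hU : C.InDiamond h) (hDN : ∀ Z ∈ C.lower, RuleDMu4N C Z)
    (hDP : ∀ P ∈ C.upper, RuleDMu4P C P) (hX : XPlusClosed C) (hGu : PermClosed C.upper) (hΔu : DeltaClosed C.upper)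
    {Z : MCell} {φ ψ χ : Fin 4} (hφψ : φ ≠ ψ) (h0 : Z 0 = floorUnit φ) (h1 : Z 1 = floorUnit ψ) (h2 : Z 2 = ceilingUnit h χ)
    (h3 : Z 3 = (h, 0, 0)) : Z ∉ C.lower := fun hZ => by
  obtain ⟨Px, hPx, hPxZ, hPx0⟩ := descent_of_floorUnitPair hU (hDN Z hZ) (b := 1) (c := 0) (by decide) h1 h0
  obtain ⟨Py, hPy, hPyZ, hPy1⟩ := descent_of_floorUnitPair hU (hDN Z hZ) (b := 0) (c := 1) (by decide) h0 h1
  have hPx1 : Px 1 = floorUnit ψ := (hPxZ 1 (by decide)).trans h1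
  have hPx2 : Px 2 = ceilingUnit h χ := (hPxZ 2 (by decide)).trans h2
  have hPx3 : Px 3 = (h, 0, 0) := (hPxZ 3 (by decide)).trans h3
  have hPy0 : Py 0 = floorUnit φ := (hPyZ 0 (by decide)).trans h0
  have hPy2 : Py 2 = ceilingUnit h χ := (hPyZ 2 (by decide)).trans h2
  have hPy3 : Py 3 = (h, 0, 0) := (hPyZ 3 (by decide)).trans h3
  obtain ⟨X, hXl, hXP, hXd⟩ := lift_of_ceilingUnit hU hPx (hDP Px hPx) (a := 3) (d := 2) (by decide)
    (by rw [hPx3]; exact onCeiling_apex h) hPx2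
  have hX0 : X 0 = (0, 0, 0) := (hXP.1 0 (by decide)).symm.trans hPx0
  have hX1 : X 1 = floorUnit ψ := (hXP.1 1 (by decide)).symm.trans hPx1
  have hX3 : X 3 = (h, 0, 0) := (hXP.1 3 (by decide)).symm.trans hPx3
  have child : ∀ Q ∈ C.upper, Q 0 = floorUnit ψ → Q 1 = (0, 0, 0) → (∃ χ', χ' ≠ χ ∧ Q 2 = ceilingUnit h χ') → Q 3 = (h, 0, 0) → False :=
    fun Q hQ hQ0 hQ1 ⟨χ', hχ', hQ2⟩ hQ3 => by
      have hQ' := hGu (Equiv.swap 0 1) Q hQ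
      refine fork_core hU hX hXl hXd hX3 hPx hQ' hχ' hXP.1 hPx2 (fun g hg => ?_) ?_
      · show Q (Equiv.swap (0 : Fin 4) 1 g) = X g
        fin_cases g
        · simpa using hQ1.trans hX0.symm
        · simpa using hQ0.trans hX1.symm
        · exact absurd rfl hg
        · simpa [Equiv.swap_apply_of_ne_of_ne] using hQ3.trans hX3.symm
      · show Q (Equiv.swap (0 : Fin 4) 1 2) = ceilingUnit h χ'
        simpa [Equiv.swap_apply_of_ne_of_ne] using hQ2
  have d1 : ∀ Q : MCell, ∀ f, Q.delta f = deltaPt (Q f) := fun Q f => rfl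
  rcases deltaPt_align 0 1 ψ φ with e | e | e | e
  · exact hφψ (floorUnit_inj e).symm
  · refine child Py.delta (hΔu Py hPy) ?_ ?_ ⟨χ + 3, fin4_add3_ne χ, ?_⟩ ?_
    · rw [d1, hPy0]; exact e.symm
    · rw [d1, hPy1, deltaPt_apex]
    · rw [d1, hPy2, deltaPt_ceilingUnit]
    · rw [d1, hPy3, deltaPt_apex]
  · refine child Py.delta.delta (hΔu _ (hΔu Py hPy)) ?_ ?_ ⟨χ + 3 + 3, fin4_add33_ne χ, ?_⟩ ?_
    · rw [d1, d1, hPy0]; exact e.symm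
    · rw [d1, d1, hPy1, deltaPt_apex, deltaPt_apex]
    · rw [d1, d1, hPy2, deltaPt_ceilingUnit, deltaPt_ceilingUnit]
    · rw [d1, d1, hPy3, deltaPt_apex, deltaPt_apex]
  · refine child Py.delta.delta.delta (hΔu _ (hΔu _ (hΔu Py hPy))) ?_ ?_ ⟨χ + 3 + 3 + 3, fin4_add333_ne χ, ?_⟩ ?_
    · rw [d1, d1, d1, hPy0]; exact e.symm
    · rw [d1, d1, d1, hPy1, deltaPt_apex, deltaPt_apex, deltaPt_apex]
    · rw [d1, d1, d1, hPy2, deltaPt_ceilingUnit, deltaPt_ceilingUnit, deltaPt_ceilingUnit]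
    · rw [d1, d1, d1, hPy3, deltaPt_apex, deltaPt_apex, deltaPt_apex]

/-- [g19 `CeilingUnitApex.apexCeilingUnit_absent_of_secondChild`] THE SECOND-CHILD THEOREM. -/
theorem apexCeilingUnit_absent_of_secondChild {h : ℤ} {C : MConfig} (hU : C.InDiamond h) (hDP : ∀ P ∈ C.upper, RuleDMu4P C P)
    (hX : XPlusClosed C) {Z Z' : MCell} {d f : Fin 4} (hfd : f ≠ d) {χ χ' : Fin 4} (hχ : χ' ≠ χ)
    (hd : Z d = ceilingUnit h χ) (hf : Z f = (h, 0, 0)) (hZ' : Z ∈ C.upper → Z' ∈ C.upper) (hagree : ∀ j, j ≠ d → Z' j = Z j)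
    (hd' : Z' d = ceilingUnit h χ') : Z ∉ C.upper := fun hZ => by
  obtain ⟨X, hXl, hXZ, hXd⟩ := lift_of_ceilingUnit hU hZ (hDP Z hZ) hfd (by rw [hf]; exact onCeiling_apex h) hd
  have hXf : X f = (h, 0, 0) := (hXZ.1 f hfd).symm.trans hf
  have u2 : UPartner X Z' d (χ' + 2) := by
    refine ⟨fun j hj => ?_, ?_, ?_⟩
    · rw [hagree j hj]; exact hXZ.1 j hj
    · rw [hd', ceilingUnit_fst, hXd]; omega
    · rw [hd', hXd, ceilingUnit_fst, show h - (h - 1) = 1 by ring]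
      exact ceilingApex_eq_ray_ceilingUnit h χ'
  have hr : χ' + 2 ≠ χ + 2 := fun e => hχ (add_right_cancel e)
  have hd₁ : (Z d).1 = h - 1 := by rw [hd, ceilingUnit_fst]
  have hd₂ : (Z' d).1 = h - 1 := by rw [hd', ceilingUnit_fst]
  exact xplus_unit_fork hU hX hXl hfd hXd hXf hZ (hZ' hZ) hr hXZ u2 hd₁ hd₂

theorem deltaPt_pow4 (y : BPoint) : deltaPt (deltaPt (deltaPt (deltaPt y))) = y := by
  obtain ⟨a, b, c⟩ := y
  simp [deltaPt]

/-- [g19 CUA sub-family A] `P{pure, pure, cu_χ, hI}`-type cells (`Δ`-fixed off `d`) are absent. -/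
theorem apexCeilingUnitFamily_absent {h : ℤ} {C : MConfig} (hU : C.InDiamond h) (hDP : ∀ P ∈ C.upper, RuleDMu4P C P)
    (hX : XPlusClosed C) (hΔu : DeltaClosed C.upper) {Z : MCell} {d f : Fin 4} (hfd : f ≠ d) {χ : Fin 4}
    (hd : Z d = ceilingUnit h χ) (hf : Z f = (h, 0, 0)) (hpure : ∀ j, j ≠ d → deltaPt (Z j) = Z j) : Z ∉ C.upper :=
  have d1 : ∀ j, Z.delta j = deltaPt (Z j) := fun _ => rfl
  apexCeilingUnit_absent_of_secondChild hU hDP hX hfd (fin4_add3_ne χ) hd hf (hΔu Z) (fun j hj => by rw [d1, hpure j hj])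
    (by rw [d1, hd, deltaPt_ceilingUnit])

/-- [g19 CUA sub-family B] `P{x, Δ²x, cu_χ, hI}` (slots 0,1,2,3) is absent. -/
theorem antipodalPair_apexCeilingUnit_absent {h : ℤ} {C : MConfig} (hU : C.InDiamond h) (hDP : ∀ P ∈ C.upper, RuleDMu4P C P)
    (hX : XPlusClosed C) (hGu : PermClosed C.upper) (hΔu : DeltaClosed C.upper) {Z : MCell} {χ : Fin 4}
    (h1 : Z 1 = deltaPt (deltaPt (Z 0))) (h2 : Z 2 = ceilingUnit h χ) (h3 : Z 3 = (h, 0, 0)) : Z ∉ C.upper := by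
  have d1 : ∀ Q : MCell, ∀ j, Q.delta j = deltaPt (Q j) := fun _ _ => rfl
  have e : ∀ j, (Z.delta.delta).perm (Equiv.swap 0 1) j = deltaPt (deltaPt (Z (Equiv.swap (0 : Fin 4) 1 j))) := fun j => by
    rw [MCell.perm_apply, d1, d1]
  refine apexCeilingUnit_absent_of_secondChild hU hDP hX (d := 2) (f := 3) (by decide) (fin4_add33_ne χ) h2 h3
    (Z' := (Z.delta.delta).perm (Equiv.swap 0 1)) (fun hZ => hGu _ _ (hΔu _ (hΔu Z hZ))) (fun j hj => ?_) ?_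
  · rw [e]
    fin_cases j
    · show deltaPt (deltaPt (Z 1)) = Z 0
      rw [h1, deltaPt_pow4]
    · show deltaPt (deltaPt (Z 0)) = Z 1
      rw [h1]
    · exact absurd rfl hj
    · show deltaPt (deltaPt (Z 3)) = Z 3
      rw [h3, deltaPt_apex, deltaPt_apex]
  · rw [e]
    show deltaPt (deltaPt (Z 2)) = ceilingUnit h (χ + 3 + 3)
    rw [h2, deltaPt_ceilingUnit, deltaPt_ceilingUnit]

/-! ## §1 NEW forcing steps: descents next to an arbitrary floor-node letter -/

/-- the unit ceiling letter lies on the ceiling: causal top `h`. -/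
theorem onCeiling_ceilingUnit (h : ℤ) (χ : Fin 4) : OnCeiling h (ceilingUnit h χ) := by
  show (ray ((h - 2, 0, 0) : BPoint) χ 1).1 + absCharge (ray ((h - 2, 0, 0) : BPoint) χ 1) = h
  rw [top_ray_apex (h - 2) χ (by decide)]; ring

/-- `Δ` rotates the floor letters: `Δ(c·ℓ_φ) = c·ℓ_{φ+3}`. -/
theorem deltaPt_floorLetter (φ : Fin 4) (c : ℤ) : deltaPt (floorLetter φ c) = floorLetter (φ + 3) c := by
  fin_cases φ <;> simp [ray, deltaPt]

theorem fin4_add33 (φ : Fin 4) : φ + 3 + 3 = φ + 2 := by fin_cases φ <;> decide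

/-- **DESCENT NEXT TO A FLOOR NODE** (KERNEL, every `h`; RULE D at the `N`-cell): an `N`-cell `Z` with a floor-node letter `Z b = c₀·ℓ_φ` (`c₀ ≥ 0`; `c₀ = 0` is … (memo §1) -/
theorem descent_of_floorNode_floorUnit {h c₀ : ℤ} {C : MConfig} (hU : C.InDiamond h) {Z : MCell} (hD : RuleDMu4N C Z)
    {b c : Fin 4} (hbc : b ≠ c) {φ ψ : Fin 4} (hc₀ : 0 ≤ c₀) (hb : Z b = floorLetter φ c₀) (hc : Z c = floorUnit ψ) :
    ∃ P ∈ C.upper, MAgree P Z c ∧ P c = (0, 0, 0) := by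
  have hk : Adapted (Z b) (φ + 2) := by rw [hb]; exact (floorLetter_node φ c₀).1
  have hk0 : coord (Z b) (φ + 2) = 0 := by rw [hb]; exact (floorLetter_node φ c₀).2
  have hk' : Adapted (Z c) ψ := by rw [hc]; exact (floorUnit_top ψ).1
  have hk'2 : coord (Z c) ψ = 2 := by rw [hc]; exact (floorUnit_top ψ).2
  have hne : coord (Z b) (φ + 2) ≠ coord (Z c) ψ := by rw [hk0, hk'2]; decide
  -- below the floor-node letter only its own ray
  have nob : ∀ P ∈ C.upper, ∀ r : Fin 4, (P b).1 < (Z b).1 → Z b = ray (P b) r ((Z b).1 - (P b).1) → r = φ :=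
    fun P hP r hlt hray => by
      have e : floorLetter φ c₀ = ray (P b) r ((Z b).1 - (P b).1) := by rw [← hb]; exact hray
      exact below_floorLetter (hU.2 P hP b) hc₀ (by omega) e
  rcases hD b c hbc (φ + 2) ψ hk hk' hne with ⟨r, hr, P, hP, hZP⟩ | ⟨r, hr, P, hP, hZP⟩ | ⟨a, a', ha, -, P, hP, -, hb1, hb2, -, -⟩
  · -- `(b, φ+2)` settled below in a direction `r ≠ φ` — impossible
    exact absurd ((nob P hP r hZP.2.1 hZP.2.2).trans (fin4_add_two_add_two φ).symm) hr
  · -- `(c, ψ)` settled below: the server is `Z(c ↦ O)`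
    have hd : 0 < (Z c).1 - (P c).1 := by have := hZP.2.1; omega
    have e : floorUnit ψ = ray (P c) r ((Z c).1 - (P c).1) := by rw [← hc]; exact hZP.2.2
    exact ⟨P, hP, hZP.1, (below_floorUnit (hU.2 P hP c) hd e).2⟩
  · -- covered below: the cover moves the floor-node letter down in a direction `a` with `DirOK (Z b) (φ+2) a`, i.e. `a ≠ φ` — impossible
    have hφ := nob P hP a hb1 hb2
    rcases ha with e | ⟨-, hne2⟩
    · exact absurd (e.symm.trans hφ) (fin4_ne_add_two φ).symm
    · exact (hne2 (hφ.trans (fin4_add_two_add_two φ).symm)).elim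

/-- **BELOW `2I + n·ℓ_u` OFF ITS OWN RAY THERE IS ONLY `(n+1)·ℓ_u`, ONE STEP DOWN THE NODE DIRECTION** (every `h`, `n ≥ 1`): a point `z` of ◇_h with `2I + n ℓ_u = …` (memo §1) -/
theorem below_nodeTwo_offRay {h n d : ℤ} {z : BPoint} {u r : Fin 4} (hn : 1 ≤ n) (hz : InDiamond h z) (hd : 0 < d) (hr : r ≠ u)
    (he : nodeTwoLetter u n = ray z r d) : r = u + 2 ∧ d = 1 ∧ z = floorLetter u (n + 1) := by
  obtain ⟨α, a, b⟩ := z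
  obtain ⟨hax, h1, -, -⟩ := hz
  simp only [AxisPt, absCharge, chargeOf, ray, Prod.mk.injEq] at hax h1 he ⊢
  fin_cases u <;> fin_cases r <;> simp at hax h1 he hr ⊢ <;>
    (simp only [abs_eq_max_neg, max_def] at h1; split_ifs at h1 <;> omega)

/-- **DESCENT OF `2I + n·ℓ_u` NEXT TO A FLOOR NODE** (KERNEL, every `h`; RULE D at the `N`-cell): an `N`-cell `N` with a floor-node letter `N b = c₀·ℓ_φ` (`c₀ ≥ …` (memo §1) -/
theorem descent_of_floorNode_nodeTwo {h c₀ n : ℤ} {C : MConfig} (hU : C.InDiamond h) (hc₀ : 0 ≤ c₀) (hn : 1 ≤ n) {N : MCell}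
    (hD : RuleDMu4N C N) {b c : Fin 4} (hbc : b ≠ c) {φ u : Fin 4} (hb : N b = floorLetter φ c₀) (hc : N c = nodeTwoLetter u n) :
    ∃ P' ∈ C.upper, UPartner N P' c (u + 2) ∧ P' c = floorLetter u (n + 1) := by
  have hk : Adapted (N b) (φ + 2) := by rw [hb]; exact (floorLetter_node φ c₀).1
  have hk0 : coord (N b) (φ + 2) = 0 := by rw [hb]; exact (floorLetter_node φ c₀).2
  have hk' : Adapted (N c) (u + 2) := by rw [hc]; exact (nodeTwoLetter_node u n).1
  have hk'2 : coord (N c) (u + 2) = 2 := by rw [hc]; exact (nodeTwoLetter_node u n).2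
  have hne : coord (N b) (φ + 2) ≠ coord (N c) (u + 2) := by rw [hk0, hk'2]; decide
  have nob : ∀ P ∈ C.upper, ∀ r : Fin 4, (P b).1 < (N b).1 → N b = ray (P b) r ((N b).1 - (P b).1) → r = φ :=
    fun P hP r hlt hray => by
      have e : floorLetter φ c₀ = ray (P b) r ((N b).1 - (P b).1) := by rw [← hb]; exact hray
      exact below_floorLetter (hU.2 P hP b) hc₀ (by omega) e
  rcases hD b c hbc (φ + 2) (u + 2) hk hk' hne with ⟨r, hr, P, hP, hZP⟩ | ⟨r, hr, P, hP, hZP⟩ | ⟨a, a', ha, -, P, hP, -, hb1, hb2, -, -⟩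
  · exact absurd ((nob P hP r hZP.2.1 hZP.2.2).trans (fin4_add_two_add_two φ).symm) hr
  · have hd : 0 < (N c).1 - (P c).1 := by have := hZP.2.1; omega
    have e : nodeTwoLetter u n = ray (P c) r ((N c).1 - (P c).1) := by rw [← hc]; exact hZP.2.2
    have hr' : r ≠ u := fun e' => hr (by rw [e', fin4_add_two_add_two])
    obtain ⟨hr2, -, hz⟩ := below_nodeTwo_offRay hn (hU.2 P hP c) hd hr' e
    subst hr2
    exact ⟨P, hP, hZP, hz⟩
  · have hφ := nob P hP a hb1 hb2
    rcases ha with e | ⟨-, hne2⟩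
    · exact absurd (e.symm.trans hφ) (fin4_ne_add_two φ).symm
    · exact (hne2 (hφ.trans (fin4_add_two_add_two φ).symm)).elim

/-! ## §2 THE PAIR FORKS: two DIFFERENT unit ceiling letters `cu_χ, cu_χ'` on slots 2, 3 (second child by the slot swap `(2 3)`) -/

/-- **THE PAIR CORE** (KERNEL, every `h`). Let `P = P{x, y, cu_χ, cu_χ'}` (`χ ≠ χ'`) be present and suppose a DESCENT RULE: every present `N`-cell `N{x, y, z, w}` … (memo §1) -/
theorem ceilingPair_core {h : ℤ} {C : MConfig} (hU : C.InDiamond h) (hDP : ∀ P ∈ C.upper, RuleDMu4P C P) (hX : XPlusClosed C)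
    (hGu : PermClosed C.upper) {P : MCell} (hP : P ∈ C.upper) {χ χ' : Fin 4} (hχ : χ' ≠ χ)
    (h2 : P 2 = ceilingUnit h χ) (h3 : P 3 = ceilingUnit h χ') {x' y' : BPoint}
    (hdesc : ∀ N ∈ C.lower, N 0 = P 0 → N 1 = P 1 →
      (N 2 = ceilingUnit h χ ∧ N 3 = (h, 0, 0)) ∨ (N 2 = (h, 0, 0) ∧ N 3 = ceilingUnit h χ') →
      ∃ P' ∈ C.upper, P' 0 = x' ∧ P' 1 = y' ∧ P' 2 = N 2 ∧ P' 3 = N 3) : False := by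
  -- the two lifts `N₁ = P(3 ↦ hI)`, `N₂ = P(2 ↦ hI)`
  obtain ⟨N₁, hN₁, hN₁P, hN₁3⟩ := lift_of_ceilingUnit hU hP (hDP P hP) (a := 2) (d := 3) (by decide)
    (by rw [h2]; exact onCeiling_ceilingUnit h χ) h3
  obtain ⟨N₂, hN₂, hN₂P, hN₂2⟩ := lift_of_ceilingUnit hU hP (hDP P hP) (a := 3) (d := 2) (by decide)
    (by rw [h3]; exact onCeiling_ceilingUnit h χ') h2
  have e12 : N₁ 2 = ceilingUnit h χ := (hN₁P.1 2 (by decide)).symm.trans h2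
  have e23 : N₂ 3 = ceilingUnit h χ' := (hN₂P.1 3 (by decide)).symm.trans h3
  -- the two descents
  obtain ⟨P₁, hP₁, h10, h11, h12, h13⟩ :=
    hdesc N₁ hN₁ (hN₁P.1 0 (by decide)).symm (hN₁P.1 1 (by decide)).symm (Or.inl ⟨e12, hN₁3⟩)
  obtain ⟨P₂, hP₂, h20, h21, h22, h23⟩ :=
    hdesc N₂ hN₂ (hN₂P.1 0 (by decide)).symm (hN₂P.1 1 (by decide)).symm (Or.inr ⟨hN₂2, e23⟩)
  rw [e12] at h12; rw [hN₁3] at h13; rw [hN₂2] at h22; rw [e23] at h23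
  -- the lift `X = P₁(2 ↦ hI) = N{x', y', hI, hI}`
  obtain ⟨X, hXl, hXP, hX2⟩ := lift_of_ceilingUnit hU hP₁ (hDP P₁ hP₁) (a := 3) (d := 2) (by decide)
    (by rw [h13]; exact onCeiling_apex h) h12
  have hX0 : X 0 = x' := (hXP.1 0 (by decide)).symm.trans h10
  have hX1 : X 1 = y' := (hXP.1 1 (by decide)).symm.trans h11
  have hX3 : X 3 = (h, 0, 0) := (hXP.1 3 (by decide)).symm.trans h13
  -- the second child `(2 3)·P₂`
  have hQ := hGu (Equiv.swap 2 3) P₂ hP₂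
  refine fork_core hU hX hXl hX2 hX3 hP₁ hQ hχ hXP.1 h12 (fun g hg => ?_) ?_
  · show P₂ (Equiv.swap (2 : Fin 4) 3 g) = X g
    fin_cases g
    · simpa [Equiv.swap_apply_of_ne_of_ne] using h20.trans hX0.symm
    · simpa [Equiv.swap_apply_of_ne_of_ne] using h21.trans hX1.symm
    · exact absurd rfl hg
    · simpa using h22.trans hX3.symm
  · show P₂ (Equiv.swap (2 : Fin 4) 3 2) = ceilingUnit h χ'
    simpa using h23

/-- **PAIR FORK A2** `P{ℓ_φ, c₀·ℓ_ψ, cu_χ, cu_χ'}` (`c₀ ≥ 0`, `χ ≠ χ'`; slots 0,1,2,3; `φ = ψ` allowed, `c₀ = 0` = the origin) **IS ABSENT** from every two-level … (memo §1) -/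
theorem pairFork_floorUnit_absent {h c₀ : ℤ} {C : MConfig} (hU : C.InDiamond h) (hDN : ∀ Z ∈ C.lower, RuleDMu4N C Z)
    (hDP : ∀ P ∈ C.upper, RuleDMu4P C P) (hX : XPlusClosed C) (hGu : PermClosed C.upper) (hc₀ : 0 ≤ c₀) {P : MCell}
    {φ ψ χ χ' : Fin 4} (hχ : χ' ≠ χ) (h0 : P 0 = floorUnit φ) (h1 : P 1 = floorLetter ψ c₀) (h2 : P 2 = ceilingUnit h χ)
    (h3 : P 3 = ceilingUnit h χ') : P ∉ C.upper := fun hP =>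
  ceilingPair_core hU hDP hX hGu hP hχ h2 h3 (x' := (0, 0, 0)) (y' := floorLetter ψ c₀) fun N hN hN0 hN1 _ => by
    obtain ⟨P', hP', hagree, hP'0⟩ := descent_of_floorNode_floorUnit hU (hDN N hN) (b := 1) (c := 0) (by decide) hc₀
      (hN1.trans h1) (hN0.trans h0)
    exact ⟨P', hP', hP'0, (hagree 1 (by decide)).trans (hN1.trans h1), hagree 2 (by decide), hagree 3 (by decide)⟩

/-- **PAIR FORK A1** `P{c₀·ℓ_φ, 2I + n·ℓ_u, cu_χ, cu_χ'}` (`c₀ ≥ 0`, `n ≥ 1`, `χ ≠ χ'`; slots 0,1,2,3) **IS ABSENT** (KERNEL, every `h`, law-free, no `Δ`; same … (memo §1) -/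
theorem pairFork_nodeTwo_absent {h c₀ n : ℤ} {C : MConfig} (hU : C.InDiamond h) (hDN : ∀ Z ∈ C.lower, RuleDMu4N C Z)
    (hDP : ∀ P ∈ C.upper, RuleDMu4P C P) (hX : XPlusClosed C) (hGu : PermClosed C.upper) (hc₀ : 0 ≤ c₀) (hn : 1 ≤ n)
    {P : MCell} {φ u χ χ' : Fin 4} (hχ : χ' ≠ χ) (h0 : P 0 = floorLetter φ c₀) (h1 : P 1 = nodeTwoLetter u n)
    (h2 : P 2 = ceilingUnit h χ) (h3 : P 3 = ceilingUnit h χ') : P ∉ C.upper := fun hP =>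
  ceilingPair_core hU hDP hX hGu hP hχ h2 h3 (x' := floorLetter φ c₀) (y' := floorLetter u (n + 1)) fun N hN hN0 hN1 _ => by
    obtain ⟨P', hP', hNP', hP'1⟩ := descent_of_floorNode_nodeTwo hU hc₀ hn (hDN N hN) (b := 0) (c := 1) (by decide)
      (hN0.trans h0) (hN1.trans h1)
    exact ⟨P', hP', (hNP'.1 0 (by decide)).trans (hN0.trans h0), hP'1, hNP'.1 2 (by decide), hNP'.1 3 (by decide)⟩

/-! ## §3 THE LONE-UNIT CHAIN and the equal-phase pairs (second child by `Δ`) -/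

/-- **B1** `N{O, ℓ_φ, cu_χ, hI}` (slots 0,1,2,3) **IS ABSENT** (KERNEL, every `h`; ◇_h, RULE D, X⁺, `Δ` on the `P`-level): the descent `N(1 ↦ O) = P{O, O, cu_χ, …` (memo §1) -/
theorem loneUnit_apex_absent {h : ℤ} {C : MConfig} (hU : C.InDiamond h) (hDN : ∀ Z ∈ C.lower, RuleDMu4N C Z)
    (hDP : ∀ P ∈ C.upper, RuleDMu4P C P) (hX : XPlusClosed C) (hΔu : DeltaClosed C.upper) {N : MCell} {φ χ : Fin 4}
    (h0 : N 0 = (0, 0, 0)) (h1 : N 1 = floorUnit φ) (h2 : N 2 = ceilingUnit h χ) (h3 : N 3 = (h, 0, 0)) : N ∉ C.lower := fun hN => by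
  have h0' : N 0 = floorLetter φ 0 := h0.trans (ray_zero _ φ).symm
  obtain ⟨P₁, hP₁, hagree, hP₁1⟩ := descent_of_floorNode_floorUnit hU (hDN N hN) (b := 0) (c := 1) (by decide) le_rfl h0' h1
  have hP₁0 : P₁ 0 = (0, 0, 0) := (hagree 0 (by decide)).trans h0
  have hP₁2 : P₁ 2 = ceilingUnit h χ := (hagree 2 (by decide)).trans h2
  have hP₁3 : P₁ 3 = (h, 0, 0) := (hagree 3 (by decide)).trans h3
  exact apexCeilingUnitFamily_absent hU hDP hX hΔu (d := 2) (f := 3) (by decide) hP₁2 hP₁3 (fun j hj => by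
    fin_cases j
    · show deltaPt (P₁ 0) = P₁ 0; rw [hP₁0, deltaPt_apex]
    · show deltaPt (P₁ 1) = P₁ 1; rw [hP₁1, deltaPt_apex]
    · exact absurd rfl hj
    · show deltaPt (P₁ 3) = P₁ 3; rw [hP₁3, deltaPt_apex]) hP₁

/-- **B2** `P{O, ℓ_φ, cu_χ, cu_χ'}` (slots 0,1,2,3; ALL `χ, χ'`, equal included) **IS ABSENT** (KERNEL, every `h`; ◇_h, RULE D, X⁺, `Δ` on the `P`-level): the lift … (memo §1) -/
theorem loneUnit_pair_absent {h : ℤ} {C : MConfig} (hU : C.InDiamond h) (hDN : ∀ Z ∈ C.lower, RuleDMu4N C Z)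
    (hDP : ∀ P ∈ C.upper, RuleDMu4P C P) (hX : XPlusClosed C) (hΔu : DeltaClosed C.upper) {P : MCell} {φ χ χ' : Fin 4}
    (h0 : P 0 = (0, 0, 0)) (h1 : P 1 = floorUnit φ) (h2 : P 2 = ceilingUnit h χ) (h3 : P 3 = ceilingUnit h χ') : P ∉ C.upper :=
  fun hP => by
  obtain ⟨N, hN, hNP, hN3⟩ := lift_of_ceilingUnit hU hP (hDP P hP) (a := 2) (d := 3) (by decide)
    (by rw [h2]; exact onCeiling_ceilingUnit h χ) h3
  exact loneUnit_apex_absent hU hDN hDP hX hΔu ((hNP.1 0 (by decide)).symm.trans h0) ((hNP.1 1 (by decide)).symm.trans h1)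
    ((hNP.1 2 (by decide)).symm.trans h2) hN3 hN

/-- **B3** `N{ℓ_φ, ℓ_ψ, cu_χ, cu_χ'}` (slots 0,1,2,3; ALL `φ, ψ, χ, χ'`) **IS ABSENT** (KERNEL, every `h`; same hypotheses): the descent `N(0 ↦ O)` is B2. (memo §1) -/
theorem unitPair_pair_absent {h : ℤ} {C : MConfig} (hU : C.InDiamond h) (hDN : ∀ Z ∈ C.lower, RuleDMu4N C Z)
    (hDP : ∀ P ∈ C.upper, RuleDMu4P C P) (hX : XPlusClosed C) (hΔu : DeltaClosed C.upper) {N : MCell} {φ ψ χ χ' : Fin 4}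
    (h0 : N 0 = floorUnit φ) (h1 : N 1 = floorUnit ψ) (h2 : N 2 = ceilingUnit h χ) (h3 : N 3 = ceilingUnit h χ') : N ∉ C.lower :=
  fun hN => by
  obtain ⟨P, hP, hagree, hP0⟩ := descent_of_floorUnitPair hU (hDN N hN) (b := 1) (c := 0) (by decide) h1 h0
  exact loneUnit_pair_absent hU hDN hDP hX hΔu hP0 ((hagree 1 (by decide)).trans h1) ((hagree 2 (by decide)).trans h2)
    ((hagree 3 (by decide)).trans h3) hP

/-- **A4** `P{ℓ_φ, ℓ_ψ, cu_χ, cu_χ'}` (`φ ≠ ψ`; ALL `χ, χ'`; slots 0,1,2,3) **IS ABSENT** (KERNEL, every `h`; ◇_h, RULE D, X⁺, `S₄` and `Δ` on the `P`-level): the … (memo §1) -/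
theorem floorFork_pair_absent {h : ℤ} {C : MConfig} (hU : C.InDiamond h) (hDN : ∀ Z ∈ C.lower, RuleDMu4N C Z)
    (hDP : ∀ P ∈ C.upper, RuleDMu4P C P) (hX : XPlusClosed C) (hGu : PermClosed C.upper) (hΔu : DeltaClosed C.upper) {P : MCell}
    {φ ψ χ χ' : Fin 4} (hφψ : φ ≠ ψ) (h0 : P 0 = floorUnit φ) (h1 : P 1 = floorUnit ψ) (h2 : P 2 = ceilingUnit h χ)
    (h3 : P 3 = ceilingUnit h χ') : P ∉ C.upper := fun hP => by
  obtain ⟨N, hN, hNP, hN3⟩ := lift_of_ceilingUnit hU hP (hDP P hP) (a := 2) (d := 3) (by decide)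
    (by rw [h2]; exact onCeiling_ceilingUnit h χ) h3
  exact ceilingForkFamily_absent hU hDN hDP hX hGu hΔu hφψ ((hNP.1 0 (by decide)).symm.trans h0)
    ((hNP.1 1 (by decide)).symm.trans h1) ((hNP.1 2 (by decide)).symm.trans h2) hN3 hN

/-- **A5** `P{c·ℓ_φ, 2I + (c−1)·ℓ_{φ+2}, cu_χ, cu_χ'}` (`c ≥ 2`; ALL `χ, χ'`; slots 0,1,2,3) **IS ABSENT** (KERNEL, every `h`; ◇_h, RULE D, X⁺, `S₄` and `Δ` on the … (memo §1) -/
theorem antipodalTower_pair_absent {h c : ℤ} {C : MConfig} (hU : C.InDiamond h) (hDN : ∀ Z ∈ C.lower, RuleDMu4N C Z)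
    (hDP : ∀ P ∈ C.upper, RuleDMu4P C P) (hX : XPlusClosed C) (hGu : PermClosed C.upper) (hΔu : DeltaClosed C.upper) (hc : 2 ≤ c)
    {P : MCell} {φ χ χ' : Fin 4} (h0 : P 0 = floorLetter φ c) (h1 : P 1 = nodeTwoLetter (φ + 2) (c - 1))
    (h2 : P 2 = ceilingUnit h χ) (h3 : P 3 = ceilingUnit h χ') : P ∉ C.upper := fun hP => by
  obtain ⟨N, hN, hNP, hN3⟩ := lift_of_ceilingUnit hU hP (hDP P hP) (a := 2) (d := 3) (by decide)
    (by rw [h2]; exact onCeiling_ceilingUnit h χ) h3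
  have hN0 : N 0 = floorLetter φ c := (hNP.1 0 (by decide)).symm.trans h0
  have hN1 : N 1 = nodeTwoLetter (φ + 2) (c - 1) := (hNP.1 1 (by decide)).symm.trans h1
  have hN2 : N 2 = ceilingUnit h χ := (hNP.1 2 (by decide)).symm.trans h2
  obtain ⟨P', hP', hNP', hP'1⟩ := descent_of_floorNode_nodeTwo hU (by omega) (by omega) (hDN N hN) (b := 0) (c := 1) (by decide)
    hN0 hN1
  rw [show c - 1 + 1 = c by ring] at hP'1
  have hP'0 : P' 0 = floorLetter φ c := (hNP'.1 0 (by decide)).trans hN0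
  have hP'2 : P' 2 = ceilingUnit h χ := (hNP'.1 2 (by decide)).trans hN2
  have hP'3 : P' 3 = (h, 0, 0) := (hNP'.1 3 (by decide)).trans hN3
  refine antipodalPair_apexCeilingUnit_absent hU hDP hX hGu hΔu ?_ hP'2 hP'3 hP'
  rw [hP'1, hP'0, deltaPt_floorLetter, deltaPt_floorLetter, fin4_add33]

/-! ## §4 Packaged over the typed static predicates of record (`MConfig.G1Closed`, `MConfig.StaticH1 = RuleDMu4Closed ∧ XPlusClosed ∧ A2IMinusClosed`) -/

theorem pairFork_floorUnit_absent_static {h c₀ : ℤ} {C : MConfig} (hU : C.InDiamond h) (hG : C.G1Closed) (hS : C.StaticH1)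
    (hc₀ : 0 ≤ c₀) {P : MCell} {φ ψ χ χ' : Fin 4} (hχ : χ' ≠ χ) (h0 : P 0 = floorUnit φ) (h1 : P 1 = floorLetter ψ c₀)
    (h2 : P 2 = ceilingUnit h χ) (h3 : P 3 = ceilingUnit h χ') : P ∉ C.upper :=
  pairFork_floorUnit_absent hU hS.1.1 hS.1.2 hS.2.1 hG.2.1 hc₀ hχ h0 h1 h2 h3

theorem pairFork_nodeTwo_absent_static {h c₀ n : ℤ} {C : MConfig} (hU : C.InDiamond h) (hG : C.G1Closed) (hS : C.StaticH1)
    (hc₀ : 0 ≤ c₀) (hn : 1 ≤ n) {P : MCell} {φ u χ χ' : Fin 4} (hχ : χ' ≠ χ) (h0 : P 0 = floorLetter φ c₀)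
    (h1 : P 1 = nodeTwoLetter u n) (h2 : P 2 = ceilingUnit h χ) (h3 : P 3 = ceilingUnit h χ') : P ∉ C.upper :=
  pairFork_nodeTwo_absent hU hS.1.1 hS.1.2 hS.2.1 hG.2.1 hc₀ hn hχ h0 h1 h2 h3

theorem loneUnit_apex_absent_static {h : ℤ} {C : MConfig} (hU : C.InDiamond h) (hG : C.G1Closed) (hS : C.StaticH1) {N : MCell}
    {φ χ : Fin 4} (h0 : N 0 = (0, 0, 0)) (h1 : N 1 = floorUnit φ) (h2 : N 2 = ceilingUnit h χ) (h3 : N 3 = (h, 0, 0)) :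
    N ∉ C.lower :=
  loneUnit_apex_absent hU hS.1.1 hS.1.2 hS.2.1 hG.2.2.2 h0 h1 h2 h3

theorem loneUnit_pair_absent_static {h : ℤ} {C : MConfig} (hU : C.InDiamond h) (hG : C.G1Closed) (hS : C.StaticH1) {P : MCell}
    {φ χ χ' : Fin 4} (h0 : P 0 = (0, 0, 0)) (h1 : P 1 = floorUnit φ) (h2 : P 2 = ceilingUnit h χ) (h3 : P 3 = ceilingUnit h χ') :
    P ∉ C.upper :=
  loneUnit_pair_absent hU hS.1.1 hS.1.2 hS.2.1 hG.2.2.2 h0 h1 h2 h3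

theorem unitPair_pair_absent_static {h : ℤ} {C : MConfig} (hU : C.InDiamond h) (hG : C.G1Closed) (hS : C.StaticH1) {N : MCell}
    {φ ψ χ χ' : Fin 4} (h0 : N 0 = floorUnit φ) (h1 : N 1 = floorUnit ψ) (h2 : N 2 = ceilingUnit h χ) (h3 : N 3 = ceilingUnit h χ') :
    N ∉ C.lower :=
  unitPair_pair_absent hU hS.1.1 hS.1.2 hS.2.1 hG.2.2.2 h0 h1 h2 h3

theorem floorFork_pair_absent_static {h : ℤ} {C : MConfig} (hU : C.InDiamond h) (hG : C.G1Closed) (hS : C.StaticH1) {P : MCell}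
    {φ ψ χ χ' : Fin 4} (hφψ : φ ≠ ψ) (h0 : P 0 = floorUnit φ) (h1 : P 1 = floorUnit ψ) (h2 : P 2 = ceilingUnit h χ)
    (h3 : P 3 = ceilingUnit h χ') : P ∉ C.upper :=
  floorFork_pair_absent hU hS.1.1 hS.1.2 hS.2.1 hG.2.1 hG.2.2.2 hφψ h0 h1 h2 h3

theorem antipodalTower_pair_absent_static {h c : ℤ} {C : MConfig} (hU : C.InDiamond h) (hG : C.G1Closed) (hS : C.StaticH1)
    (hc : 2 ≤ c) {P : MCell} {φ χ χ' : Fin 4} (h0 : P 0 = floorLetter φ c) (h1 : P 1 = nodeTwoLetter (φ + 2) (c - 1))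
    (h2 : P 2 = ceilingUnit h χ) (h3 : P 3 = ceilingUnit h χ') : P ∉ C.upper :=
  antipodalTower_pair_absent hU hS.1.1 hS.1.2 hS.2.1 hG.2.1 hG.2.2.2 hc h0 h1 h2 h3

/-! ## §5 The ◇₈ census representatives are instances (encoder coordinates `ℓ_1 = (1,1,0)`, `ℓ_i = (1,0,−1)`, `ℓ_{-1} = (1,−1,0)`, `ℓ_{-i} = (1,0,1)`, (memo §1, §3) -/

/-- A2: `P[l-1|2l-1|6I+l-1|6I+li]` (var 14372, 6 propagations). -/
def repA2 : MCell := ![((1, -1, 0) : BPoint), (2, -2, 0), (7, -1, 0), (7, 0, -1)]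
theorem repA2_spec : repA2 0 = floorUnit 2 ∧ repA2 1 = floorLetter 2 2 ∧ repA2 2 = ceilingUnit 8 2 ∧ repA2 3 = ceilingUnit 8 1 := by
  refine ⟨?_, ?_, ?_, ?_⟩ <;> simp [repA2, ray]
theorem repA2_absent {C : MConfig} (hU : C.InDiamond 8) (hG : C.G1Closed) (hS : C.StaticH1) : repA2 ∉ C.upper :=
  pairFork_floorUnit_absent_static hU hG hS (c₀ := 2) (by decide) (χ := 2) (χ' := 1) (by decide) repA2_spec.1 repA2_spec.2.1
    repA2_spec.2.2.1 repA2_spec.2.2.2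

/-- A1: `P[O|2I+l-1|6I+l-1|6I+l-i]` (var 6326, 6 propagations). -/
def repA1 : MCell := ![((0, 0, 0) : BPoint), (3, -1, 0), (7, -1, 0), (7, 0, 1)]
theorem repA1_spec : repA1 0 = floorLetter 0 0 ∧ repA1 1 = nodeTwoLetter 2 1 ∧ repA1 2 = ceilingUnit 8 2 ∧ repA1 3 = ceilingUnit 8 3 := by
  refine ⟨?_, ?_, ?_, ?_⟩ <;> simp [repA1, ray]
theorem repA1_absent {C : MConfig} (hU : C.InDiamond 8) (hG : C.G1Closed) (hS : C.StaticH1) : repA1 ∉ C.upper :=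
  pairFork_nodeTwo_absent_static hU hG hS (c₀ := 0) (n := 1) le_rfl le_rfl (χ := 2) (χ' := 3) (by decide) repA1_spec.1
    repA1_spec.2.1 repA1_spec.2.2.1 repA1_spec.2.2.2

/-- B1: `N[O|l-1|6I+l-1|8I]` (var 2383, 3 propagations). -/
def repB1 : MCell := ![((0, 0, 0) : BPoint), (1, -1, 0), (7, -1, 0), (8, 0, 0)]
theorem repB1_spec : repB1 0 = (0, 0, 0) ∧ repB1 1 = floorUnit 2 ∧ repB1 2 = ceilingUnit 8 2 ∧ repB1 3 = (8, 0, 0) := by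
  refine ⟨?_, ?_, ?_, ?_⟩ <;> simp [repB1, ray]
theorem repB1_absent {C : MConfig} (hU : C.InDiamond 8) (hG : C.G1Closed) (hS : C.StaticH1) : repB1 ∉ C.lower :=
  loneUnit_apex_absent_static hU hG hS repB1_spec.1 repB1_spec.2.1 repB1_spec.2.2.1 repB1_spec.2.2.2

/-- B2 (equal phases): `P[O|l-1|6I+l-1|6I+l-1]` (var 2376, 4 propagations). -/
def repB2 : MCell := ![((0, 0, 0) : BPoint), (1, -1, 0), (7, -1, 0), (7, -1, 0)]
theorem repB2_spec : repB2 0 = (0, 0, 0) ∧ repB2 1 = floorUnit 2 ∧ repB2 2 = ceilingUnit 8 2 ∧ repB2 3 = ceilingUnit 8 2 := by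
  refine ⟨?_, ?_, ?_, ?_⟩ <;> simp [repB2, ray]
theorem repB2_absent {C : MConfig} (hU : C.InDiamond 8) (hG : C.G1Closed) (hS : C.StaticH1) : repB2 ∉ C.upper :=
  loneUnit_pair_absent_static hU hG hS repB2_spec.1 repB2_spec.2.1 repB2_spec.2.2.1 repB2_spec.2.2.2

/-- B3: `N[l-1|l-1|6I+l-1|6I+li]` (var 10161, 8 propagations). -/
def repB3 : MCell := ![((1, -1, 0) : BPoint), (1, -1, 0), (7, -1, 0), (7, 0, -1)]
theorem repB3_spec : repB3 0 = floorUnit 2 ∧ repB3 1 = floorUnit 2 ∧ repB3 2 = ceilingUnit 8 2 ∧ repB3 3 = ceilingUnit 8 1 := by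
  refine ⟨?_, ?_, ?_, ?_⟩ <;> simp [repB3, ray]
theorem repB3_absent {C : MConfig} (hU : C.InDiamond 8) (hG : C.G1Closed) (hS : C.StaticH1) : repB3 ∉ C.lower :=
  unitPair_pair_absent_static hU hG hS repB3_spec.1 repB3_spec.2.1 repB3_spec.2.2.1 repB3_spec.2.2.2

/-- A4 (equal phases): `P[l-1|li|6I+l-1|6I+l-1]` (var 11882, 5 propagations). -/
def repA4 : MCell := ![((1, -1, 0) : BPoint), (1, 0, -1), (7, -1, 0), (7, -1, 0)]
theorem repA4_spec : repA4 0 = floorUnit 2 ∧ repA4 1 = floorUnit 1 ∧ repA4 2 = ceilingUnit 8 2 ∧ repA4 3 = ceilingUnit 8 2 := by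
  refine ⟨?_, ?_, ?_, ?_⟩ <;> simp [repA4, ray]
theorem repA4_absent {C : MConfig} (hU : C.InDiamond 8) (hG : C.G1Closed) (hS : C.StaticH1) : repA4 ∉ C.upper :=
  floorFork_pair_absent_static hU hG hS (φ := 2) (ψ := 1) (by decide) repA4_spec.1 repA4_spec.2.1 repA4_spec.2.2.1 repA4_spec.2.2.2

/-- A5 (equal phases): `P[2l-1|2I+l1|6I+l-1|6I+l-1]` (var 48178, 4 propagations): `2ℓ_{-1} = floorLetter 2 2`, `2I + ℓ_1 = nodeTwoLetter (2+2) 1`. -/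
def repA5 : MCell := ![((2, -2, 0) : BPoint), (3, 1, 0), (7, -1, 0), (7, -1, 0)]
theorem repA5_spec : repA5 0 = floorLetter 2 2 ∧ repA5 1 = nodeTwoLetter (2 + 2) (2 - 1) ∧ repA5 2 = ceilingUnit 8 2 ∧
    repA5 3 = ceilingUnit 8 2 := by
  refine ⟨?_, ?_, ?_, ?_⟩ <;> simp [repA5, ray]
theorem repA5_absent {C : MConfig} (hU : C.InDiamond 8) (hG : C.G1Closed) (hS : C.StaticH1) : repA5 ∉ C.upper :=
  antipodalTower_pair_absent_static hU hG hS (c := 2) le_rfl (φ := 2) repA5_spec.1 repA5_spec.2.1 repA5_spec.2.2.1 repA5_spec.2.2.2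


/-! ## §6 Restated verbatim from `CeilingFork.lean` §7 (control g18): THE TWIN FORK — credited, not new -/

theorem nodeTwoLetter_top (u : Fin 4) (n : ℤ) : Adapted (nodeTwoLetter u n) u ∧ coord (nodeTwoLetter u n) u = 2 + 2 * n := by
  refine ⟨(adapted_ray_apex 2 u n).1, ?_⟩
  rw [coord_ray_self, coord_of_isApex ⟨rfl, rfl⟩]

theorem nodeTwoLetter_flip (u : Fin 4) (n : ℤ) : nodeTwoLetter u n = ray ((2 + 2 * n, 0, 0) : BPoint) (u + 2) (-n) :=
  ray_apex_flip 2 n u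

theorem floorLetter_flip (φ : Fin 4) (c : ℤ) : floorLetter φ c = ray ((2 * c, 0, 0) : BPoint) (φ + 2) (-c) := by
  have := ray_apex_flip 0 c φ; simpa using this

/-- [g18] above `2I + m·ℓ_u` along `u` there is one step in ◇_{2m+4}. -/
theorem above_nodeTwoLetter {h m e : ℤ} {z : BPoint} {u : Fin 4} (hh : h = 2 * m + 4) (hm : 0 ≤ m) (he : 0 < e)
    (hz : InDiamond h z) (hze : z = ray (nodeTwoLetter u m) u e) : e = 1 := by
  have htop := hz.2.2.2
  rw [hze, show ray (nodeTwoLetter u m) u e = ray ((2, 0, 0) : BPoint) u (m + e) from (ray_add _ u m e).symm,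
    top_ray_apex 2 u (by omega)] at htop
  omega

/-- [g18] below the ceiling letter `2I + (m+1)ℓ_u` off its own ray there is only the full letter `(m+2)ℓ_u` (in ◇_{2m+4}). -/
theorem below_nodeTwoTop {h m d : ℤ} {z : BPoint} {u r : Fin 4} (hh : h = 2 * m + 4) (hm : 0 ≤ m) (hz : InDiamond h z) (hd : 0 < d)
    (hr : r ≠ u) (he : nodeTwoLetter u (m + 1) = ray z r d) : r = u + 2 ∧ d = 1 ∧ z = floorLetter u (m + 2) := by
  obtain ⟨α, a, b⟩ := z
  obtain ⟨hax, h1, -, h3⟩ := hz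
  simp only [AxisPt, absCharge, chargeOf, ray, Prod.mk.injEq] at hax h1 h3 he ⊢
  fin_cases u <;> fin_cases r <;> simp at hax h1 h3 he hr ⊢ <;>
    (simp only [abs_eq_max_neg, max_def] at h1 h3; split_ifs at h1 h3 <;> omega)

theorem onCeiling_fullLetter {h m : ℤ} (hh : h = 2 * m + 4) (hm : 0 ≤ m) (u : Fin 4) : OnCeiling h (floorLetter u (m + 2)) := by
  show (ray ((0, 0, 0) : BPoint) u (m + 2)).1 + absCharge (ray ((0, 0, 0) : BPoint) u (m + 2)) = h
  rw [top_ray_apex 0 u (by omega)]; omega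

/-- [g18 `twin_lift`] `P{x, 2I + m ℓ_u, hI, …}` (slots 0,1,2) has the `N`-parent `P(1 ↦ 2I + (m+1)ℓ_u)`, as a `u`-partner. -/
theorem twin_lift {h m : ℤ} {C : MConfig} (hU : C.InDiamond h) (hh : h = 2 * m + 4) (hm : 1 ≤ m) {P : MCell} (hP : P ∈ C.upper)
    (hD : RuleDMu4P C P) {u : Fin 4} (h1 : P 1 = nodeTwoLetter u m) (h2 : P 2 = (h, 0, 0)) :
    ∃ N ∈ C.lower, UPartner N P 1 u ∧ N 1 = nodeTwoLetter u (m + 1) := by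
  have hna : ¬ isApex (P 1) := by rw [h1]; exact nodeTwoLetter_not_isApex u (by omega)
  have hk : Adapted (P 1) u := by rw [h1]; exact (nodeTwoLetter_top u m).1
  have hkh : coord (P 1) u ≠ h := by rw [h1, (nodeTwoLetter_top u m).2]; omega
  obtain ⟨N, hN, hNP⟩ := upLine_of_ruleDMu4P hU hP hD (g := 2) (j := 1) (by decide) (by rw [h2]; exact onCeiling_apex h) hna hk hkh
  have he0 : 0 < (N 1).1 - (P 1).1 := by have := hNP.2.1; omega
  have e : N 1 = ray (nodeTwoLetter u m) u ((N 1).1 - (P 1).1) := by rw [← h1]; exact hNP.2.2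
  have he1 := above_nodeTwoLetter hh (by omega) he0 (hU.1 N hN 1) e
  refine ⟨N, hN, hNP, ?_⟩
  rw [e, he1]; exact (ray_add _ u m 1).symm

/-- [g18 `twin_descent`] `N{c·ℓ_φ, 2I + (m+1)ℓ_u, …}` (slots 0,1) has the `P`-child `N(1 ↦ (m+2)ℓ_u)`, as a `(u+2)`-partner. -/
theorem twin_descent {h m c : ℤ} {C : MConfig} (hU : C.InDiamond h) (hh : h = 2 * m + 4) (hm : 0 ≤ m) (hc : 0 ≤ c) {N : MCell}
    (hD : RuleDMu4N C N) {φ u : Fin 4} (h0 : N 0 = floorLetter φ c) (h1 : N 1 = nodeTwoLetter u (m + 1)) :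
    ∃ P' ∈ C.upper, UPartner N P' 1 (u + 2) ∧ P' 1 = floorLetter u (m + 2) := by
  have hk : Adapted (N 0) (φ + 2) := by rw [h0]; exact (floorLetter_node φ c).1
  have hk0 : coord (N 0) (φ + 2) = 0 := by rw [h0]; exact (floorLetter_node φ c).2
  have hk' : Adapted (N 1) (u + 2) := by rw [h1]; exact (nodeTwoLetter_node u (m + 1)).1
  have hk'2 : coord (N 1) (u + 2) = 2 := by rw [h1]; exact (nodeTwoLetter_node u (m + 1)).2
  have hne : coord (N 0) (φ + 2) ≠ coord (N 1) (u + 2) := by rw [hk0, hk'2]; decide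
  have nob : ∀ P ∈ C.upper, ∀ r : Fin 4, (P 0).1 < (N 0).1 → N 0 = ray (P 0) r ((N 0).1 - (P 0).1) → r = φ := fun P hP r hlt hray => by
    have e : floorLetter φ c = ray (P 0) r ((N 0).1 - (P 0).1) := by rw [← h0]; exact hray
    exact below_floorLetter (hU.2 P hP 0) hc (by omega) e
  rcases hD 0 1 (by decide) (φ + 2) (u + 2) hk hk' hne with ⟨r, hr, P, hP, hZP⟩ | ⟨r, hr, P, hP, hZP⟩ | ⟨a, a', ha, -, P, hP, -, hb1, hb2, -, -⟩
  · exact absurd ((nob P hP r hZP.2.1 hZP.2.2).trans (fin4_add_two_add_two φ).symm) hr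
  · have hd : 0 < (N 1).1 - (P 1).1 := by have := hZP.2.1; omega
    have e : nodeTwoLetter u (m + 1) = ray (P 1) r ((N 1).1 - (P 1).1) := by rw [← h1]; exact hZP.2.2
    have hr' : r ≠ u := fun e' => hr (by rw [e', fin4_add_two_add_two])
    obtain ⟨hr2, -, hz⟩ := below_nodeTwoTop hh hm (hU.2 P hP 1) hd hr' e
    subst hr2
    exact ⟨P, hP, hZP, hz⟩
  · have hφ := nob P hP a hb1 hb2
    rcases ha with e | ⟨-, hne2⟩
    · exact absurd (e.symm.trans hφ) (fin4_ne_add_two φ).symm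
    · exact (hne2 (hφ.trans (fin4_add_two_add_two φ).symm)).elim

/-- [g18 `twinForkFamily_absent`] THE TWIN FORK `P{c·ℓ_φ, 2I + m·ℓ_u, hI, w}` (slots 0,1,2; slot 3 arbitrary; `c ≥ 0`, `h = 2m+4`, `m ≥ 1`) is absent from every … (memo §1) -/
theorem twinForkFamily_absent {h m c : ℤ} {C : MConfig} (hU : C.InDiamond h) (hDN : ∀ Z ∈ C.lower, RuleDMu4N C Z)
    (hDP : ∀ P ∈ C.upper, RuleDMu4P C P) (hX : XPlusClosed C) (hh : h = 2 * m + 4) (hm : 1 ≤ m) (hc : 0 ≤ c)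
    {P : MCell} {φ u : Fin 4} (h0 : P 0 = floorLetter φ c) (h1 : P 1 = nodeTwoLetter u m) (h2 : P 2 = (h, 0, 0)) :
    P ∉ C.upper := fun hP => by
  obtain ⟨N, hN, hNP, hN1⟩ := twin_lift hU hh hm hP (hDP P hP) h1 h2
  have hN0 : N 0 = floorLetter φ c := (hNP.1 0 (by decide)).symm.trans h0
  have hN2 : N 2 = (h, 0, 0) := (hNP.1 2 (by decide)).symm.trans h2
  obtain ⟨P', hP', hNP', hP'1⟩ := twin_descent hU hh (by omega) hc (hDN N hN) hN0 hN1
  have hz : N 1 = ray ((h, 0, 0) : BPoint) (u + 2) (-(m + 1)) := by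
    rw [hN1, nodeTwoLetter_flip]; congr 2; omega
  have hw : P' 1 = ray ((h, 0, 0) : BPoint) (u + 2) (-(m + 2)) := by
    rw [hP'1, floorLetter_flip]; congr 2; omega
  have hy : P 1 = ray (N 1) (u + 2 + 2) (-1) := by
    rw [fin4_add_two_add_two, hN1, h1, ← ray_add]; congr 1; omega
  refine xplus_fork hU hX hN (g := 1) (f := 2) (by decide) hN2 hP hP' (r₁ := u) (r₂ := u + 2) (fin4_ne_add_two u).symm hNP hNP'
    (by rw [h1]; exact nodeTwoLetter_not_isApex u (by omega)) ?_ ?_ ?_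
  · intro X hX' hXP
    have he0 : 0 < (X 1).1 - (P 1).1 := by have := hXP.2.1; omega
    have e : X 1 = ray (nodeTwoLetter u m) u ((X 1).1 - (P 1).1) := by rw [← h1]; exact hXP.2.2
    have := above_nodeTwoLetter hh (by omega) he0 (hU.1 X hX' 1) e
    have hP1 : (P 1).1 = 2 + m := by rw [h1, nodeTwoLetter_fst]
    have hN1' : (N 1).1 = 2 + (m + 1) := by rw [hN1, nodeTwoLetter_fst]
    omega
  · intro X _ _ hlt1 hlt2
    exfalso
    have hN1' : (N 1).1 = 2 + (m + 1) := by rw [hN1, nodeTwoLetter_fst]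
    have hP'1' : (P' 1).1 = m + 2 := by rw [hP'1, floorLetter_fst]
    omega
  · intro X hX' _ _ hE hnT
    have hXc : OnCeiling h (X 1) :=
      onCeiling_of_effective_above (by rw [hP'1]; exact onCeiling_fullLetter hh (by omega) u) (hU.2 P' hP' 1).1 (hU.1 X hX' 1) hE
    obtain ⟨d₂, -, -, hx⟩ := ceiling_effective_sameRay (by omega : (0 : ℤ) < m + 2) hw hXc (hU.1 X hX' 1).1 hE
    exact fork_effective one_pos hz hy hx hnT

/-! ## §7 NEW: THE TWIN-BASED FAMILIES — a unit ceiling letter or a floor tower over the twin fork (law-free, every `h = 2m+4`, `m ≥ 1`) -/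

/-- the top direction `φ` of the floor letter `c·ℓ_φ` carries the coordinate `2c`. -/
theorem floorLetter_top (φ : Fin 4) (c : ℤ) : Adapted (floorLetter φ c) φ ∧ coord (floorLetter φ c) φ = 2 * c := by
  refine ⟨(adapted_ray_apex 0 φ c).1, ?_⟩
  rw [coord_ray_self, coord_of_isApex ⟨rfl, rfl⟩]; show (0 : ℤ) + 2 * c = 2 * c; ring

/-- `2I + (m+1)ℓ_ψ` lies on the ceiling of ◇_{2m+4}. -/
theorem onCeiling_nodeTwoTop {h m : ℤ} (hh : h = 2 * m + 4) (hm : 0 ≤ m) (ψ : Fin 4) : OnCeiling h (nodeTwoLetter ψ (m + 1)) := by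
  show (ray ((2, 0, 0) : BPoint) ψ (m + 1)).1 + absCharge (ray ((2, 0, 0) : BPoint) ψ (m + 1)) = h
  rw [top_ray_apex 2 ψ (by omega)]; omega

/-- **THE TOWER SERVER** (KERNEL, every `h`; RULE D at the `N`-cell): an `N`-cell with a floor TOWER `N t = c·ℓ_φ`, `c ≥ 1`, and a floor-node letter `N s = c'·ℓ_ψ` … (memo §1) -/
theorem towerServer {h c c' : ℤ} {C : MConfig} (hU : C.InDiamond h) {N : MCell} (hD : RuleDMu4N C N) {t s : Fin 4} (hts : t ≠ s)
    {φ ψ : Fin 4} (hc : 1 ≤ c) (hc' : 0 ≤ c') (ht : N t = floorLetter φ c) (hs : N s = floorLetter ψ c') :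
    ∃ P ∈ C.upper, MAgree P N t ∧ ∃ d, 0 < d ∧ 0 ≤ c - d ∧ P t = floorLetter φ (c - d) := by
  have hk : Adapted (N s) (ψ + 2) := by rw [hs]; exact (floorLetter_node ψ c').1
  have hk0 : coord (N s) (ψ + 2) = 0 := by rw [hs]; exact (floorLetter_node ψ c').2
  have hk' : Adapted (N t) φ := by rw [ht]; exact (floorLetter_top φ c).1
  have hk'2 : coord (N t) φ = 2 * c := by rw [ht]; exact (floorLetter_top φ c).2
  have hne : coord (N s) (ψ + 2) ≠ coord (N t) φ := by rw [hk0, hk'2]; omega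
  have nob : ∀ P ∈ C.upper, ∀ r : Fin 4, (P s).1 < (N s).1 → N s = ray (P s) r ((N s).1 - (P s).1) → r = ψ :=
    fun P hP r hlt hray => by
      have e : floorLetter ψ c' = ray (P s) r ((N s).1 - (P s).1) := by rw [← hs]; exact hray
      exact below_floorLetter (hU.2 P hP s) hc' (by omega) e
  rcases hD s t hts.symm (ψ + 2) φ hk hk' hne with ⟨r, hr, P, hP, hZP⟩ | ⟨r, -, P, hP, hZP⟩ | ⟨a, a', ha, -, P, hP, -, hb1, hb2, -, -⟩
  · exact absurd ((nob P hP r hZP.2.1 hZP.2.2).trans (fin4_add_two_add_two ψ).symm) hr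
  · -- the tower is settled below: along its own ray, by `(c−d)ℓ_φ`
    have hd : 0 < (N t).1 - (P t).1 := by have := hZP.2.1; omega
    have e : floorLetter φ c = ray (P t) r ((N t).1 - (P t).1) := by rw [← ht]; exact hZP.2.2
    have hr := below_floorLetter (hU.2 P hP t) (by omega) hd e
    rw [hr] at e
    have hNt : (N t).1 = c := by rw [ht, floorLetter_fst]
    have h0 : 0 ≤ (P t).1 := (inDiamond_bounds (hU.2 P hP t)).1
    have hPt : P t = floorLetter φ (c - ((N t).1 - (P t).1)) := by
      have h' := (eq_ray_neg e).trans (ray_add _ φ c _).symm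
      rwa [← sub_eq_add_neg] at h'
    exact ⟨P, hP, hZP.1, (N t).1 - (P t).1, hd, by omega, hPt⟩
  · have hψ := nob P hP a hb1 hb2
    rcases ha with e | ⟨-, hne2⟩
    · exact absurd (e.symm.trans hψ) (fin4_ne_add_two ψ).symm
    · exact (hne2 (hψ.trans (fin4_add_two_add_two ψ).symm)).elim

/-- **TN0 — A FLOOR TOWER OVER THE TWIN FORK** `N{c·ℓ_φ, 2I + m·ℓ_u, hI, c'·ℓ_ψ}` (slots 0,1,2,3; `c, c' ≥ 0`, not both `0`; `h = 2m+4`, `m ≥ 1`) **IS ABSENT** … (memo §1) -/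
theorem twinTower_N_absent {h m c c' : ℤ} {C : MConfig} (hU : C.InDiamond h) (hDN : ∀ Z ∈ C.lower, RuleDMu4N C Z)
    (hDP : ∀ P ∈ C.upper, RuleDMu4P C P) (hX : XPlusClosed C) (hh : h = 2 * m + 4) (hm : 1 ≤ m) (hc : 0 ≤ c) (hc' : 0 ≤ c')
    (hcc : 1 ≤ c ∨ 1 ≤ c') {N : MCell} {φ u ψ : Fin 4} (h0 : N 0 = floorLetter φ c) (h1 : N 1 = nodeTwoLetter u m)
    (h2 : N 2 = (h, 0, 0)) (h3 : N 3 = floorLetter ψ c') : N ∉ C.lower := fun hN => by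
  rcases hcc with hc1 | hc1
  · obtain ⟨P, hP, hagree, d, -, hcd, hPt⟩ := towerServer hU (hDN N hN) (t := 0) (s := 3) (by decide) hc1 hc' h0 h3
    exact twinForkFamily_absent hU hDN hDP hX hh hm hcd hPt ((hagree 1 (by decide)).trans h1) ((hagree 2 (by decide)).trans h2) hP
  · obtain ⟨P, hP, hagree, d, -, -, -⟩ := towerServer hU (hDN N hN) (t := 3) (s := 0) (by decide) hc1 hc h3 h0
    exact twinForkFamily_absent hU hDN hDP hX hh hm hc ((hagree 0 (by decide)).trans h0) ((hagree 1 (by decide)).trans h1)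
      ((hagree 2 (by decide)).trans h2) hP

/-- **TP1 — A UNIT CEILING LETTER OVER THE TWIN FORK, lifted through a FULL FLOOR LETTER** `P{c·ℓ_φ, 2I + m·ℓ_u, cu_χ, (m+2)·ℓ_ψ}` (slots 0,1,2,3; `c ≥ 0`) **IS … (memo §1) -/
theorem twinTower_full_absent {h m c : ℤ} {C : MConfig} (hU : C.InDiamond h) (hDN : ∀ Z ∈ C.lower, RuleDMu4N C Z)
    (hDP : ∀ P ∈ C.upper, RuleDMu4P C P) (hX : XPlusClosed C) (hh : h = 2 * m + 4) (hm : 1 ≤ m) (hc : 0 ≤ c) {P : MCell}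
    {φ u χ ψ : Fin 4} (h0 : P 0 = floorLetter φ c) (h1 : P 1 = nodeTwoLetter u m) (h2 : P 2 = ceilingUnit h χ)
    (h3 : P 3 = floorLetter ψ (m + 2)) : P ∉ C.upper := fun hP => by
  obtain ⟨N, hN, hNP, hN2⟩ := lift_of_ceilingUnit hU hP (hDP P hP) (a := 3) (d := 2) (by decide)
    (by rw [h3]; exact onCeiling_fullLetter hh (by omega) ψ) h2
  exact twinTower_N_absent hU hDN hDP hX hh hm hc (by omega : (0 : ℤ) ≤ m + 2) (Or.inr (by omega))
    ((hNP.1 0 (by decide)).symm.trans h0) ((hNP.1 1 (by decide)).symm.trans h1) hN2 ((hNP.1 3 (by decide)).symm.trans h3) hN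

/-- **TP2 — A UNIT CEILING LETTER OVER THE TWIN FORK, lifted through `2I + (m+1)ℓ_ψ`** `P{c·ℓ_φ, 2I + m·ℓ_u, cu_χ, 2I + (m+1)·ℓ_ψ}` (slots 0,1,2,3; `c ≥ 0`) **IS … (memo §1) -/
theorem twinTower_nodeTwo_absent {h m c : ℤ} {C : MConfig} (hU : C.InDiamond h) (hDN : ∀ Z ∈ C.lower, RuleDMu4N C Z)
    (hDP : ∀ P ∈ C.upper, RuleDMu4P C P) (hX : XPlusClosed C) (hh : h = 2 * m + 4) (hm : 1 ≤ m) (hc : 0 ≤ c) {P : MCell}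
    {φ u χ ψ : Fin 4} (h0 : P 0 = floorLetter φ c) (h1 : P 1 = nodeTwoLetter u m) (h2 : P 2 = ceilingUnit h χ)
    (h3 : P 3 = nodeTwoLetter ψ (m + 1)) : P ∉ C.upper := fun hP => by
  obtain ⟨N, hN, hNP, hN2⟩ := lift_of_ceilingUnit hU hP (hDP P hP) (a := 3) (d := 2) (by decide)
    (by rw [h3]; exact onCeiling_nodeTwoTop hh (by omega) ψ) h2
  have hN0 : N 0 = floorLetter φ c := (hNP.1 0 (by decide)).symm.trans h0
  have hN1 : N 1 = nodeTwoLetter u m := (hNP.1 1 (by decide)).symm.trans h1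
  have hN3 : N 3 = nodeTwoLetter ψ (m + 1) := (hNP.1 3 (by decide)).symm.trans h3
  obtain ⟨P', hP', hNP', -⟩ := descent_of_floorNode_nodeTwo hU hc (by omega) (hDN N hN) (b := 0) (c := 3) (by decide) hN0 hN3
  exact twinForkFamily_absent hU hDN hDP hX hh hm hc ((hNP'.1 0 (by decide)).trans hN0) ((hNP'.1 1 (by decide)).trans hN1)
    ((hNP'.1 2 (by decide)).trans hN2) hP'

/-- **TN1** `N{c·ℓ_φ, 2I + m·ℓ_u, cu_χ, 2I + (m+1)·ℓ_ψ}` (slots 0,1,2,3; `c ≥ 0`) **IS ABSENT** (KERNEL; no symmetry): the §1 descent of `2I + (m+1)ℓ_ψ` is TP1. (memo §1) -/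
theorem twinPair_N_absent {h m c : ℤ} {C : MConfig} (hU : C.InDiamond h) (hDN : ∀ Z ∈ C.lower, RuleDMu4N C Z)
    (hDP : ∀ P ∈ C.upper, RuleDMu4P C P) (hX : XPlusClosed C) (hh : h = 2 * m + 4) (hm : 1 ≤ m) (hc : 0 ≤ c) {N : MCell}
    {φ u χ ψ : Fin 4} (h0 : N 0 = floorLetter φ c) (h1 : N 1 = nodeTwoLetter u m) (h2 : N 2 = ceilingUnit h χ)
    (h3 : N 3 = nodeTwoLetter ψ (m + 1)) : N ∉ C.lower := fun hN => by
  obtain ⟨P, hP, hNP, hP3⟩ := descent_of_floorNode_nodeTwo hU hc (by omega) (hDN N hN) (b := 0) (c := 3) (by decide) h0 h3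
  rw [show m + 1 + 1 = m + 2 by ring] at hP3
  exact twinTower_full_absent hU hDN hDP hX hh hm hc ((hNP.1 0 (by decide)).trans h0) ((hNP.1 1 (by decide)).trans h1)
    ((hNP.1 2 (by decide)).trans h2) hP3 hP

/-- **TN2** `N{ℓ_φ, 2I + n·ℓ_u, cu_χ, cu_χ'}` (slots 0,1,2,3; `n ≥ 1`, `χ ≠ χ'`) **IS ABSENT** (KERNEL, every `h`; ◇_h, RULE D, X⁺, `S₄` on the `P`-level): the §1 … (memo §1) -/
theorem unitNodeTwo_pair_N_absent {h n : ℤ} {C : MConfig} (hU : C.InDiamond h) (hDN : ∀ Z ∈ C.lower, RuleDMu4N C Z)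
    (hDP : ∀ P ∈ C.upper, RuleDMu4P C P) (hX : XPlusClosed C) (hGu : PermClosed C.upper) (hn : 1 ≤ n) {N : MCell}
    {φ u χ χ' : Fin 4} (hχ : χ' ≠ χ) (h0 : N 0 = floorUnit φ) (h1 : N 1 = nodeTwoLetter u n) (h2 : N 2 = ceilingUnit h χ)
    (h3 : N 3 = ceilingUnit h χ') : N ∉ C.lower := fun hN => by
  have h0' : N 0 = floorLetter φ 1 := h0
  obtain ⟨P, hP, hNP, hP1⟩ := descent_of_floorNode_nodeTwo hU zero_le_one hn (hDN N hN) (b := 0) (c := 1) (by decide) h0' h1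
  exact pairFork_floorUnit_absent hU hDN hDP hX hGu (by omega : (0 : ℤ) ≤ n + 1) hχ ((hNP.1 0 (by decide)).trans h0) hP1
    ((hNP.1 2 (by decide)).trans h2) ((hNP.1 3 (by decide)).trans h3) hP

/-! ## §8 Packaged (twin-based) and the ◇₈ census representatives, round 1 AND round 2 -/

theorem twinTower_N_absent_static {h m c c' : ℤ} {C : MConfig} (hU : C.InDiamond h) (hS : C.StaticH1) (hh : h = 2 * m + 4)
    (hm : 1 ≤ m) (hc : 0 ≤ c) (hc' : 0 ≤ c') (hcc : 1 ≤ c ∨ 1 ≤ c') {N : MCell} {φ u ψ : Fin 4} (h0 : N 0 = floorLetter φ c)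
    (h1 : N 1 = nodeTwoLetter u m) (h2 : N 2 = (h, 0, 0)) (h3 : N 3 = floorLetter ψ c') : N ∉ C.lower :=
  twinTower_N_absent hU hS.1.1 hS.1.2 hS.2.1 hh hm hc hc' hcc h0 h1 h2 h3

theorem twinTower_full_absent_static {h m c : ℤ} {C : MConfig} (hU : C.InDiamond h) (hS : C.StaticH1) (hh : h = 2 * m + 4) (hm : 1 ≤ m)
    (hc : 0 ≤ c) {P : MCell} {φ u χ ψ : Fin 4} (h0 : P 0 = floorLetter φ c) (h1 : P 1 = nodeTwoLetter u m) (h2 : P 2 = ceilingUnit h χ)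
    (h3 : P 3 = floorLetter ψ (m + 2)) : P ∉ C.upper :=
  twinTower_full_absent hU hS.1.1 hS.1.2 hS.2.1 hh hm hc h0 h1 h2 h3

theorem twinTower_nodeTwo_absent_static {h m c : ℤ} {C : MConfig} (hU : C.InDiamond h) (hS : C.StaticH1) (hh : h = 2 * m + 4) (hm : 1 ≤ m)
    (hc : 0 ≤ c) {P : MCell} {φ u χ ψ : Fin 4} (h0 : P 0 = floorLetter φ c) (h1 : P 1 = nodeTwoLetter u m) (h2 : P 2 = ceilingUnit h χ)
    (h3 : P 3 = nodeTwoLetter ψ (m + 1)) : P ∉ C.upper :=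
  twinTower_nodeTwo_absent hU hS.1.1 hS.1.2 hS.2.1 hh hm hc h0 h1 h2 h3

theorem twinPair_N_absent_static {h m c : ℤ} {C : MConfig} (hU : C.InDiamond h) (hS : C.StaticH1) (hh : h = 2 * m + 4) (hm : 1 ≤ m)
    (hc : 0 ≤ c) {N : MCell} {φ u χ ψ : Fin 4} (h0 : N 0 = floorLetter φ c) (h1 : N 1 = nodeTwoLetter u m) (h2 : N 2 = ceilingUnit h χ)
    (h3 : N 3 = nodeTwoLetter ψ (m + 1)) : N ∉ C.lower :=
  twinPair_N_absent hU hS.1.1 hS.1.2 hS.2.1 hh hm hc h0 h1 h2 h3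

theorem unitNodeTwo_pair_N_absent_static {h n : ℤ} {C : MConfig} (hU : C.InDiamond h) (hG : C.G1Closed) (hS : C.StaticH1) (hn : 1 ≤ n)
    {N : MCell} {φ u χ χ' : Fin 4} (hχ : χ' ≠ χ) (h0 : N 0 = floorUnit φ) (h1 : N 1 = nodeTwoLetter u n) (h2 : N 2 = ceilingUnit h χ)
    (h3 : N 3 = ceilingUnit h χ') : N ∉ C.lower :=
  unitNodeTwo_pair_N_absent hU hS.1.1 hS.1.2 hS.2.1 hG.2.1 hn hχ h0 h1 h2 h3

/-- TN0, round 1: `N[l-1|l-1|2I+2l-1|8I]` (var 9537, `P:Xp`, 7 propagations), slot order `(ℓ, 2I+2ℓ, 8I, ℓ)`. -/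
def repTN0 : MCell := ![((1, -1, 0) : BPoint), (4, -2, 0), (8, 0, 0), (1, -1, 0)]
theorem repTN0_absent {C : MConfig} (hU : C.InDiamond 8) (hS : C.StaticH1) : repTN0 ∉ C.lower :=
  twinTower_N_absent_static (m := 2) (c := 1) (c' := 1) (φ := 2) (u := 2) (ψ := 2) hU hS (by norm_num) (by norm_num) zero_le_one
    zero_le_one (Or.inl le_rfl) (by simp [repTN0, ray]) (by simp [repTN0, ray]) (by simp [repTN0]) (by simp [repTN0, ray])

/-- TN0, ROUND 2 (beyond unit propagation): `N[O|2l-1|2I+2l-1|8I]` (var 3279, peel round 2, kind `B:DN`), slot order `(2ℓ, 2I+2ℓ, 8I, O)`. -/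
def repTN0r2 : MCell := ![((2, -2, 0) : BPoint), (4, -2, 0), (8, 0, 0), (0, 0, 0)]
theorem repTN0r2_absent {C : MConfig} (hU : C.InDiamond 8) (hS : C.StaticH1) : repTN0r2 ∉ C.lower :=
  twinTower_N_absent_static (m := 2) (c := 2) (c' := 0) (φ := 2) (u := 2) (ψ := 0) hU hS (by norm_num) (by norm_num) (by norm_num)
    le_rfl (Or.inl (by norm_num)) (by simp [repTN0r2, ray]) (by simp [repTN0r2, ray]) (by simp [repTN0r2]) (by simp [repTN0r2, ray])

/-- TP1, round 1: `P[l-1|4l-1|2I+2l-1|6I+l-1]` (var 28508, `P:Xp`, 10 propagations), slot order `(ℓ, 2I+2ℓ, 6I+ℓ, 4ℓ)`. -/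
def repTP1 : MCell := ![((1, -1, 0) : BPoint), (4, -2, 0), (7, -1, 0), (4, -4, 0)]
theorem repTP1_absent {C : MConfig} (hU : C.InDiamond 8) (hS : C.StaticH1) : repTP1 ∉ C.upper :=
  twinTower_full_absent_static (m := 2) (c := 1) (φ := 2) (u := 2) (χ := 2) (ψ := 2) hU hS (by norm_num) (by norm_num) zero_le_one
    (by simp [repTP1, ray]) (by simp [repTP1, ray]) (by simp [repTP1, ray]) (by simp [repTP1, ray])

/-- TP1, ROUND 2: `P[2l-1|4l-1|2I+2l-1|6I+l-1]` (var 49116, peel round 2, kind `B:DP`), slot order `(2ℓ, 2I+2ℓ, 6I+ℓ, 4ℓ)`. -/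
def repTP1r2 : MCell := ![((2, -2, 0) : BPoint), (4, -2, 0), (7, -1, 0), (4, -4, 0)]
theorem repTP1r2_absent {C : MConfig} (hU : C.InDiamond 8) (hS : C.StaticH1) : repTP1r2 ∉ C.upper :=
  twinTower_full_absent_static (m := 2) (c := 2) (φ := 2) (u := 2) (χ := 2) (ψ := 2) hU hS (by norm_num) (by norm_num) (by norm_num)
    (by simp [repTP1r2, ray]) (by simp [repTP1r2, ray]) (by simp [repTP1r2, ray]) (by simp [repTP1r2, ray])

/-- TP2: `P[O|2I+2l-1|2I+3l-1|6I+l-1]` (var 7204, `P:Xp`, 9 propagations), slot order `(O, 2I+2ℓ, 6I+ℓ, 2I+3ℓ)`. -/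
def repTP2 : MCell := ![((0, 0, 0) : BPoint), (4, -2, 0), (7, -1, 0), (5, -3, 0)]
theorem repTP2_absent {C : MConfig} (hU : C.InDiamond 8) (hS : C.StaticH1) : repTP2 ∉ C.upper :=
  twinTower_nodeTwo_absent_static (m := 2) (c := 0) (φ := 0) (u := 2) (χ := 2) (ψ := 2) hU hS (by norm_num) (by norm_num) le_rfl
    (by simp [repTP2, ray]) (by simp [repTP2, ray]) (by simp [repTP2, ray]) (by simp [repTP2, ray])

/-- TN1: `N[l-1|2I+2l-1|2I+3l-1|6I+l-1]` (var 29553, `P:Xp`, 16 propagations), slot order `(ℓ, 2I+2ℓ, 6I+ℓ, 2I+3ℓ)`. -/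
def repTN1 : MCell := ![((1, -1, 0) : BPoint), (4, -2, 0), (7, -1, 0), (5, -3, 0)]
theorem repTN1_absent {C : MConfig} (hU : C.InDiamond 8) (hS : C.StaticH1) : repTN1 ∉ C.lower :=
  twinPair_N_absent_static (m := 2) (c := 1) (φ := 2) (u := 2) (χ := 2) (ψ := 2) hU hS (by norm_num) (by norm_num) zero_le_one
    (by simp [repTN1, ray]) (by simp [repTN1, ray]) (by simp [repTN1, ray]) (by simp [repTN1, ray])

/-- TN2: `N[l-1|2I+l-1|6I+l-1|6I+li]` (var 22601, `P:Xp`, 7 propagations). -/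
def repTN2 : MCell := ![((1, -1, 0) : BPoint), (3, -1, 0), (7, -1, 0), (7, 0, -1)]
theorem repTN2_absent {C : MConfig} (hU : C.InDiamond 8) (hG : C.G1Closed) (hS : C.StaticH1) : repTN2 ∉ C.lower :=
  unitNodeTwo_pair_N_absent_static (n := 1) (φ := 2) (u := 2) (χ := 2) (χ' := 1) hU hG hS le_rfl (by decide)
    (by simp [repTN2, ray]) (by simp [repTN2, ray]) (by simp [repTN2, ray]) (by simp [repTN2, ray])


/-! ## §9 NEW: THE GENERAL-LETTER TWIN FAMILIES — ANY letter `x ≠ O` beside `2I + m·ℓ_u`, `hI` and a floor letter (law-free, `h = 2m+4`, `m ≥ 1`) (memo §1, §3) -/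

/-- a letter of ◇_h other than the origin has an adapted frame direction with NON-ZERO coordinate (a floor letter: its top direction; any other
letter: every adapted direction). -/
theorem exists_coord_ne_zero {h : ℤ} {x : BPoint} (hx : InDiamond h x) (hO : x ≠ (0, 0, 0)) :
    ∃ k : Fin 4, Adapted x k ∧ coord x k ≠ 0 := by
  obtain ⟨α, a, b⟩ := x
  have hax := hx.1
  simp only [AxisPt, Prod.mk.injEq] at hax
  have hO' : ¬ (α = 0 ∧ a = 0 ∧ b = 0) := fun ⟨e1, e2, e3⟩ => hO (by rw [e1, e2, e3])
  rcases hax with ⟨ha, hb⟩ | ⟨ha, hb⟩ | ⟨ha, hb⟩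
  · subst ha; subst hb
    refine ⟨0, by simp [Adapted], ?_⟩
    simp only [coord, Matrix.cons_val_zero]; omega
  · subst hb
    by_cases hc : α + a = 0
    · refine ⟨2, by simp [Adapted], ?_⟩
      have e : coord ((α, a, (0 : ℤ)) : BPoint) 2 = α + -a := by simp [coord]
      rw [e]; omega
    · refine ⟨0, by simp [Adapted], ?_⟩
      simp only [coord, Matrix.cons_val_zero]; exact hc
  · subst ha
    by_cases hc : α + b = 0
    · refine ⟨1, by simp [Adapted], ?_⟩
      have e : coord ((α, (0 : ℤ), b) : BPoint) 1 = α + -b := by simp [coord]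
      rw [e]; omega
    · refine ⟨3, by simp [Adapted], ?_⟩
      have e : coord ((α, (0 : ℤ), b) : BPoint) 3 = α + b := by simp [coord]
      rw [e]; exact hc

/-- a ceiling letter of ◇_h, `h > 0`, is not the origin. -/
theorem ne_origin_of_onCeiling {h : ℤ} {x : BPoint} (hh : 0 < h) (hx : OnCeiling h x) : x ≠ (0, 0, 0) := fun e => by
  subst e
  have : (0 : ℤ) + |(0 : ℤ) - 0| = h := hx
  simp at this; omega

/-- the twin fork with the floor letter on SLOT 3 and slot 0 free (from §6 by the slot swap `(0 3)`, `PermClosed C.upper`). -/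
theorem twinFork_slot3_absent {h m c : ℤ} {C : MConfig} (hU : C.InDiamond h) (hDN : ∀ Z ∈ C.lower, RuleDMu4N C Z)
    (hDP : ∀ P ∈ C.upper, RuleDMu4P C P) (hX : XPlusClosed C) (hGu : PermClosed C.upper) (hh : h = 2 * m + 4) (hm : 1 ≤ m)
    (hc : 0 ≤ c) {P : MCell} {u ψ : Fin 4} (h1 : P 1 = nodeTwoLetter u m) (h2 : P 2 = (h, 0, 0)) (h3 : P 3 = floorLetter ψ c) :
    P ∉ C.upper := fun hP =>
  twinForkFamily_absent hU hDN hDP hX hh hm hc (P := P.perm (Equiv.swap 0 3)) (φ := ψ) (u := u)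
    (by show P (Equiv.swap (0 : Fin 4) 3 0) = _; simpa using h3)
    (by show P (Equiv.swap (0 : Fin 4) 3 1) = _; simpa [Equiv.swap_apply_of_ne_of_ne] using h1)
    (by show P (Equiv.swap (0 : Fin 4) 3 2) = _; simpa [Equiv.swap_apply_of_ne_of_ne] using h2)
    (hGu _ P hP)

/-- **TN3 — ANY LETTER OVER THE TWIN FORK** (KERNEL; ◇_h, RULE D on both levels, X⁺, `S₄` on the `P`-level; `h = 2m+4`, `m ≥ 1`, `c ≥ 0`): `N{x, 2I + m·ℓ_u, hI, …` (memo §1) -/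
theorem twinFloor_N_absent {h m c : ℤ} {C : MConfig} (hU : C.InDiamond h) (hDN : ∀ Z ∈ C.lower, RuleDMu4N C Z)
    (hDP : ∀ P ∈ C.upper, RuleDMu4P C P) (hX : XPlusClosed C) (hGu : PermClosed C.upper) (hh : h = 2 * m + 4) (hm : 1 ≤ m)
    (hc : 0 ≤ c) {N : MCell} {u ψ k : Fin 4} (hk : Adapted (N 0) k) (hk0 : coord (N 0) k ≠ 0) (h1 : N 1 = nodeTwoLetter u m)
    (h2 : N 2 = (h, 0, 0)) (h3 : N 3 = floorLetter ψ c) : N ∉ C.lower := fun hN => by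
  have hk' : Adapted (N 3) (ψ + 2) := by rw [h3]; exact (floorLetter_node ψ c).1
  have hk'0 : coord (N 3) (ψ + 2) = 0 := by rw [h3]; exact (floorLetter_node ψ c).2
  have hne : coord (N 0) k ≠ coord (N 3) (ψ + 2) := by rw [hk'0]; exact hk0
  have nob : ∀ P ∈ C.upper, ∀ r : Fin 4, (P 3).1 < (N 3).1 → N 3 = ray (P 3) r ((N 3).1 - (P 3).1) → r = ψ :=
    fun P hP r hlt hray => by
      have e : floorLetter ψ c = ray (P 3) r ((N 3).1 - (P 3).1) := by rw [← h3]; exact hray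
      exact below_floorLetter (hU.2 P hP 3) hc (by omega) e
  rcases hDN N hN 0 3 (by decide) k (ψ + 2) hk hk' hne with ⟨r, -, P, hP, hZP⟩ | ⟨r, hr, P, hP, hZP⟩ | ⟨a, a', -, ha', P, hP, -, -, -, hc1, hc2⟩
  · -- `x` served below by anything: the child is a twin-fork cell (floor letter on slot 3)
    exact twinFork_slot3_absent hU hDN hDP hX hGu hh hm hc ((hZP.1 1 (by decide)).trans h1) ((hZP.1 2 (by decide)).trans h2)
      ((hZP.1 3 (by decide)).trans h3) hP
  · exact absurd ((nob P hP r hZP.2.1 hZP.2.2).trans (fin4_add_two_add_two ψ).symm) hr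
  · have hψ := nob P hP a' hc1 hc2
    rcases ha' with e | ⟨-, hne2⟩
    · exact absurd (e.symm.trans hψ) (fin4_ne_add_two ψ).symm
    · exact (hne2 (hψ.trans (fin4_add_two_add_two ψ).symm)).elim

/-- TN3 with the hypothesis `x ≠ O` (the letter lies in ◇_h because the design does). -/
theorem twinFloor_N_absent' {h m c : ℤ} {C : MConfig} (hU : C.InDiamond h) (hDN : ∀ Z ∈ C.lower, RuleDMu4N C Z)
    (hDP : ∀ P ∈ C.upper, RuleDMu4P C P) (hX : XPlusClosed C) (hGu : PermClosed C.upper) (hh : h = 2 * m + 4) (hm : 1 ≤ m)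
    (hc : 0 ≤ c) {N : MCell} {u ψ : Fin 4} (hx : N 0 ≠ (0, 0, 0)) (h1 : N 1 = nodeTwoLetter u m) (h2 : N 2 = (h, 0, 0))
    (h3 : N 3 = floorLetter ψ c) : N ∉ C.lower := fun hN => by
  obtain ⟨k, hk, hk0⟩ := exists_coord_ne_zero (hU.1 N hN 0) hx
  exact twinFloor_N_absent hU hDN hDP hX hGu hh hm hc hk hk0 h1 h2 h3 hN

/-- **TP3** `P{x, 2I + m·ℓ_u, cu_χ, (m+2)·ℓ_ψ}` (slots 0,1,2,3; any `x ≠ O`) **IS ABSENT** (KERNEL): the lift `P(2 ↦ hI)` through the full letter is TN3. -/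
theorem twinFloor_full_absent {h m : ℤ} {C : MConfig} (hU : C.InDiamond h) (hDN : ∀ Z ∈ C.lower, RuleDMu4N C Z)
    (hDP : ∀ P ∈ C.upper, RuleDMu4P C P) (hX : XPlusClosed C) (hGu : PermClosed C.upper) (hh : h = 2 * m + 4) (hm : 1 ≤ m)
    {P : MCell} {u χ ψ : Fin 4} (hx : P 0 ≠ (0, 0, 0)) (h1 : P 1 = nodeTwoLetter u m) (h2 : P 2 = ceilingUnit h χ)
    (h3 : P 3 = floorLetter ψ (m + 2)) : P ∉ C.upper := fun hP => by
  obtain ⟨N, hN, hNP, hN2⟩ := lift_of_ceilingUnit hU hP (hDP P hP) (a := 3) (d := 2) (by decide)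
    (by rw [h3]; exact onCeiling_fullLetter hh (by omega) ψ) h2
  have hN0 : N 0 = P 0 := (hNP.1 0 (by decide)).symm
  exact twinFloor_N_absent' hU hDN hDP hX hGu hh hm (by omega : (0 : ℤ) ≤ m + 2) (by rw [hN0]; exact hx)
    ((hNP.1 1 (by decide)).symm.trans h1) hN2 ((hNP.1 3 (by decide)).symm.trans h3) hN

/-- **TP5** `P{x, 2I + m·ℓ_u, cu_χ, c·ℓ_ψ}` (slots 0,1,2,3; `x` ON THE CEILING, `c ≥ 0`) **IS ABSENT** (KERNEL): the lift `P(2 ↦ hI)` through `x` is TN3. (memo §1) -/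
theorem twinCeiling_floor_absent {h m c : ℤ} {C : MConfig} (hU : C.InDiamond h) (hDN : ∀ Z ∈ C.lower, RuleDMu4N C Z)
    (hDP : ∀ P ∈ C.upper, RuleDMu4P C P) (hX : XPlusClosed C) (hGu : PermClosed C.upper) (hh : h = 2 * m + 4) (hm : 1 ≤ m)
    (hc : 0 ≤ c) {P : MCell} {u χ ψ : Fin 4} (h0 : OnCeiling h (P 0)) (h1 : P 1 = nodeTwoLetter u m) (h2 : P 2 = ceilingUnit h χ)
    (h3 : P 3 = floorLetter ψ c) : P ∉ C.upper := fun hP => by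
  obtain ⟨N, hN, hNP, hN2⟩ := lift_of_ceilingUnit hU hP (hDP P hP) (a := 0) (d := 2) (by decide) h0 h2
  have hN0 : N 0 = P 0 := (hNP.1 0 (by decide)).symm
  exact twinFloor_N_absent' hU hDN hDP hX hGu hh hm hc (by rw [hN0]; exact ne_origin_of_onCeiling (by omega) h0)
    ((hNP.1 1 (by decide)).symm.trans h1) hN2 ((hNP.1 3 (by decide)).symm.trans h3) hN

/-- the slot-swapped TP5: `P{c·ℓ_φ, 2I + m·ℓ_u, cu_χ, y}` with `y` on the ceiling (slots 0,1,2,3). -/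
theorem twinCeiling_floor_absent_swap {h m c : ℤ} {C : MConfig} (hU : C.InDiamond h) (hDN : ∀ Z ∈ C.lower, RuleDMu4N C Z)
    (hDP : ∀ P ∈ C.upper, RuleDMu4P C P) (hX : XPlusClosed C) (hGu : PermClosed C.upper) (hh : h = 2 * m + 4) (hm : 1 ≤ m)
    (hc : 0 ≤ c) {P : MCell} {φ u χ : Fin 4} (h0 : P 0 = floorLetter φ c) (h1 : P 1 = nodeTwoLetter u m) (h2 : P 2 = ceilingUnit h χ)
    (h3 : OnCeiling h (P 3)) : P ∉ C.upper := fun hP =>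
  twinCeiling_floor_absent hU hDN hDP hX hGu hh hm hc (P := P.perm (Equiv.swap 0 3)) (u := u) (χ := χ) (ψ := φ)
    (by show OnCeiling h (P (Equiv.swap (0 : Fin 4) 3 0)); simpa using h3)
    (by show P (Equiv.swap (0 : Fin 4) 3 1) = _; simpa [Equiv.swap_apply_of_ne_of_ne] using h1)
    (by show P (Equiv.swap (0 : Fin 4) 3 2) = _; simpa [Equiv.swap_apply_of_ne_of_ne] using h2)
    (by show P (Equiv.swap (0 : Fin 4) 3 3) = _; simpa using h0)
    (hGu _ P hP)

/-! ### §9b packaged, and ◇₈ representatives of rounds 1 and 2 -/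

theorem twinFloor_N_absent_static {h m c : ℤ} {C : MConfig} (hU : C.InDiamond h) (hG : C.G1Closed) (hS : C.StaticH1) (hh : h = 2 * m + 4)
    (hm : 1 ≤ m) (hc : 0 ≤ c) {N : MCell} {u ψ : Fin 4} (hx : N 0 ≠ (0, 0, 0)) (h1 : N 1 = nodeTwoLetter u m) (h2 : N 2 = (h, 0, 0))
    (h3 : N 3 = floorLetter ψ c) : N ∉ C.lower :=
  twinFloor_N_absent' hU hS.1.1 hS.1.2 hS.2.1 hG.2.1 hh hm hc hx h1 h2 h3

theorem twinFloor_full_absent_static {h m : ℤ} {C : MConfig} (hU : C.InDiamond h) (hG : C.G1Closed) (hS : C.StaticH1) (hh : h = 2 * m + 4)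
    (hm : 1 ≤ m) {P : MCell} {u χ ψ : Fin 4} (hx : P 0 ≠ (0, 0, 0)) (h1 : P 1 = nodeTwoLetter u m) (h2 : P 2 = ceilingUnit h χ)
    (h3 : P 3 = floorLetter ψ (m + 2)) : P ∉ C.upper :=
  twinFloor_full_absent hU hS.1.1 hS.1.2 hS.2.1 hG.2.1 hh hm hx h1 h2 h3

theorem twinCeiling_floor_absent_static {h m c : ℤ} {C : MConfig} (hU : C.InDiamond h) (hG : C.G1Closed) (hS : C.StaticH1)
    (hh : h = 2 * m + 4) (hm : 1 ≤ m) (hc : 0 ≤ c) {P : MCell} {u χ ψ : Fin 4} (h0 : OnCeiling h (P 0)) (h1 : P 1 = nodeTwoLetter u m)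
    (h2 : P 2 = ceilingUnit h χ) (h3 : P 3 = floorLetter ψ c) : P ∉ C.upper :=
  twinCeiling_floor_absent hU hS.1.1 hS.1.2 hS.2.1 hG.2.1 hh hm hc h0 h1 h2 h3

/-- TN3, round 1: `N[2I+l-1|4l-1|2I+2l-1|8I]` (var 76651, `P:Xp`, 6 propagations; r1fam F066), slot order `(2I+ℓ, 2I+2ℓ, 8I, 4ℓ)`. -/
def repTN3 : MCell := ![((3, -1, 0) : BPoint), (4, -2, 0), (8, 0, 0), (4, -4, 0)]
theorem repTN3_absent {C : MConfig} (hU : C.InDiamond 8) (hG : C.G1Closed) (hS : C.StaticH1) : repTN3 ∉ C.lower :=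
  twinFloor_N_absent_static (m := 2) (c := 4) (u := 2) (ψ := 2) hU hG hS (by norm_num) (by norm_num) (by norm_num)
    (by simp [repTN3]) (by simp [repTN3, ray]) (by simp [repTN3]) (by simp [repTN3, ray])

/-- TN3, ROUND 2 with `x = 4I + 2ℓ`: `N[l-1|2I+2l-1|4I+2l-1|8I]` (var 29777, peel round 2, `B:DN`), slot order `(4I+2ℓ, 2I+2ℓ, 8I, ℓ)`. -/
def repTN3r2 : MCell := ![((6, -2, 0) : BPoint), (4, -2, 0), (8, 0, 0), (1, -1, 0)]
theorem repTN3r2_absent {C : MConfig} (hU : C.InDiamond 8) (hG : C.G1Closed) (hS : C.StaticH1) : repTN3r2 ∉ C.lower :=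
  twinFloor_N_absent_static (m := 2) (c := 1) (u := 2) (ψ := 2) hU hG hS (by norm_num) (by norm_num) zero_le_one
    (by simp [repTN3r2]) (by simp [repTN3r2, ray]) (by simp [repTN3r2]) (by simp [repTN3r2, ray])

/-- TN3, ROUND 2 with the node apex `x = 2I`: `N[l-1|2I|2I+2l-1|8I]` (var 16789, peel round 2, `B:DN`), slot order `(2I, 2I+2ℓ, 8I, ℓ)`. -/
def repTN3apex : MCell := ![((2, 0, 0) : BPoint), (4, -2, 0), (8, 0, 0), (1, -1, 0)]
theorem repTN3apex_absent {C : MConfig} (hU : C.InDiamond 8) (hG : C.G1Closed) (hS : C.StaticH1) : repTN3apex ∉ C.lower :=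
  twinFloor_N_absent_static (m := 2) (c := 1) (u := 2) (ψ := 2) hU hG hS (by norm_num) (by norm_num) zero_le_one
    (by simp [repTN3apex]) (by simp [repTN3apex, ray]) (by simp [repTN3apex]) (by simp [repTN3apex, ray])

/-- TP3, round 1: `P[2I+l-1|4l-1|2I+2l-1|6I+l-1]` (var 76644, `P:Xp`, 10 propagations; r1fam F009), slot order `(2I+ℓ, 2I+2ℓ, 6I+ℓ, 4ℓ)`. -/
def repTP3 : MCell := ![((3, -1, 0) : BPoint), (4, -2, 0), (7, -1, 0), (4, -4, 0)]
theorem repTP3_absent {C : MConfig} (hU : C.InDiamond 8) (hG : C.G1Closed) (hS : C.StaticH1) : repTP3 ∉ C.upper :=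
  twinFloor_full_absent_static (m := 2) (u := 2) (χ := 2) (ψ := 2) hU hG hS (by norm_num) (by norm_num)
    (by simp [repTP3]) (by simp [repTP3, ray]) (by simp [repTP3, ray]) (by simp [repTP3, ray])

/-- TP3, ROUND 2 with `x = 2I`: `P[2I|4l-1|2I+2l-1|6I+l-1]` (var 58844, peel round 2, `B:DP`). -/
def repTP3r2 : MCell := ![((2, 0, 0) : BPoint), (4, -2, 0), (7, -1, 0), (4, -4, 0)]
theorem repTP3r2_absent {C : MConfig} (hU : C.InDiamond 8) (hG : C.G1Closed) (hS : C.StaticH1) : repTP3r2 ∉ C.upper :=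
  twinFloor_full_absent_static (m := 2) (u := 2) (χ := 2) (ψ := 2) hU hG hS (by norm_num) (by norm_num)
    (by simp [repTP3r2]) (by simp [repTP3r2, ray]) (by simp [repTP3r2, ray]) (by simp [repTP3r2, ray])

/-- TP5, ROUND 2 with `x = 4I + 2ℓ` on the ceiling: `P[l-1|2I+2l-1|4I+2l-1|6I+l-1]` (var 29770, peel round 2, `B:DP`), slot order
`(4I+2ℓ, 2I+2ℓ, 6I+ℓ, ℓ)`. -/
def repTP5r2 : MCell := ![((6, -2, 0) : BPoint), (4, -2, 0), (7, -1, 0), (1, -1, 0)]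
theorem repTP5r2_absent {C : MConfig} (hU : C.InDiamond 8) (hG : C.G1Closed) (hS : C.StaticH1) : repTP5r2 ∉ C.upper :=
  twinCeiling_floor_absent_static (m := 2) (c := 1) (u := 2) (χ := 2) (ψ := 2) hU hG hS (by norm_num) (by norm_num) zero_le_one
    (by show ((6 : ℤ), (-2 : ℤ), (0 : ℤ)).1 + |(-2 : ℤ) - 0| = 8; norm_num) (by simp [repTP5r2, ray]) (by simp [repTP5r2, ray])
    (by simp [repTP5r2, ray])

/-! ## §10 NEW: THE NODE-FOUR LETTER `4I + n·ℓ_v` AND THE SECOND TWIN (law-free; `h = 2m + 4`) (memo §1, §3) -/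

/-- the letter `4I + n·ℓ_v` (node level 4). -/
abbrev nodeFourLetter (v : Fin 4) (n : ℤ) : BPoint := ray ((4, 0, 0) : BPoint) v n

theorem nodeFourLetter_node (v : Fin 4) (n : ℤ) :
    Adapted (nodeFourLetter v n) (v + 2) ∧ coord (nodeFourLetter v n) (v + 2) = 4 :=
  ⟨(adapted_ray_apex 4 v n).2, coord_ray_apex_antip 4 v n⟩

theorem nodeFourLetter_top (v : Fin 4) (n : ℤ) :
    Adapted (nodeFourLetter v n) v ∧ coord (nodeFourLetter v n) v = 4 + 2 * n := by
  refine ⟨(adapted_ray_apex 4 v n).1, ?_⟩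
  rw [coord_ray_self, coord_of_isApex ⟨rfl, rfl⟩]

theorem nodeFourLetter_not_isApex (v : Fin 4) {n : ℤ} (hn : n ≠ 0) : ¬ isApex (nodeFourLetter v n) := by
  fin_cases v <;> simp [ray, isApex, hn]

/-- above `4I + n·ℓ_v` along its ray there is one diamond step when `h = 2n + 6`. -/
theorem above_nodeFourLetter {h n e : ℤ} {z : BPoint} {v : Fin 4} (hh : h = 2 * n + 6) (hn : 0 ≤ n) (he : 0 < e)
    (hz : InDiamond h z) (hze : z = ray (nodeFourLetter v n) v e) : e = 1 := by
  have htop := hz.2.2.2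
  rw [hze, show ray (nodeFourLetter v n) v e = ray ((4, 0, 0) : BPoint) v (n + e) from (ray_add _ v n e).symm,
    top_ray_apex 4 v (by omega)] at htop
  omega

/-- below `4I + n·ℓ_v` (`n ≥ 1`) off its ray: `2I + (n+1)·ℓ_v` one step or `(n+2)·ℓ_v` two steps along `v + 2`, nothing else. -/
theorem below_nodeFour_offRay {h n d : ℤ} {z : BPoint} {v r : Fin 4} (hn : 1 ≤ n) (hz : InDiamond h z) (hd : 0 < d) (hr : r ≠ v)
    (he : nodeFourLetter v n = ray z r d) :
    r = v + 2 ∧ (d = 1 ∧ z = nodeTwoLetter v (n + 1) ∨ d = 2 ∧ z = floorLetter v (n + 2)) := by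
  obtain ⟨α, a, b⟩ := z
  obtain ⟨hax, h1, -, -⟩ := hz
  simp only [AxisPt, absCharge, chargeOf, ray, Prod.mk.injEq] at hax h1 he ⊢
  fin_cases v <;> fin_cases r <;> simp at hax h1 he hr ⊢ <;>
    (simp only [abs_eq_max_neg, max_def] at h1; split_ifs at h1 <;> omega)

/-- **TN4.** `N{c·ℓ_φ, 2I + m·ℓ_u, cu_χ, 4I + m·ℓ_v} ∉ C.lower` (`h = 2m+4`, `m ≥ 1`, `c ≥ 0`) [◇_h, RULE D, X⁺]. (memo §1) -/
theorem nodeFour_N_absent {h m c : ℤ} {C : MConfig} (hU : C.InDiamond h) (hDN : ∀ Z ∈ C.lower, RuleDMu4N C Z)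
    (hDP : ∀ P ∈ C.upper, RuleDMu4P C P) (hX : XPlusClosed C) (hh : h = 2 * m + 4) (hm : 1 ≤ m) (hc : 0 ≤ c)
    {N : MCell} {φ u χ v : Fin 4} (h0 : N 0 = floorLetter φ c) (h1 : N 1 = nodeTwoLetter u m)
    (h2 : N 2 = ceilingUnit h χ) (h3 : N 3 = nodeFourLetter v m) : N ∉ C.lower := fun hN => by
  have hk : Adapted (N 0) (φ + 2) := by rw [h0]; exact (floorLetter_node φ c).1
  have hk0 : coord (N 0) (φ + 2) = 0 := by rw [h0]; exact (floorLetter_node φ c).2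
  have hk' : Adapted (N 3) (v + 2) := by rw [h3]; exact (nodeFourLetter_node v m).1
  have hk'4 : coord (N 3) (v + 2) = 4 := by rw [h3]; exact (nodeFourLetter_node v m).2
  have hne : coord (N 0) (φ + 2) ≠ coord (N 3) (v + 2) := by rw [hk0, hk'4]; decide
  have nob : ∀ P ∈ C.upper, ∀ r : Fin 4, (P 0).1 < (N 0).1 → N 0 = ray (P 0) r ((N 0).1 - (P 0).1) → r = φ :=
    fun P hP r hlt e => below_floorLetter (hU.2 P hP 0) hc (by omega) (h0.symm.trans e)
  rcases hDN N hN 0 3 (by decide) (φ + 2) (v + 2) hk hk' hne with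
    ⟨r, hr, P, hP, hZP⟩ | ⟨r, hr, P, hP, hZP⟩ | ⟨a, a', ha, -, P, hP, -, hb1, hb2, -, -⟩
  · exact absurd ((nob P hP r hZP.2.1 hZP.2.2).trans (fin4_add_two_add_two φ).symm) hr
  · have hd : 0 < (N 3).1 - (P 3).1 := by have := hZP.2.1; omega
    have e : nodeFourLetter v m = ray (P 3) r ((N 3).1 - (P 3).1) := by rw [← h3]; exact hZP.2.2
    have hr' : r ≠ v := fun e' => hr (by rw [e', fin4_add_two_add_two])
    have hP0 : P 0 = floorLetter φ c := (hZP.1 0 (by decide)).trans h0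
    have hP1 : P 1 = nodeTwoLetter u m := (hZP.1 1 (by decide)).trans h1
    have hP2 : P 2 = ceilingUnit h χ := (hZP.1 2 (by decide)).trans h2
    obtain ⟨-, ⟨-, hz⟩ | ⟨-, hz⟩⟩ := below_nodeFour_offRay hm (hU.2 P hP 3) hd hr' e
    · exact twinTower_nodeTwo_absent hU hDN hDP hX hh hm hc hP0 hP1 hP2 hz hP
    · exact twinTower_full_absent hU hDN hDP hX hh hm hc hP0 hP1 hP2 hz hP
  · have hφ := nob P hP a hb1 hb2
    rcases ha with e | ⟨-, hne2⟩
    · exact absurd (e.symm.trans hφ) (fin4_ne_add_two φ).symm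
    · exact (hne2 (hφ.trans (fin4_add_two_add_two φ).symm)).elim

/-- **TP6.** `P{c·ℓ_φ, 2I + m·ℓ_u, cu_χ, 4I + (m−1)·ℓ_v} ∉ C.upper` (`h = 2m+4`, `m ≥ 2`, `c ≥ 0`) [◇_h, RULE D, X⁺]. (memo §1) -/
theorem nodeFourMinus_P_absent {h m c : ℤ} {C : MConfig} (hU : C.InDiamond h) (hDN : ∀ Z ∈ C.lower, RuleDMu4N C Z)
    (hDP : ∀ P ∈ C.upper, RuleDMu4P C P) (hX : XPlusClosed C) (hh : h = 2 * m + 4) (hm : 2 ≤ m) (hc : 0 ≤ c)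
    {P : MCell} {φ u χ v : Fin 4} (h0 : P 0 = floorLetter φ c) (h1 : P 1 = nodeTwoLetter u m)
    (h2 : P 2 = ceilingUnit h χ) (h3 : P 3 = nodeFourLetter v (m - 1)) : P ∉ C.upper := fun hP => by
  have hna : ¬ isApex (P 3) := by rw [h3]; exact nodeFourLetter_not_isApex v (by omega)
  have hk : Adapted (P 3) v := by rw [h3]; exact (nodeFourLetter_top v (m - 1)).1
  have hkh : coord (P 3) v ≠ h := by rw [h3, (nodeFourLetter_top v (m - 1)).2]; omega
  obtain ⟨N, hN, hNP⟩ := upLine_of_ruleDMu4P hU hP (hDP P hP) (g := 2) (j := 3) (by decide)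
    (by rw [h2]; exact onCeiling_ceilingUnit h χ) hna hk hkh
  have he0 : 0 < (N 3).1 - (P 3).1 := by have := hNP.2.1; omega
  have e : N 3 = ray (nodeFourLetter v (m - 1)) v ((N 3).1 - (P 3).1) := by rw [← h3]; exact hNP.2.2
  have he1 := above_nodeFourLetter (n := m - 1) (by omega) (by omega) he0 (hU.1 N hN 3) e
  have hN3 : N 3 = nodeFourLetter v (m - 1 + 1) := by rw [e, he1]; exact (ray_add _ v (m - 1) 1).symm
  rw [sub_add_cancel] at hN3
  exact nodeFour_N_absent hU hDN hDP hX hh (by omega) hc ((hNP.1 0 (by decide)).symm.trans h0)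
    ((hNP.1 1 (by decide)).symm.trans h1) ((hNP.1 2 (by decide)).symm.trans h2) hN3 hN

/-- **TP7.** `P{c·ℓ_φ, 2I + m·ℓ_u, cu_χ, 2I + m·ℓ_v} ∉ C.upper` (`h = 2m+4`, `m ≥ 1`, `c ≥ 0`; `u = v` allowed) [◇_h, RULE D, X⁺]. (memo §1) -/
theorem nodeTwoPair_P_absent {h m c : ℤ} {C : MConfig} (hU : C.InDiamond h) (hDN : ∀ Z ∈ C.lower, RuleDMu4N C Z)
    (hDP : ∀ P ∈ C.upper, RuleDMu4P C P) (hX : XPlusClosed C) (hh : h = 2 * m + 4) (hm : 1 ≤ m) (hc : 0 ≤ c)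
    {P : MCell} {φ u χ v : Fin 4} (h0 : P 0 = floorLetter φ c) (h1 : P 1 = nodeTwoLetter u m)
    (h2 : P 2 = ceilingUnit h χ) (h3 : P 3 = nodeTwoLetter v m) : P ∉ C.upper := fun hP => by
  have hna : ¬ isApex (P 3) := by rw [h3]; exact nodeTwoLetter_not_isApex v (by omega)
  have hk : Adapted (P 3) v := by rw [h3]; exact (nodeTwoLetter_top v m).1
  have hkh : coord (P 3) v ≠ h := by rw [h3, (nodeTwoLetter_top v m).2]; omega
  obtain ⟨N, hN, hNP⟩ := upLine_of_ruleDMu4P hU hP (hDP P hP) (g := 2) (j := 3) (by decide)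
    (by rw [h2]; exact onCeiling_ceilingUnit h χ) hna hk hkh
  have he0 : 0 < (N 3).1 - (P 3).1 := by have := hNP.2.1; omega
  have e : N 3 = ray (nodeTwoLetter v m) v ((N 3).1 - (P 3).1) := by rw [← h3]; exact hNP.2.2
  have he1 := above_nodeTwoLetter hh (by omega) he0 (hU.1 N hN 3) e
  have hN3 : N 3 = nodeTwoLetter v (m + 1) := by rw [e, he1]; exact (ray_add _ v m 1).symm
  exact twinPair_N_absent hU hDN hDP hX hh hm hc ((hNP.1 0 (by decide)).symm.trans h0)
    ((hNP.1 1 (by decide)).symm.trans h1) ((hNP.1 2 (by decide)).symm.trans h2) hN3 hN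

/-- **TN5.** `N{c·ℓ_φ, 2I + (c−1)·ℓ_{φ+2}, cu_χ, hI} ∉ C.lower` (`c ≥ 2`, every `h`) [◇, RULE D, X⁺, `PermClosed` + `DeltaClosed C.upper`]: the descent next to the … (memo §1) -/
theorem antipodalTower_apex_N_absent {h c : ℤ} {C : MConfig} (hU : C.InDiamond h) (hDN : ∀ Z ∈ C.lower, RuleDMu4N C Z)
    (hDP : ∀ P ∈ C.upper, RuleDMu4P C P) (hX : XPlusClosed C) (hGu : PermClosed C.upper) (hΔu : DeltaClosed C.upper) (hc : 2 ≤ c)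
    {N : MCell} {φ χ : Fin 4} (h0 : N 0 = floorLetter φ c) (h1 : N 1 = nodeTwoLetter (φ + 2) (c - 1))
    (h2 : N 2 = ceilingUnit h χ) (h3 : N 3 = (h, 0, 0)) : N ∉ C.lower := fun hN => by
  obtain ⟨P', hP', hNP', hP'1⟩ := descent_of_floorNode_nodeTwo hU (by omega) (by omega) (hDN N hN) (b := 0) (c := 1) (by decide)
    h0 h1
  rw [show c - 1 + 1 = c by ring] at hP'1
  have hP'0 : P' 0 = floorLetter φ c := (hNP'.1 0 (by decide)).trans h0
  have hP'2 : P' 2 = ceilingUnit h χ := (hNP'.1 2 (by decide)).trans h2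
  have hP'3 : P' 3 = (h, 0, 0) := (hNP'.1 3 (by decide)).trans h3
  refine antipodalPair_apexCeilingUnit_absent hU hDP hX hGu hΔu ?_ hP'2 hP'3 hP'
  rw [hP'1, hP'0, deltaPt_floorLetter, deltaPt_floorLetter, fin4_add33]

/-! ### §10b packaged, and ◇₈ representatives -/

theorem nodeFour_N_absent_static {h m c : ℤ} {C : MConfig} (hU : C.InDiamond h) (hS : C.StaticH1)
    (hh : h = 2 * m + 4) (hm : 1 ≤ m) (hc : 0 ≤ c) {N : MCell} {φ u χ v : Fin 4} (h0 : N 0 = floorLetter φ c)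
    (h1 : N 1 = nodeTwoLetter u m) (h2 : N 2 = ceilingUnit h χ) (h3 : N 3 = nodeFourLetter v m) : N ∉ C.lower :=
  nodeFour_N_absent hU hS.1.1 hS.1.2 hS.2.1 hh hm hc h0 h1 h2 h3

theorem nodeFourMinus_P_absent_static {h m c : ℤ} {C : MConfig} (hU : C.InDiamond h) (hS : C.StaticH1)
    (hh : h = 2 * m + 4) (hm : 2 ≤ m) (hc : 0 ≤ c) {P : MCell} {φ u χ v : Fin 4} (h0 : P 0 = floorLetter φ c)
    (h1 : P 1 = nodeTwoLetter u m) (h2 : P 2 = ceilingUnit h χ) (h3 : P 3 = nodeFourLetter v (m - 1)) : P ∉ C.upper :=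
  nodeFourMinus_P_absent hU hS.1.1 hS.1.2 hS.2.1 hh hm hc h0 h1 h2 h3

theorem nodeTwoPair_P_absent_static {h m c : ℤ} {C : MConfig} (hU : C.InDiamond h) (hS : C.StaticH1)
    (hh : h = 2 * m + 4) (hm : 1 ≤ m) (hc : 0 ≤ c) {P : MCell} {φ u χ v : Fin 4} (h0 : P 0 = floorLetter φ c)
    (h1 : P 1 = nodeTwoLetter u m) (h2 : P 2 = ceilingUnit h χ) (h3 : P 3 = nodeTwoLetter v m) : P ∉ C.upper :=
  nodeTwoPair_P_absent hU hS.1.1 hS.1.2 hS.2.1 hh hm hc h0 h1 h2 h3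

theorem antipodalTower_apex_N_absent_static {h c : ℤ} {C : MConfig} (hU : C.InDiamond h) (hG : C.G1Closed) (hS : C.StaticH1)
    (hc : 2 ≤ c) {N : MCell} {φ χ : Fin 4} (h0 : N 0 = floorLetter φ c) (h1 : N 1 = nodeTwoLetter (φ + 2) (c - 1))
    (h2 : N 2 = ceilingUnit h χ) (h3 : N 3 = (h, 0, 0)) : N ∉ C.lower :=
  antipodalTower_apex_N_absent hU hS.1.1 hS.1.2 hS.2.1 hG.2.1 hG.2.2.2 hc h0 h1 h2 h3

/-- ◇₈ `N[l-1|2I+2l-1|4I+2l-1|6I+l-1]` (census var 29769, peel ROUND 2, clause `B:DN`): TN4. -/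
def repTN4r2 : MCell := ![(1, -1, 0), (4, -2, 0), (7, -1, 0), (6, -2, 0)]
theorem repTN4r2_absent {C : MConfig} (hU : C.InDiamond 8) (hS : C.StaticH1) : repTN4r2 ∉ C.lower :=
  nodeFour_N_absent_static hU hS (m := 2) (c := 1) (by norm_num) (by norm_num) (by norm_num) (φ := 2) (u := 2) (χ := 2) (v := 2)
    (by simp [repTN4r2, ray]) (by simp [repTN4r2, ray]) (by simp [repTN4r2, ray]) (by simp [repTN4r2, ray])

/-- ◇₈ `P[l-1|2I+2l-1|4I+l-1|6I+l-1]` (census var 29588, round 1, clause `P:DP`, 133 propagations): TP6. -/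
def repTP6 : MCell := ![(1, -1, 0), (4, -2, 0), (7, -1, 0), (5, -1, 0)]
theorem repTP6_absent {C : MConfig} (hU : C.InDiamond 8) (hS : C.StaticH1) : repTP6 ∉ C.upper :=
  nodeFourMinus_P_absent_static hU hS (m := 2) (c := 1) (by norm_num) (by norm_num) (by norm_num) (φ := 2) (u := 2) (χ := 2)
    (v := 2) (by simp [repTP6, ray]) (by simp [repTP6, ray]) (by simp [repTP6, ray]) (by simp [repTP6, ray])

/-- ◇₈ `P[O|2I+2l-1|4I+li|6I+l-1]` (census var 7300, peel ROUND 2, clause `B:DP`): TP6 with `x = O`, `v = 1`. -/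
def repTP6r2 : MCell := ![(0, 0, 0), (4, -2, 0), (7, -1, 0), (5, 0, -1)]
theorem repTP6r2_absent {C : MConfig} (hU : C.InDiamond 8) (hS : C.StaticH1) : repTP6r2 ∉ C.upper :=
  nodeFourMinus_P_absent_static hU hS (m := 2) (c := 0) (by norm_num) (by norm_num) (by norm_num) (φ := 0) (u := 2) (χ := 2)
    (v := 1) (by simp [repTP6r2, ray]) (by simp [repTP6r2, ray]) (by simp [repTP6r2, ray]) (by simp [repTP6r2, ray])

/-- ◇₈ `P[l-1|2I+2l-1|2I+2l1|6I+l-1]` (census var 29480, round 1, clause `P:Xp`, 27 propagations): TP7. -/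
def repTP7 : MCell := ![(1, -1, 0), (4, -2, 0), (7, -1, 0), (4, 2, 0)]
theorem repTP7_absent {C : MConfig} (hU : C.InDiamond 8) (hS : C.StaticH1) : repTP7 ∉ C.upper :=
  nodeTwoPair_P_absent_static hU hS (m := 2) (c := 1) (by norm_num) (by norm_num) (by norm_num) (φ := 2) (u := 2) (χ := 2) (v := 0)
    (by simp [repTP7, ray]) (by simp [repTP7, ray]) (by simp [repTP7, ray]) (by simp [repTP7, ray])

/-- ◇₈ `P[O|2I+2l-1|2I+2l-1|6I+l-1]` (census var 7068, peel ROUND 2, clause `B:DP`): TP7 with `x = O` and `u = v`. -/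
def repTP7r2 : MCell := ![(0, 0, 0), (4, -2, 0), (7, -1, 0), (4, -2, 0)]
theorem repTP7r2_absent {C : MConfig} (hU : C.InDiamond 8) (hS : C.StaticH1) : repTP7r2 ∉ C.upper :=
  nodeTwoPair_P_absent_static hU hS (m := 2) (c := 0) (by norm_num) (by norm_num) (by norm_num) (φ := 0) (u := 2) (χ := 2) (v := 2)
    (by simp [repTP7r2, ray]) (by simp [repTP7r2, ray]) (by simp [repTP7r2, ray]) (by simp [repTP7r2, ray])

/-- ◇₈ `N[2l-1|2I+l1|6I+l-1|8I]` (census var 48185, round 1, clause `P:Xp`): TN5 with `c = 2`, `φ = 2`. -/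
def repTN5 : MCell := ![(2, -2, 0), (3, 1, 0), (7, -1, 0), (8, 0, 0)]
theorem repTN5_absent {C : MConfig} (hU : C.InDiamond 8) (hG : C.G1Closed) (hS : C.StaticH1) : repTN5 ∉ C.lower :=
  antipodalTower_apex_N_absent_static hU hG hS (c := 2) (by norm_num) (φ := 2) (χ := 2)
    (by simp [repTN5, ray]) (by simp [repTN5, ray]) (by simp [repTN5, ray]) (by simp [repTN5])


/-! ## §11 NEW: THE TWIN FRAME ONE NODE BELOW THE CEILING — the ceiling line `y_d` and the sub-ceiling line `s_k` (law-free; `h = 2m + 4`) (memo §1, §3) -/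

/-- the CEILING-LINE letter `y_d = (h − 2 − 2d)·I + (1 + d)·ℓ_χ` (`d = 0`: `cu_χ`; top coordinate `h`). -/
abbrev ceilLetter (h : ℤ) (χ : Fin 4) (d : ℤ) : BPoint := ray ((h - 2 - 2 * d, 0, 0) : BPoint) χ (1 + d)

/-- the SUB-CEILING-LINE letter `s_k = 2k·I + (m + 1 − k)·ℓ_v` of ◇_{2m+4} (`k = 1`: `2I + m·ℓ_v`; top coordinate `h − 2`). -/
abbrev subCeilLetter (m : ℤ) (v : Fin 4) (k : ℤ) : BPoint := ray ((2 * k, 0, 0) : BPoint) v (m + 1 - k)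

theorem ceilLetter_node (h : ℤ) (χ : Fin 4) (d : ℤ) :
    Adapted (ceilLetter h χ d) (χ + 2) ∧ coord (ceilLetter h χ d) (χ + 2) = h - 2 - 2 * d :=
  ⟨(adapted_ray_apex _ χ _).2, coord_ray_apex_antip _ χ _⟩

theorem onCeiling_ceilLetter {h d : ℤ} (hd : 0 ≤ 1 + d) (χ : Fin 4) : OnCeiling h (ceilLetter h χ d) := by
  show (ray ((h - 2 - 2 * d, 0, 0) : BPoint) χ (1 + d)).1 + absCharge (ray ((h - 2 - 2 * d, 0, 0) : BPoint) χ (1 + d)) = h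
  rw [top_ray_apex (h - 2 - 2 * d) χ hd]; ring

theorem ceilingUnit_top (h : ℤ) (χ : Fin 4) : Adapted (ceilingUnit h χ) χ ∧ coord (ceilingUnit h χ) χ = h - 2 + 2 * 1 := by
  refine ⟨(adapted_ray_apex _ χ 1).1, ?_⟩
  rw [coord_ray_self, coord_of_isApex ⟨rfl, rfl⟩]

theorem subCeilLetter_node (m : ℤ) (v : Fin 4) (k : ℤ) :
    Adapted (subCeilLetter m v k) (v + 2) ∧ coord (subCeilLetter m v k) (v + 2) = 2 * k :=
  ⟨(adapted_ray_apex _ v _).2, coord_ray_apex_antip _ v _⟩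

theorem subCeilLetter_top (m : ℤ) (v : Fin 4) (k : ℤ) :
    Adapted (subCeilLetter m v k) v ∧ coord (subCeilLetter m v k) v = 2 * k + 2 * (m + 1 - k) := by
  refine ⟨(adapted_ray_apex _ v _).1, ?_⟩
  rw [coord_ray_self, coord_of_isApex ⟨rfl, rfl⟩]

theorem subCeilLetter_not_isApex {m k : ℤ} (v : Fin 4) (hk : m + 1 - k ≠ 0) : ¬ isApex (subCeilLetter m v k) := by
  fin_cases v <;> simp [ray, isApex, hk] <;> omega

/-- the up-step along the ray: `s_k + ℓ_v = y_{m+1−k}` (`h = 2m+4`). -/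
theorem subCeilLetter_up {h m : ℤ} (hh : h = 2 * m + 4) (v : Fin 4) (k : ℤ) :
    ray (subCeilLetter m v k) v 1 = ceilLetter h v (m + 1 - k) := by
  have e1 : (h - 2 - 2 * (m + 1 - k) : ℤ) = 2 * k := by rw [hh]; ring
  have e2 : (1 + (m + 1 - k) : ℤ) = m + 1 - k + 1 := by ring
  show ray (subCeilLetter m v k) v 1 = ray ((h - 2 - 2 * (m + 1 - k), 0, 0) : BPoint) v (1 + (m + 1 - k))
  rw [e1, e2]; exact (ray_add _ v _ 1).symm

/-- one diamond step above a sub-ceiling letter along its ray. -/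
theorem above_subCeilLetter {h m k e : ℤ} {z : BPoint} {v : Fin 4} (hh : h = 2 * m + 4) (hk : k ≤ m + 1) (he : 0 < e)
    (hz : InDiamond h z) (hze : z = ray (subCeilLetter m v k) v e) : e = 1 := by
  have htop := hz.2.2.2
  rw [hze, show ray (subCeilLetter m v k) v e = ray ((2 * k, 0, 0) : BPoint) v (m + 1 - k + e) from (ray_add _ v _ e).symm,
    top_ray_apex (2 * k) v (by omega)] at htop
  omega

/-- one diamond step above `(m+1)·ℓ_ψ` along its ray. -/
theorem above_subFullLetter {h m e : ℤ} {z : BPoint} {ψ : Fin 4} (hh : h = 2 * m + 4) (hm : 0 ≤ m) (he : 0 < e)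
    (hz : InDiamond h z) (hze : z = ray (floorLetter ψ (m + 1)) ψ e) : e = 1 := by
  have htop := hz.2.2.2
  rw [hze, show ray (floorLetter ψ (m + 1)) ψ e = ray ((0, 0, 0) : BPoint) ψ (m + 1 + e) from (ray_add _ ψ _ e).symm,
    top_ray_apex 0 ψ (by omega)] at htop
  omega

/-- one diamond step above the sub-ceiling apex `(h−2)·I`. -/
theorem above_subApex {h e : ℤ} {z : BPoint} {r : Fin 4} (he : 0 < e) (hz : InDiamond h z)
    (hze : z = ray ((h - 2, 0, 0) : BPoint) r e) : e = 1 := by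
  have htop := hz.2.2.2
  rw [hze, top_ray_apex (h - 2) r (by omega)] at htop
  omega

/-- THE OFF-RAY STEP PRESERVES THE TOP: a diamond server below a ceiling-line letter `y_d` (`d ≥ 0`) off its ray is ON THE CEILING. -/
theorem onCeiling_below_ceilLetter {h d e : ℤ} {z : BPoint} {χ r : Fin 4} (hd : 0 ≤ d) (hz : InDiamond h z) (he : 0 < e)
    (hr : r ≠ χ) (heq : ceilLetter h χ d = ray z r e) : OnCeiling h z := by
  obtain ⟨α, a, b⟩ := z
  obtain ⟨hax, h1, -, -⟩ := hz
  simp only [AxisPt, absCharge, chargeOf, ray, Prod.mk.injEq, OnCeiling] at hax h1 heq ⊢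
  fin_cases χ <;> fin_cases r <;> simp at hax h1 heq hr ⊢ <;>
    (simp only [abs_eq_max_neg, max_def] at h1 ⊢; split_ifs at h1 ⊢ <;> omega)

/-- below the apex `hI` every diamond server is on the ceiling. -/
theorem onCeiling_below_apex {h e : ℤ} {z : BPoint} {r : Fin 4} (hz : InDiamond h z) (he : 0 < e)
    (heq : ((h, 0, 0) : BPoint) = ray z r e) : OnCeiling h z := by
  obtain ⟨α, a, b⟩ := z
  obtain ⟨hax, h1, -, -⟩ := hz
  simp only [AxisPt, absCharge, chargeOf, ray, Prod.mk.injEq, OnCeiling] at hax h1 heq ⊢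
  fin_cases r <;> simp at hax h1 heq ⊢ <;>
    (simp only [abs_eq_max_neg, max_def] at h1 ⊢; split_ifs at h1 ⊢ <;> omega)

/-- below a sub-ceiling letter `s_k` (`k ≤ m`, so charged) off its ray: exactly the `s_{k'}`, `0 ≤ k' < k`. -/
theorem below_subCeilLetter_offRay {h m k e : ℤ} {z : BPoint} {v r : Fin 4} (hk : k ≤ m) (hz : InDiamond h z) (he : 0 < e)
    (hr : r ≠ v) (heq : subCeilLetter m v k = ray z r e) : ∃ k', 0 ≤ k' ∧ k' < k ∧ z = subCeilLetter m v k' := by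
  refine ⟨k - e, ?_, by omega, ?_⟩ <;> obtain ⟨α, a, b⟩ := z <;> obtain ⟨hax, h1, -, -⟩ := hz <;>
    simp only [AxisPt, absCharge, chargeOf, ray, Prod.mk.injEq] at hax h1 heq ⊢ <;>
    fin_cases v <;> fin_cases r <;> simp at hax h1 heq hr ⊢ <;>
    (simp only [abs_eq_max_neg, max_def] at h1; split_ifs at h1 <;> omega)

/-- below the sub-ceiling apex `(h−2)·I` (`h = 2m+4`): exactly the `s_k` of phase `r + 2`, `0 ≤ k ≤ m`. -/
theorem below_subApex {h m e : ℤ} {z : BPoint} {r : Fin 4} (hh : h = 2 * m + 4) (hz : InDiamond h z) (he : 0 < e)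
    (heq : ((h - 2, 0, 0) : BPoint) = ray z r e) : ∃ k, 0 ≤ k ∧ k ≤ m ∧ z = subCeilLetter m (r + 2) k := by
  subst hh
  refine ⟨m + 1 - e, ?_, by omega, ?_⟩ <;> obtain ⟨α, a, b⟩ := z <;> obtain ⟨hax, h1, -, -⟩ := hz <;>
    simp only [AxisPt, absCharge, chargeOf, ray, Prod.mk.injEq] at hax h1 heq ⊢ <;>
    fin_cases r <;> simp at hax h1 heq ⊢ <;>
    (simp only [abs_eq_max_neg, max_def] at h1; split_ifs at h1 <;> omega)

/-- **TN8.** `N{c·ℓ_φ, 2I + m·ℓ_u, cu_χ, y_d} ∉ C.lower` for the ceiling-line letter `y_d = (h−2−2d)I + (1+d)ℓ_{χ'}`, `0 ≤ d ≤ m` (`h = 2m+4`, `m ≥ 1`, `c ≥ 0`; `d …` (memo §1) -/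
theorem ceilLetter_N_absent {h m c d : ℤ} {C : MConfig} (hU : C.InDiamond h) (hDN : ∀ Z ∈ C.lower, RuleDMu4N C Z)
    (hDP : ∀ P ∈ C.upper, RuleDMu4P C P) (hX : XPlusClosed C) (hGu : PermClosed C.upper) (hh : h = 2 * m + 4) (hm : 1 ≤ m) (hc : 0 ≤ c)
    (hd : 0 ≤ d) (hdm : d ≤ m) {N : MCell} {φ u χ χ' : Fin 4} (h0 : N 0 = floorLetter φ c) (h1 : N 1 = nodeTwoLetter u m)
    (h2 : N 2 = ceilingUnit h χ) (h3 : N 3 = ceilLetter h χ' d) : N ∉ C.lower := fun hN => by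
  have hk : Adapted (N 0) (φ + 2) := by rw [h0]; exact (floorLetter_node φ c).1
  have hk0 : coord (N 0) (φ + 2) = 0 := by rw [h0]; exact (floorLetter_node φ c).2
  have hk' : Adapted (N 3) (χ' + 2) := by rw [h3]; exact (ceilLetter_node h χ' d).1
  have hk'c : coord (N 3) (χ' + 2) = h - 2 - 2 * d := by rw [h3]; exact (ceilLetter_node h χ' d).2
  have hne : coord (N 0) (φ + 2) ≠ coord (N 3) (χ' + 2) := by rw [hk0, hk'c]; omega
  have nob : ∀ P ∈ C.upper, ∀ r : Fin 4, (P 0).1 < (N 0).1 → N 0 = ray (P 0) r ((N 0).1 - (P 0).1) → r = φ :=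
    fun P hP r hlt e => below_floorLetter (hU.2 P hP 0) hc (by omega) (h0.symm.trans e)
  rcases hDN N hN 0 3 (by decide) (φ + 2) (χ' + 2) hk hk' hne with
    ⟨r, hr, P, hP, hZP⟩ | ⟨r, hr, P, hP, hZP⟩ | ⟨a, a', ha, -, P, hP, -, hb1, hb2, -, -⟩
  · exact absurd ((nob P hP r hZP.2.1 hZP.2.2).trans (fin4_add_two_add_two φ).symm) hr
  · have hd0 : 0 < (N 3).1 - (P 3).1 := by have := hZP.2.1; omega
    have e : ceilLetter h χ' d = ray (P 3) r ((N 3).1 - (P 3).1) := by rw [← h3]; exact hZP.2.2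
    have hr' : r ≠ χ' := fun e' => hr (by rw [e', fin4_add_two_add_two])
    have hP3 : OnCeiling h (P 3) := onCeiling_below_ceilLetter hd (hU.2 P hP 3) hd0 hr' e
    exact twinCeiling_floor_absent_swap hU hDN hDP hX hGu hh hm hc ((hZP.1 0 (by decide)).trans h0)
      ((hZP.1 1 (by decide)).trans h1) ((hZP.1 2 (by decide)).trans h2) hP3 hP
  · have hφ := nob P hP a hb1 hb2
    rcases ha with e | ⟨-, hne2⟩
    · exact absurd (e.symm.trans hφ) (fin4_ne_add_two φ).symm
    · exact (hne2 (hφ.trans (fin4_add_two_add_two φ).symm)).elim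

/-- **TN9.** `N{c·ℓ_φ, 2I + m·ℓ_u, cu_χ, hI} ∉ C.lower` (`h = 2m+4`, `m ≥ 1`, `c ≥ 0`) [◇_h, RULE D, X⁺, `PermClosed C.upper`]: RULE D pairs the floor node `0` … (memo §1) -/
theorem ceilingApex_N_absent {h m c : ℤ} {C : MConfig} (hU : C.InDiamond h) (hDN : ∀ Z ∈ C.lower, RuleDMu4N C Z)
    (hDP : ∀ P ∈ C.upper, RuleDMu4P C P) (hX : XPlusClosed C) (hGu : PermClosed C.upper) (hh : h = 2 * m + 4) (hm : 1 ≤ m) (hc : 0 ≤ c)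
    {N : MCell} {φ u χ : Fin 4} (h0 : N 0 = floorLetter φ c) (h1 : N 1 = nodeTwoLetter u m) (h2 : N 2 = ceilingUnit h χ)
    (h3 : N 3 = (h, 0, 0)) : N ∉ C.lower := fun hN => by
  have hk : Adapted (N 0) (φ + 2) := by rw [h0]; exact (floorLetter_node φ c).1
  have hk0 : coord (N 0) (φ + 2) = 0 := by rw [h0]; exact (floorLetter_node φ c).2
  have hk' : Adapted (N 3) 0 := by rw [h3]; simp [Adapted]
  have hk'c : coord (N 3) 0 = h := by rw [h3]; simp [coord]
  have hne : coord (N 0) (φ + 2) ≠ coord (N 3) 0 := by rw [hk0, hk'c]; omega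
  have nob : ∀ P ∈ C.upper, ∀ r : Fin 4, (P 0).1 < (N 0).1 → N 0 = ray (P 0) r ((N 0).1 - (P 0).1) → r = φ :=
    fun P hP r hlt e => below_floorLetter (hU.2 P hP 0) hc (by omega) (h0.symm.trans e)
  rcases hDN N hN 0 3 (by decide) (φ + 2) 0 hk hk' hne with
    ⟨r, hr, P, hP, hZP⟩ | ⟨r, -, P, hP, hZP⟩ | ⟨a, a', ha, -, P, hP, -, hb1, hb2, -, -⟩
  · exact absurd ((nob P hP r hZP.2.1 hZP.2.2).trans (fin4_add_two_add_two φ).symm) hr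
  · have hd0 : 0 < (N 3).1 - (P 3).1 := by have := hZP.2.1; omega
    have e : ((h, 0, 0) : BPoint) = ray (P 3) r ((N 3).1 - (P 3).1) := by rw [← h3]; exact hZP.2.2
    have hP3 : OnCeiling h (P 3) := onCeiling_below_apex (hU.2 P hP 3) hd0 e
    exact twinCeiling_floor_absent_swap hU hDN hDP hX hGu hh hm hc ((hZP.1 0 (by decide)).trans h0)
      ((hZP.1 1 (by decide)).trans h1) ((hZP.1 2 (by decide)).trans h2) hP3 hP
  · have hφ := nob P hP a hb1 hb2
    rcases ha with e | ⟨-, hne2⟩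
    · exact absurd (e.symm.trans hφ) (fin4_ne_add_two φ).symm
    · exact (hne2 (hφ.trans (fin4_add_two_add_two φ).symm)).elim

/-- **TN6.** `N{c·ℓ_φ, 2I + m·ℓ_u, cu_χ, (m+2)·ℓ_ψ} ∉ C.lower` (`h = 2m+4`, `m ≥ 1`, `c ≥ 1`) [◇_h, RULE D, X⁺]: the tower server (floor node of the full letter … (memo §1) -/
theorem fullFloor_N_absent {h m c : ℤ} {C : MConfig} (hU : C.InDiamond h) (hDN : ∀ Z ∈ C.lower, RuleDMu4N C Z)
    (hDP : ∀ P ∈ C.upper, RuleDMu4P C P) (hX : XPlusClosed C) (hh : h = 2 * m + 4) (hm : 1 ≤ m) (hc : 1 ≤ c)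
    {N : MCell} {φ u χ ψ : Fin 4} (h0 : N 0 = floorLetter φ c) (h1 : N 1 = nodeTwoLetter u m) (h2 : N 2 = ceilingUnit h χ)
    (h3 : N 3 = floorLetter ψ (m + 2)) : N ∉ C.lower := fun hN => by
  obtain ⟨P, hP, hPN, d, -, hcd, hP0⟩ := towerServer hU (hDN N hN) (t := 0) (s := 3) (by decide) hc (by omega : (0 : ℤ) ≤ m + 2) h0 h3
  exact twinTower_full_absent hU hDN hDP hX hh hm hcd hP0 ((hPN 1 (by decide)).trans h1) ((hPN 2 (by decide)).trans h2)
    ((hPN 3 (by decide)).trans h3) hP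

/-- **TP8.** `P{c·ℓ_φ, 2I + m·ℓ_u, cu_χ, (m+1)·ℓ_ψ} ∉ C.upper` (`h = 2m+4`, `m ≥ 1`, `c ≥ 1`) [◇_h, RULE D, X⁺]: RULE D at `P` (top `h` of `cu_χ` against the top … (memo §1) -/
theorem subFull_P_absent {h m c : ℤ} {C : MConfig} (hU : C.InDiamond h) (hDN : ∀ Z ∈ C.lower, RuleDMu4N C Z)
    (hDP : ∀ P ∈ C.upper, RuleDMu4P C P) (hX : XPlusClosed C) (hh : h = 2 * m + 4) (hm : 1 ≤ m) (hc : 1 ≤ c)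
    {P : MCell} {φ u χ ψ : Fin 4} (h0 : P 0 = floorLetter φ c) (h1 : P 1 = nodeTwoLetter u m) (h2 : P 2 = ceilingUnit h χ)
    (h3 : P 3 = floorLetter ψ (m + 1)) : P ∉ C.upper := fun hP => by
  have hna : ¬ isApex (P 3) := by rw [h3]; exact floorLetter_not_isApex ψ (by omega)
  have hk : Adapted (P 3) ψ := by rw [h3]; exact (floorLetter_top ψ (m + 1)).1
  have hkh : coord (P 3) ψ ≠ h := by rw [h3, (floorLetter_top ψ (m + 1)).2]; omega
  obtain ⟨N, hN, hNP⟩ := upLine_of_ruleDMu4P hU hP (hDP P hP) (g := 2) (j := 3) (by decide)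
    (by rw [h2]; exact onCeiling_ceilingUnit h χ) hna hk hkh
  have he0 : 0 < (N 3).1 - (P 3).1 := by have := hNP.2.1; omega
  have e : N 3 = ray (floorLetter ψ (m + 1)) ψ ((N 3).1 - (P 3).1) := by rw [← h3]; exact hNP.2.2
  have he1 := above_subFullLetter hh (by omega) he0 (hU.1 N hN 3) e
  have hN3 : N 3 = floorLetter ψ (m + 1 + 1) := by rw [e, he1]; exact (ray_add _ ψ (m + 1) 1).symm
  rw [show m + 1 + 1 = m + 2 by ring] at hN3
  exact fullFloor_N_absent hU hDN hDP hX hh hm hc ((hNP.1 0 (by decide)).symm.trans h0)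
    ((hNP.1 1 (by decide)).symm.trans h1) ((hNP.1 2 (by decide)).symm.trans h2) hN3 hN

/-- **TP9.** `P{c·ℓ_φ, 2I + m·ℓ_u, cu_χ, s_k} ∉ C.upper` for the sub-ceiling letter `s_k = 2kI + (m+1−k)ℓ_v`, `1 ≤ k ≤ m` (`h = 2m+4`, `c ≥ 0`) [◇_h, RULE D, X⁺, … (memo §1) -/
theorem subCeil_P_absent {h m c k : ℤ} {C : MConfig} (hU : C.InDiamond h) (hDN : ∀ Z ∈ C.lower, RuleDMu4N C Z)
    (hDP : ∀ P ∈ C.upper, RuleDMu4P C P) (hX : XPlusClosed C) (hGu : PermClosed C.upper) (hh : h = 2 * m + 4) (hm : 1 ≤ m) (hc : 0 ≤ c)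
    (hk1 : 1 ≤ k) (hkm : k ≤ m) {P : MCell} {φ u χ v : Fin 4} (h0 : P 0 = floorLetter φ c) (h1 : P 1 = nodeTwoLetter u m)
    (h2 : P 2 = ceilingUnit h χ) (h3 : P 3 = subCeilLetter m v k) : P ∉ C.upper := fun hP => by
  have hna : ¬ isApex (P 3) := by rw [h3]; exact subCeilLetter_not_isApex v (by omega)
  have hk : Adapted (P 3) v := by rw [h3]; exact (subCeilLetter_top m v k).1
  have hkh : coord (P 3) v ≠ h := by rw [h3, (subCeilLetter_top m v k).2]; omega
  obtain ⟨N, hN, hNP⟩ := upLine_of_ruleDMu4P hU hP (hDP P hP) (g := 2) (j := 3) (by decide)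
    (by rw [h2]; exact onCeiling_ceilingUnit h χ) hna hk hkh
  have he0 : 0 < (N 3).1 - (P 3).1 := by have := hNP.2.1; omega
  have e : N 3 = ray (subCeilLetter m v k) v ((N 3).1 - (P 3).1) := by rw [← h3]; exact hNP.2.2
  have he1 := above_subCeilLetter hh (by omega) he0 (hU.1 N hN 3) e
  have hN3 : N 3 = ceilLetter h v (m + 1 - k) := by rw [e, he1]; exact subCeilLetter_up hh v k
  exact ceilLetter_N_absent hU hDN hDP hX hGu hh hm hc (d := m + 1 - k) (by omega) (by omega) ((hNP.1 0 (by decide)).symm.trans h0)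
    ((hNP.1 1 (by decide)).symm.trans h1) ((hNP.1 2 (by decide)).symm.trans h2) hN3 hN

theorem subCeilLetter_zero (m : ℤ) (v : Fin 4) : subCeilLetter m v 0 = floorLetter v (m + 1) := by
  show ray ((2 * 0, 0, 0) : BPoint) v (m + 1 - 0) = ray ((0, 0, 0) : BPoint) v (m + 1)
  rw [mul_zero, sub_zero]

theorem subCeilLetter_one (m : ℤ) (v : Fin 4) : subCeilLetter m v 1 = nodeTwoLetter v m := by
  show ray ((2 * 1, 0, 0) : BPoint) v (m + 1 - 1) = ray ((2, 0, 0) : BPoint) v m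
  rw [mul_one, add_sub_cancel_right]

theorem subCeilLetter_two (m : ℤ) (v : Fin 4) : subCeilLetter m v 2 = nodeFourLetter v (m - 1) := by
  show ray ((2 * 2, 0, 0) : BPoint) v (m + 1 - 2) = ray ((4, 0, 0) : BPoint) v (m - 1)
  rw [show (2 * 2 : ℤ) = 4 by norm_num, show m + 1 - 2 = m - 1 by ring]

theorem ceilLetter_zero (h : ℤ) (χ : Fin 4) : ceilLetter h χ 0 = ceilingUnit h χ := by
  show ray ((h - 2 - 2 * 0, 0, 0) : BPoint) χ (1 + 0) = ray ((h - 2, 0, 0) : BPoint) χ 1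
  rw [mul_zero, sub_zero, add_zero]

/-- **TN10.** `N{c·ℓ_φ, 2I + m·ℓ_u, cu_χ, s_k} ∉ C.lower`, `1 ≤ k ≤ m` (`h = 2m+4`, `c ≥ 1`) [◇_h, RULE D, X⁺, `PermClosed C.upper`]: RULE D pairs the floor node … (memo §1) -/
theorem subCeil_N_absent {h m c k : ℤ} {C : MConfig} (hU : C.InDiamond h) (hDN : ∀ Z ∈ C.lower, RuleDMu4N C Z)
    (hDP : ∀ P ∈ C.upper, RuleDMu4P C P) (hX : XPlusClosed C) (hGu : PermClosed C.upper) (hh : h = 2 * m + 4) (hm : 1 ≤ m) (hc : 1 ≤ c)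
    (hk1 : 1 ≤ k) (hkm : k ≤ m) {N : MCell} {φ u χ v : Fin 4} (h0 : N 0 = floorLetter φ c) (h1 : N 1 = nodeTwoLetter u m)
    (h2 : N 2 = ceilingUnit h χ) (h3 : N 3 = subCeilLetter m v k) : N ∉ C.lower := fun hN => by
  have hk : Adapted (N 0) (φ + 2) := by rw [h0]; exact (floorLetter_node φ c).1
  have hk0 : coord (N 0) (φ + 2) = 0 := by rw [h0]; exact (floorLetter_node φ c).2
  have hk' : Adapted (N 3) (v + 2) := by rw [h3]; exact (subCeilLetter_node m v k).1
  have hk'c : coord (N 3) (v + 2) = 2 * k := by rw [h3]; exact (subCeilLetter_node m v k).2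
  have hne : coord (N 0) (φ + 2) ≠ coord (N 3) (v + 2) := by rw [hk0, hk'c]; omega
  have nob : ∀ P ∈ C.upper, ∀ r : Fin 4, (P 0).1 < (N 0).1 → N 0 = ray (P 0) r ((N 0).1 - (P 0).1) → r = φ :=
    fun P hP r hlt e => below_floorLetter (hU.2 P hP 0) (by omega) (by omega) (h0.symm.trans e)
  rcases hDN N hN 0 3 (by decide) (φ + 2) (v + 2) hk hk' hne with
    ⟨r, hr, P, hP, hZP⟩ | ⟨r, hr, P, hP, hZP⟩ | ⟨a, a', ha, -, P, hP, -, hb1, hb2, -, -⟩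
  · exact absurd ((nob P hP r hZP.2.1 hZP.2.2).trans (fin4_add_two_add_two φ).symm) hr
  · have hd0 : 0 < (N 3).1 - (P 3).1 := by have := hZP.2.1; omega
    have e : subCeilLetter m v k = ray (P 3) r ((N 3).1 - (P 3).1) := by rw [← h3]; exact hZP.2.2
    have hr' : r ≠ v := fun e' => hr (by rw [e', fin4_add_two_add_two])
    have hP0 : P 0 = floorLetter φ c := (hZP.1 0 (by decide)).trans h0
    have hP1 : P 1 = nodeTwoLetter u m := (hZP.1 1 (by decide)).trans h1
    have hP2 : P 2 = ceilingUnit h χ := (hZP.1 2 (by decide)).trans h2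
    obtain ⟨k', hk'0, hk'k, hz⟩ := below_subCeilLetter_offRay hkm (hU.2 P hP 3) hd0 hr' e
    rcases (show k' = 0 ∨ 1 ≤ k' by omega) with hz0 | hz1
    · subst hz0
      rw [subCeilLetter_zero] at hz
      exact subFull_P_absent hU hDN hDP hX hh hm hc hP0 hP1 hP2 hz hP
    · exact subCeil_P_absent hU hDN hDP hX hGu hh hm (by omega) hz1 (by omega) hP0 hP1 hP2 hz hP
  · have hφ := nob P hP a hb1 hb2
    rcases ha with e | ⟨-, hne2⟩
    · exact absurd (e.symm.trans hφ) (fin4_ne_add_two φ).symm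
    · exact (hne2 (hφ.trans (fin4_add_two_add_two φ).symm)).elim

/-- **TP10.** `P{c·ℓ_φ, 2I + m·ℓ_u, cu_χ, (h−2)·I} ∉ C.upper` (`h = 2m+4`, `m ≥ 1`, `c ≥ 0`) [◇_h, RULE D, X⁺, `PermClosed C.upper`]: RULE D at `P` (top `h` of … (memo §1) -/
theorem subApex_P_absent {h m c : ℤ} {C : MConfig} (hU : C.InDiamond h) (hDN : ∀ Z ∈ C.lower, RuleDMu4N C Z)
    (hDP : ∀ P ∈ C.upper, RuleDMu4P C P) (hX : XPlusClosed C) (hGu : PermClosed C.upper) (hh : h = 2 * m + 4) (hm : 1 ≤ m) (hc : 0 ≤ c)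
    {P : MCell} {φ u χ : Fin 4} (h0 : P 0 = floorLetter φ c) (h1 : P 1 = nodeTwoLetter u m) (h2 : P 2 = ceilingUnit h χ)
    (h3 : P 3 = (h - 2, 0, 0)) : P ∉ C.upper := fun hP => by
  have hk : Adapted (P 2) χ := by rw [h2]; exact (ceilingUnit_top h χ).1
  have hkc : coord (P 2) χ = h - 2 + 2 * 1 := by rw [h2]; exact (ceilingUnit_top h χ).2
  have hk' : Adapted (P 3) 0 := by rw [h3]; simp [Adapted]
  have hk'c : coord (P 3) 0 = h - 2 := by rw [h3]; simp [coord]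
  have hne : coord (P 2) χ ≠ coord (P 3) 0 := by rw [hkc, hk'c]; omega
  have nocu : ∀ N ∈ C.lower, ∀ r : Fin 4, (P 2).1 < (N 2).1 → N 2 = ray (P 2) r ((N 2).1 - (P 2).1) → r = χ + 2 :=
    fun N hN r hlt e => by
      have e' : N 2 = ray (ceilingUnit h χ) r ((N 2).1 - (P 2).1) := by rw [← h2]; exact e
      exact (above_ceilingUnit (hU.1 N hN 2) (by omega) e').1
  rcases hDP P hP 2 3 (by decide) χ 0 hk hk' hne with ⟨r, hr, N, hN, hNP⟩ | ⟨r, -, N, hN, hNP⟩ | ⟨a, b, ha, -, N, hN, -, hg1, hg2, -, -⟩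
  · exact (hr (nocu N hN r hNP.2.1 hNP.2.2)).elim
  · have he0 : 0 < (N 3).1 - (P 3).1 := by have := hNP.2.1; omega
    have e : N 3 = ray ((h - 2, 0, 0) : BPoint) r ((N 3).1 - (P 3).1) := by rw [← h3]; exact hNP.2.2
    have he1 := above_subApex he0 (hU.1 N hN 3) e
    have hN3 : N 3 = ceilLetter h r 0 := by rw [e, he1, ceilLetter_zero]
    exact ceilLetter_N_absent hU hDN hDP hX hGu hh hm hc le_rfl (by omega) ((hNP.1 0 (by decide)).symm.trans h0)
      ((hNP.1 1 (by decide)).symm.trans h1) ((hNP.1 2 (by decide)).symm.trans h2) hN3 hN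
  · have ha' : a = χ + 2 := nocu N hN a hg1 hg2
    rcases ha with e | ⟨hap, -⟩
    · exact absurd (e.symm.trans ha') (fin4_ne_add_two χ)
    · exact absurd hap (by rw [h2]; exact ceilingUnit_not_isApex h χ)

/-- **TN11.** `N{c·ℓ_φ, 2I + m·ℓ_u, cu_χ, (h−2)·I} ∉ C.lower` (`h = 2m+4`, `m ≥ 1`, `c ≥ 1`) [◇_h, RULE D, X⁺, `PermClosed C.upper`]: RULE D pairs the floor node … (memo §1) -/
theorem subApex_N_absent {h m c : ℤ} {C : MConfig} (hU : C.InDiamond h) (hDN : ∀ Z ∈ C.lower, RuleDMu4N C Z)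
    (hDP : ∀ P ∈ C.upper, RuleDMu4P C P) (hX : XPlusClosed C) (hGu : PermClosed C.upper) (hh : h = 2 * m + 4) (hm : 1 ≤ m) (hc : 1 ≤ c)
    {N : MCell} {φ u χ : Fin 4} (h0 : N 0 = floorLetter φ c) (h1 : N 1 = nodeTwoLetter u m) (h2 : N 2 = ceilingUnit h χ)
    (h3 : N 3 = (h - 2, 0, 0)) : N ∉ C.lower := fun hN => by
  have hk : Adapted (N 0) (φ + 2) := by rw [h0]; exact (floorLetter_node φ c).1
  have hk0 : coord (N 0) (φ + 2) = 0 := by rw [h0]; exact (floorLetter_node φ c).2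
  have hk' : Adapted (N 3) 0 := by rw [h3]; simp [Adapted]
  have hk'c : coord (N 3) 0 = h - 2 := by rw [h3]; simp [coord]
  have hne : coord (N 0) (φ + 2) ≠ coord (N 3) 0 := by rw [hk0, hk'c]; omega
  have nob : ∀ P ∈ C.upper, ∀ r : Fin 4, (P 0).1 < (N 0).1 → N 0 = ray (P 0) r ((N 0).1 - (P 0).1) → r = φ :=
    fun P hP r hlt e => below_floorLetter (hU.2 P hP 0) (by omega) (by omega) (h0.symm.trans e)
  rcases hDN N hN 0 3 (by decide) (φ + 2) 0 hk hk' hne with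
    ⟨r, hr, P, hP, hZP⟩ | ⟨r, -, P, hP, hZP⟩ | ⟨a, a', ha, -, P, hP, -, hb1, hb2, -, -⟩
  · exact absurd ((nob P hP r hZP.2.1 hZP.2.2).trans (fin4_add_two_add_two φ).symm) hr
  · have hd0 : 0 < (N 3).1 - (P 3).1 := by have := hZP.2.1; omega
    have e : ((h - 2, 0, 0) : BPoint) = ray (P 3) r ((N 3).1 - (P 3).1) := by rw [← h3]; exact hZP.2.2
    have hP0 : P 0 = floorLetter φ c := (hZP.1 0 (by decide)).trans h0
    have hP1 : P 1 = nodeTwoLetter u m := (hZP.1 1 (by decide)).trans h1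
    have hP2 : P 2 = ceilingUnit h χ := (hZP.1 2 (by decide)).trans h2
    obtain ⟨k', hk'0, hk'm, hz⟩ := below_subApex hh (hU.2 P hP 3) hd0 e
    rcases (show k' = 0 ∨ 1 ≤ k' by omega) with hz0 | hz1
    · subst hz0
      rw [subCeilLetter_zero] at hz
      exact subFull_P_absent hU hDN hDP hX hh hm hc hP0 hP1 hP2 hz hP
    · exact subCeil_P_absent hU hDN hDP hX hGu hh hm (by omega) hz1 hk'm hP0 hP1 hP2 hz hP
  · have hφ := nob P hP a hb1 hb2
    rcases ha with e | ⟨-, hne2⟩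
    · exact absurd (e.symm.trans hφ) (fin4_ne_add_two φ).symm
    · exact (hne2 (hφ.trans (fin4_add_two_add_two φ).symm)).elim

/-- the letter TWO nodes below the ceiling on its ray: `t_k = 2k·I + (m − k)·ℓ_v` of ◇_{2m+4} (top coordinate `h − 4`). -/
abbrev subSubLetter (m : ℤ) (v : Fin 4) (k : ℤ) : BPoint := ray ((2 * k, 0, 0) : BPoint) v (m - k)

theorem subSubLetter_top (m : ℤ) (v : Fin 4) (k : ℤ) :
    Adapted (subSubLetter m v k) v ∧ coord (subSubLetter m v k) v = 2 * k + 2 * (m - k) := by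
  refine ⟨(adapted_ray_apex _ v _).1, ?_⟩
  rw [coord_ray_self, coord_of_isApex ⟨rfl, rfl⟩]

theorem subSubLetter_not_isApex {m k : ℤ} (v : Fin 4) (hk : m - k ≠ 0) : ¬ isApex (subSubLetter m v k) := by
  fin_cases v <;> simp [ray, isApex, hk] <;> omega

/-- above `t_k` along its ray there are at most two diamond steps (`h = 2m+4`). -/
theorem above_subSubLetter {h m k e : ℤ} {z : BPoint} {v : Fin 4} (hh : h = 2 * m + 4) (hk : k ≤ m) (he : 0 < e)
    (hz : InDiamond h z) (hze : z = ray (subSubLetter m v k) v e) : e = 1 ∨ e = 2 := by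
  have htop := hz.2.2.2
  rw [hze, show ray (subSubLetter m v k) v e = ray ((2 * k, 0, 0) : BPoint) v (m - k + e) from (ray_add _ v _ e).symm,
    top_ray_apex (2 * k) v (by omega)] at htop
  omega

theorem subSubLetter_up1 (m : ℤ) (v : Fin 4) (k : ℤ) : ray (subSubLetter m v k) v 1 = subCeilLetter m v k := by
  show ray (subSubLetter m v k) v 1 = ray ((2 * k, 0, 0) : BPoint) v (m + 1 - k)
  rw [show m + 1 - k = m - k + 1 by ring]; exact (ray_add _ v _ 1).symm

theorem subSubLetter_up2 {h m : ℤ} (hh : h = 2 * m + 4) (v : Fin 4) (k : ℤ) : ray (subSubLetter m v k) v 2 = ceilLetter h v (m + 1 - k) := by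
  show ray (subSubLetter m v k) v 2 = ray ((h - 2 - 2 * (m + 1 - k), 0, 0) : BPoint) v (1 + (m + 1 - k))
  rw [show (h - 2 - 2 * (m + 1 - k) : ℤ) = 2 * k by rw [hh]; ring, show (1 + (m + 1 - k) : ℤ) = m - k + 2 by ring]
  exact (ray_add _ v _ 2).symm

/-- **TP11.** `P{c·ℓ_φ, 2I + m·ℓ_u, cu_χ, t_k} ∉ C.upper` for `t_k = 2kI + (m−k)ℓ_v` two nodes below the ceiling, `1 ≤ k ≤ m − 1` (`h = 2m+4`, `c ≥ 1`) [◇_h, RULE … (memo §1) -/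
theorem subSub_P_absent {h m c k : ℤ} {C : MConfig} (hU : C.InDiamond h) (hDN : ∀ Z ∈ C.lower, RuleDMu4N C Z)
    (hDP : ∀ P ∈ C.upper, RuleDMu4P C P) (hX : XPlusClosed C) (hGu : PermClosed C.upper) (hh : h = 2 * m + 4) (hm : 1 ≤ m) (hc : 1 ≤ c)
    (hk1 : 1 ≤ k) (hkm : k ≤ m - 1) {P : MCell} {φ u χ v : Fin 4} (h0 : P 0 = floorLetter φ c) (h1 : P 1 = nodeTwoLetter u m)
    (h2 : P 2 = ceilingUnit h χ) (h3 : P 3 = subSubLetter m v k) : P ∉ C.upper := fun hP => by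
  have hna : ¬ isApex (P 3) := by rw [h3]; exact subSubLetter_not_isApex v (by omega)
  have hk : Adapted (P 3) v := by rw [h3]; exact (subSubLetter_top m v k).1
  have hkh : coord (P 3) v ≠ h := by rw [h3, (subSubLetter_top m v k).2]; omega
  obtain ⟨N, hN, hNP⟩ := upLine_of_ruleDMu4P hU hP (hDP P hP) (g := 2) (j := 3) (by decide)
    (by rw [h2]; exact onCeiling_ceilingUnit h χ) hna hk hkh
  have he0 : 0 < (N 3).1 - (P 3).1 := by have := hNP.2.1; omega
  have e : N 3 = ray (subSubLetter m v k) v ((N 3).1 - (P 3).1) := by rw [← h3]; exact hNP.2.2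
  have hN0 : N 0 = floorLetter φ c := (hNP.1 0 (by decide)).symm.trans h0
  have hN1 : N 1 = nodeTwoLetter u m := (hNP.1 1 (by decide)).symm.trans h1
  have hN2 : N 2 = ceilingUnit h χ := (hNP.1 2 (by decide)).symm.trans h2
  rcases above_subSubLetter hh (by omega) he0 (hU.1 N hN 3) e with he1 | he2
  · have hN3 : N 3 = subCeilLetter m v k := by rw [e, he1]; exact subSubLetter_up1 m v k
    exact subCeil_N_absent hU hDN hDP hX hGu hh hm hc hk1 (by omega) hN0 hN1 hN2 hN3 hN
  · have hN3 : N 3 = ceilLetter h v (m + 1 - k) := by rw [e, he2]; exact subSubLetter_up2 hh v k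
    exact ceilLetter_N_absent hU hDN hDP hX hGu hh hm (by omega) (d := m + 1 - k) (by omega) (by omega) hN0 hN1 hN2 hN3 hN

/-- **TP12.** `P{c·ℓ_φ, 2I + m·ℓ_u, cu_χ, (h−4)·I} ∉ C.upper` (`h = 2m+4`, `m ≥ 1`, `c ≥ 1`) [◇_h, RULE D, X⁺, `PermClosed C.upper`]: RULE D at `P` (top of `cu_χ` … (memo §1) -/
theorem subSubApex_P_absent {h m c : ℤ} {C : MConfig} (hU : C.InDiamond h) (hDN : ∀ Z ∈ C.lower, RuleDMu4N C Z)
    (hDP : ∀ P ∈ C.upper, RuleDMu4P C P) (hX : XPlusClosed C) (hGu : PermClosed C.upper) (hh : h = 2 * m + 4) (hm : 1 ≤ m) (hc : 1 ≤ c)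
    {P : MCell} {φ u χ : Fin 4} (h0 : P 0 = floorLetter φ c) (h1 : P 1 = nodeTwoLetter u m) (h2 : P 2 = ceilingUnit h χ)
    (h3 : P 3 = (h - 4, 0, 0)) : P ∉ C.upper := fun hP => by
  have hk : Adapted (P 2) χ := by rw [h2]; exact (ceilingUnit_top h χ).1
  have hkc : coord (P 2) χ = h - 2 + 2 * 1 := by rw [h2]; exact (ceilingUnit_top h χ).2
  have hk' : Adapted (P 3) 0 := by rw [h3]; simp [Adapted]
  have hk'c : coord (P 3) 0 = h - 4 := by rw [h3]; simp [coord]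
  have hne : coord (P 2) χ ≠ coord (P 3) 0 := by rw [hkc, hk'c]; omega
  have nocu : ∀ N ∈ C.lower, ∀ r : Fin 4, (P 2).1 < (N 2).1 → N 2 = ray (P 2) r ((N 2).1 - (P 2).1) → r = χ + 2 :=
    fun N hN r hlt e => by
      have e' : N 2 = ray (ceilingUnit h χ) r ((N 2).1 - (P 2).1) := by rw [← h2]; exact e
      exact (above_ceilingUnit (hU.1 N hN 2) (by omega) e').1
  rcases hDP P hP 2 3 (by decide) χ 0 hk hk' hne with ⟨r, hr, N, hN, hNP⟩ | ⟨r, -, N, hN, hNP⟩ | ⟨a, b, ha, -, N, hN, -, hg1, hg2, -, -⟩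
  · exact (hr (nocu N hN r hNP.2.1 hNP.2.2)).elim
  · have he0 : 0 < (N 3).1 - (P 3).1 := by have := hNP.2.1; omega
    have e : N 3 = ray ((h - 4, 0, 0) : BPoint) r ((N 3).1 - (P 3).1) := by rw [← h3]; exact hNP.2.2
    have hN0 : N 0 = floorLetter φ c := (hNP.1 0 (by decide)).symm.trans h0
    have hN1 : N 1 = nodeTwoLetter u m := (hNP.1 1 (by decide)).symm.trans h1
    have hN2 : N 2 = ceilingUnit h χ := (hNP.1 2 (by decide)).symm.trans h2
    have htop := (hU.1 N hN 3).2.2.2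
    rw [e, top_ray_apex (h - 4) r (by omega)] at htop
    rcases (show (N 3).1 - (P 3).1 = 1 ∨ (N 3).1 - (P 3).1 = 2 by omega) with he1 | he2
    · have hN3 : N 3 = subCeilLetter m r m := by
        rw [e, he1]; show _ = ray ((2 * m, 0, 0) : BPoint) r (m + 1 - m)
        rw [show (2 * m : ℤ) = h - 4 by rw [hh]; ring, show (m + 1 - m : ℤ) = 1 by ring]
      exact subCeil_N_absent hU hDN hDP hX hGu hh hm hc hm le_rfl hN0 hN1 hN2 hN3 hN
    · have hN3 : N 3 = ceilLetter h r 1 := by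
        rw [e, he2]; show _ = ray ((h - 2 - 2 * 1, 0, 0) : BPoint) r (1 + 1)
        rw [show (h - 2 - 2 * 1 : ℤ) = h - 4 by ring]; norm_num
      exact ceilLetter_N_absent hU hDN hDP hX hGu hh hm (by omega) (d := 1) (by norm_num) hm hN0 hN1 hN2 hN3 hN
  · have ha' : a = χ + 2 := nocu N hN a hg1 hg2
    rcases ha with e | ⟨hap, -⟩
    · exact absurd (e.symm.trans ha') (fin4_ne_add_two χ)
    · exact absurd hap (by rw [h2]; exact ceilingUnit_not_isApex h χ)

/-! ### §11b packaged, and ◇₈ census representatives (all peel round 2, kinds `B:DN` ∕ `B:DP`) -/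

theorem ceilLetter_N_absent_static {h m c d : ℤ} {C : MConfig} (hU : C.InDiamond h) (hG : C.G1Closed) (hS : C.StaticH1)
    (hh : h = 2 * m + 4) (hm : 1 ≤ m) (hc : 0 ≤ c) (hd : 0 ≤ d) (hdm : d ≤ m) {N : MCell} {φ u χ χ' : Fin 4}
    (h0 : N 0 = floorLetter φ c) (h1 : N 1 = nodeTwoLetter u m) (h2 : N 2 = ceilingUnit h χ) (h3 : N 3 = ceilLetter h χ' d) :
    N ∉ C.lower :=
  ceilLetter_N_absent hU hS.1.1 hS.1.2 hS.2.1 hG.2.1 hh hm hc hd hdm h0 h1 h2 h3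

theorem ceilingApex_N_absent_static {h m c : ℤ} {C : MConfig} (hU : C.InDiamond h) (hG : C.G1Closed) (hS : C.StaticH1)
    (hh : h = 2 * m + 4) (hm : 1 ≤ m) (hc : 0 ≤ c) {N : MCell} {φ u χ : Fin 4} (h0 : N 0 = floorLetter φ c)
    (h1 : N 1 = nodeTwoLetter u m) (h2 : N 2 = ceilingUnit h χ) (h3 : N 3 = (h, 0, 0)) : N ∉ C.lower :=
  ceilingApex_N_absent hU hS.1.1 hS.1.2 hS.2.1 hG.2.1 hh hm hc h0 h1 h2 h3

theorem fullFloor_N_absent_static {h m c : ℤ} {C : MConfig} (hU : C.InDiamond h) (hS : C.StaticH1) (hh : h = 2 * m + 4) (hm : 1 ≤ m)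
    (hc : 1 ≤ c) {N : MCell} {φ u χ ψ : Fin 4} (h0 : N 0 = floorLetter φ c) (h1 : N 1 = nodeTwoLetter u m) (h2 : N 2 = ceilingUnit h χ)
    (h3 : N 3 = floorLetter ψ (m + 2)) : N ∉ C.lower :=
  fullFloor_N_absent hU hS.1.1 hS.1.2 hS.2.1 hh hm hc h0 h1 h2 h3

theorem subFull_P_absent_static {h m c : ℤ} {C : MConfig} (hU : C.InDiamond h) (hS : C.StaticH1) (hh : h = 2 * m + 4) (hm : 1 ≤ m)
    (hc : 1 ≤ c) {P : MCell} {φ u χ ψ : Fin 4} (h0 : P 0 = floorLetter φ c) (h1 : P 1 = nodeTwoLetter u m) (h2 : P 2 = ceilingUnit h χ)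
    (h3 : P 3 = floorLetter ψ (m + 1)) : P ∉ C.upper :=
  subFull_P_absent hU hS.1.1 hS.1.2 hS.2.1 hh hm hc h0 h1 h2 h3

theorem subCeil_P_absent_static {h m c k : ℤ} {C : MConfig} (hU : C.InDiamond h) (hG : C.G1Closed) (hS : C.StaticH1)
    (hh : h = 2 * m + 4) (hm : 1 ≤ m) (hc : 0 ≤ c) (hk1 : 1 ≤ k) (hkm : k ≤ m) {P : MCell} {φ u χ v : Fin 4}
    (h0 : P 0 = floorLetter φ c) (h1 : P 1 = nodeTwoLetter u m) (h2 : P 2 = ceilingUnit h χ) (h3 : P 3 = subCeilLetter m v k) :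
    P ∉ C.upper :=
  subCeil_P_absent hU hS.1.1 hS.1.2 hS.2.1 hG.2.1 hh hm hc hk1 hkm h0 h1 h2 h3

theorem subCeil_N_absent_static {h m c k : ℤ} {C : MConfig} (hU : C.InDiamond h) (hG : C.G1Closed) (hS : C.StaticH1)
    (hh : h = 2 * m + 4) (hm : 1 ≤ m) (hc : 1 ≤ c) (hk1 : 1 ≤ k) (hkm : k ≤ m) {N : MCell} {φ u χ v : Fin 4}
    (h0 : N 0 = floorLetter φ c) (h1 : N 1 = nodeTwoLetter u m) (h2 : N 2 = ceilingUnit h χ) (h3 : N 3 = subCeilLetter m v k) :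
    N ∉ C.lower :=
  subCeil_N_absent hU hS.1.1 hS.1.2 hS.2.1 hG.2.1 hh hm hc hk1 hkm h0 h1 h2 h3

theorem subApex_P_absent_static {h m c : ℤ} {C : MConfig} (hU : C.InDiamond h) (hG : C.G1Closed) (hS : C.StaticH1)
    (hh : h = 2 * m + 4) (hm : 1 ≤ m) (hc : 0 ≤ c) {P : MCell} {φ u χ : Fin 4} (h0 : P 0 = floorLetter φ c)
    (h1 : P 1 = nodeTwoLetter u m) (h2 : P 2 = ceilingUnit h χ) (h3 : P 3 = (h - 2, 0, 0)) : P ∉ C.upper :=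
  subApex_P_absent hU hS.1.1 hS.1.2 hS.2.1 hG.2.1 hh hm hc h0 h1 h2 h3

theorem subApex_N_absent_static {h m c : ℤ} {C : MConfig} (hU : C.InDiamond h) (hG : C.G1Closed) (hS : C.StaticH1)
    (hh : h = 2 * m + 4) (hm : 1 ≤ m) (hc : 1 ≤ c) {N : MCell} {φ u χ : Fin 4} (h0 : N 0 = floorLetter φ c)
    (h1 : N 1 = nodeTwoLetter u m) (h2 : N 2 = ceilingUnit h χ) (h3 : N 3 = (h - 2, 0, 0)) : N ∉ C.lower :=
  subApex_N_absent hU hS.1.1 hS.1.2 hS.2.1 hG.2.1 hh hm hc h0 h1 h2 h3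

/-- ◇₈ `N[l-1|2I+2l-1|6I+l-1|6I+l-1]` (census var 29839, peel ROUND 2, `B:DN`): TN8 with `d = 0` and EQUAL phases `χ = χ'` (outside TN2). -/
def repTN8 : MCell := ![(1, -1, 0), (4, -2, 0), (7, -1, 0), (7, -1, 0)]
theorem repTN8_absent {C : MConfig} (hU : C.InDiamond 8) (hG : C.G1Closed) (hS : C.StaticH1) : repTN8 ∉ C.lower :=
  ceilLetter_N_absent_static hU hG hS (m := 2) (c := 1) (d := 0) (by norm_num) (by norm_num) (by norm_num) (by norm_num) (by norm_num)
    (φ := 2) (u := 2) (χ := 2) (χ' := 2) (by simp [repTN8, ray]) (by simp [repTN8, ray]) (by simp [repTN8, ray]) (by simp [repTN8, ray])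

/-- ◇₈ `N[2l-1|2I+2l-1|4I+2li|6I+l-1]` (census var 50395, ROUND 2, `B:DN`): TN8 with `c = 2`, `d = 1`, `χ' = 1` (`4I + 2ℓ_i`). -/
def repTN8b : MCell := ![(2, -2, 0), (4, -2, 0), (7, -1, 0), (6, 0, -2)]
theorem repTN8b_absent {C : MConfig} (hU : C.InDiamond 8) (hG : C.G1Closed) (hS : C.StaticH1) : repTN8b ∉ C.lower :=
  ceilLetter_N_absent_static hU hG hS (m := 2) (c := 2) (d := 1) (by norm_num) (by norm_num) (by norm_num) (by norm_num) (by norm_num)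
    (φ := 2) (u := 2) (χ := 2) (χ' := 1) (by simp [repTN8b, ray]) (by simp [repTN8b, ray]) (by simp [repTN8b, ray]) (by simp [repTN8b, ray])

/-- ◇₈ `N[l-1|2I+2l-1|6I+l-1|8I]` (census var 29847, ROUND 2, `B:DN`): TN9. -/
def repTN9 : MCell := ![(1, -1, 0), (4, -2, 0), (7, -1, 0), (8, 0, 0)]
theorem repTN9_absent {C : MConfig} (hU : C.InDiamond 8) (hG : C.G1Closed) (hS : C.StaticH1) : repTN9 ∉ C.lower :=
  ceilingApex_N_absent_static hU hG hS (m := 2) (c := 1) (by norm_num) (by norm_num) (by norm_num) (φ := 2) (u := 2) (χ := 2)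
    (by simp [repTN9, ray]) (by simp [repTN9, ray]) (by simp [repTN9, ray]) (by simp [repTN9])

/-- ◇₈ `N[l-1|4l-1|2I+2l-1|6I+l-1]` (census var 28507, ROUND 2, `B:DN`): TN6. -/
def repTN6 : MCell := ![(1, -1, 0), (4, -2, 0), (7, -1, 0), (4, -4, 0)]
theorem repTN6_absent {C : MConfig} (hU : C.InDiamond 8) (hS : C.StaticH1) : repTN6 ∉ C.lower :=
  fullFloor_N_absent_static hU hS (m := 2) (c := 1) (by norm_num) (by norm_num) (by norm_num) (φ := 2) (u := 2) (χ := 2) (ψ := 2)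
    (by simp [repTN6, ray]) (by simp [repTN6, ray]) (by simp [repTN6, ray]) (by simp [repTN6, ray])

/-- ◇₈ `P[l-1|3l-1|2I+2l-1|6I+l-1]` (census var 20780, ROUND 2, `B:DP`): TP8. -/
def repTP8 : MCell := ![(1, -1, 0), (4, -2, 0), (7, -1, 0), (3, -3, 0)]
theorem repTP8_absent {C : MConfig} (hU : C.InDiamond 8) (hS : C.StaticH1) : repTP8 ∉ C.upper :=
  subFull_P_absent_static hU hS (m := 2) (c := 1) (by norm_num) (by norm_num) (by norm_num) (φ := 2) (u := 2) (χ := 2) (ψ := 2)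
    (by simp [repTP8, ray]) (by simp [repTP8, ray]) (by simp [repTP8, ray]) (by simp [repTP8, ray])

/-- ◇₈ `N[l-1|2I+2l-1|4I+l-1|6I+l-1]` (census var 29587, ROUND 2, `B:DN`; r2fam classes R008–R012 at ◇₁₀): TN10 with `k = 2`. -/
def repTN10 : MCell := ![(1, -1, 0), (4, -2, 0), (7, -1, 0), (5, -1, 0)]
theorem repTN10_absent {C : MConfig} (hU : C.InDiamond 8) (hG : C.G1Closed) (hS : C.StaticH1) : repTN10 ∉ C.lower :=
  subCeil_N_absent_static hU hG hS (m := 2) (c := 1) (k := 2) (by norm_num) (by norm_num) (by norm_num) (by norm_num) (by norm_num)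
    (φ := 2) (u := 2) (χ := 2) (v := 2) (by simp [repTN10, ray]) (by simp [repTN10, ray]) (by simp [repTN10, ray]) (by simp [repTN10, ray])

/-- ◇₈ `N[l-1|2I+2l-1|2I+2l-1|6I+l-1]` (census var 29209, ROUND 2, `B:DN`): TN10 with `k = 1` and `u = v`. -/
def repTN10b : MCell := ![(1, -1, 0), (4, -2, 0), (7, -1, 0), (4, -2, 0)]
theorem repTN10b_absent {C : MConfig} (hU : C.InDiamond 8) (hG : C.G1Closed) (hS : C.StaticH1) : repTN10b ∉ C.lower :=
  subCeil_N_absent_static hU hG hS (m := 2) (c := 1) (k := 1) (by norm_num) (by norm_num) (by norm_num) (by norm_num) (by norm_num)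
    (φ := 2) (u := 2) (χ := 2) (v := 2) (by simp [repTN10b, ray]) (by simp [repTN10b, ray]) (by simp [repTN10b, ray])
    (by simp [repTN10b, ray])

/-- ◇₈ `P[O|2I+2l-1|6I|6I+l-1]` (census var 7454, ROUND 2, `B:DP`): TP10 with `c = 0`. -/
def repTP10 : MCell := ![(0, 0, 0), (4, -2, 0), (7, -1, 0), (6, 0, 0)]
theorem repTP10_absent {C : MConfig} (hU : C.InDiamond 8) (hG : C.G1Closed) (hS : C.StaticH1) : repTP10 ∉ C.upper :=
  subApex_P_absent_static hU hG hS (m := 2) (c := 0) (by norm_num) (by norm_num) (by norm_num) (φ := 0) (u := 2) (χ := 2)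
    (by simp [repTP10, ray]) (by simp [repTP10, ray]) (by simp [repTP10, ray]) (by simp [repTP10])

/-- ◇₈ `N[l-1|2I+2l-1|6I|6I+l-1]` (census var 29803, ROUND 2, `B:DN`): TN11. -/
def repTN11 : MCell := ![(1, -1, 0), (4, -2, 0), (7, -1, 0), (6, 0, 0)]
theorem repTN11_absent {C : MConfig} (hU : C.InDiamond 8) (hG : C.G1Closed) (hS : C.StaticH1) : repTN11 ∉ C.lower :=
  subApex_N_absent_static hU hG hS (m := 2) (c := 1) (by norm_num) (by norm_num) (by norm_num) (φ := 2) (u := 2) (χ := 2)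
    (by simp [repTN11, ray]) (by simp [repTN11, ray]) (by simp [repTN11, ray]) (by simp [repTN11])


/-- ◇₈ `P[l-1|2I+l1|2I+2l-1|6I+l-1]` (census var 26940, ROUND 2, `B:DP`): TP11 with `k = 1` (`t_1 = 2I + ℓ_1`). -/
def repTP11 : MCell := ![(1, -1, 0), (4, -2, 0), (7, -1, 0), (3, 1, 0)]
theorem repTP11_absent {C : MConfig} (hU : C.InDiamond 8) (hG : C.G1Closed) (hS : C.StaticH1) : repTP11 ∉ C.upper :=
  subSub_P_absent hU hS.1.1 hS.1.2 hS.2.1 hG.2.1 (m := 2) (c := 1) (k := 1) (by norm_num) (by norm_num) (by norm_num) (by norm_num)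
    (by norm_num) (φ := 2) (u := 2) (χ := 2) (v := 0) (by simp [repTP11, ray]) (by simp [repTP11, ray]) (by simp [repTP11, ray])
    (by simp [repTP11, ray])

/-- ◇₈ `P[l-1|2I+2l-1|4I|6I+l-1]` (census var 29354, ROUND 2, `B:DP`): TP12. -/
def repTP12 : MCell := ![(1, -1, 0), (4, -2, 0), (7, -1, 0), (4, 0, 0)]
theorem repTP12_absent {C : MConfig} (hU : C.InDiamond 8) (hG : C.G1Closed) (hS : C.StaticH1) : repTP12 ∉ C.upper :=
  subSubApex_P_absent hU hS.1.1 hS.1.2 hS.2.1 hG.2.1 (m := 2) (c := 1) (by norm_num) (by norm_num) (by norm_num) (φ := 2) (u := 2) (χ := 2)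
    (by simp [repTP12, ray]) (by simp [repTP12, ray]) (by simp [repTP12, ray]) (by simp [repTP12])

/-! ## §12 TWO CEILING-LINE LETTERS OVER THE TWIN-FORK BASE `{c·ℓ_φ, 2I + m·ℓ_u}` (control g20, v1.4) (memo §1, §3) -/

theorem ceilLetter_not_isApex {h d : ℤ} (v : Fin 4) (hd : 1 + d ≠ 0) : ¬ isApex (ceilLetter h v d) := by
  fin_cases v <;> simp [ray, isApex, hd] <;> omega

theorem ceilLetter_neg_one (h : ℤ) (v : Fin 4) : ceilLetter h v (-1) = (h, 0, 0) := by
  fin_cases v <;> simp [ray]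

/-- `y_{m+1} = (m+2)·ℓ` (`h = 2m+4`). -/
theorem ceilLetter_full {h m : ℤ} (hh : h = 2 * m + 4) (v : Fin 4) : ceilLetter h v (m + 1) = floorLetter v (m + 2) := by
  show ray ((h - 2 - 2 * (m + 1), 0, 0) : BPoint) v (1 + (m + 1)) = ray ((0, 0, 0) : BPoint) v (m + 2)
  rw [show (h - 2 - 2 * (m + 1) : ℤ) = 0 by omega, show (1 + (m + 1) : ℤ) = m + 2 by ring]

/-- ABOVE a ceiling-line letter `y_d` (`d ≥ 0`) in ◇_h: only the off-ray step up the node direction, `y_d + e·ℓ_{v+2} = y_{d−e}`, `e ≤ d + 1`. -/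
theorem above_ceilLetter_offRay {h d e : ℤ} {z : BPoint} {v r : Fin 4} (hd : 0 ≤ d) (hz : InDiamond h z) (he : 0 < e)
    (heq : z = ray (ceilLetter h v d) r e) : r = v + 2 ∧ e ≤ d + 1 ∧ z = ceilLetter h v (d - e) := by
  subst heq
  obtain ⟨hax, h1, -, h3⟩ := hz
  simp only [AxisPt, absCharge, chargeOf, ray, Prod.mk.injEq] at hax h1 h3 ⊢
  fin_cases v <;> fin_cases r <;> simp at hax h1 h3 ⊢ <;>
    (simp only [abs_eq_max_neg, max_def] at h1 h3; split_ifs at h1 h3 <;> omega)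

/-- BELOW a ceiling-line letter `y_d` (`d ≥ 0`) OFF its ray in ◇_h: only `y_{d+e}`, and its node `h − 2 − 2(d+e)` is `≥ 0`. -/
theorem below_ceilLetter_offRay {h d e : ℤ} {z : BPoint} {v r : Fin 4} (hd : 0 ≤ d) (hz : InDiamond h z) (he : 0 < e)
    (hr : r ≠ v) (heq : ceilLetter h v d = ray z r e) : z = ceilLetter h v (d + e) ∧ 2 * (d + e) ≤ h - 2 := by
  obtain ⟨α, a, b⟩ := z
  obtain ⟨hax, h1, -, -⟩ := hz
  simp only [AxisPt, absCharge, chargeOf, ray, Prod.mk.injEq] at hax h1 heq ⊢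
  fin_cases v <;> fin_cases r <;> simp at hax h1 heq hr ⊢ <;>
    (simp only [abs_eq_max_neg, max_def] at h1; split_ifs at h1 <;> omega)

/-- TN3 in the slot arrangement of this section (floor letter on slot 0, `hI` on slot 2, the free letter on slot 3): no symmetry needed, the child
is the twin fork of §6 itself. -/
theorem twinFloor_N_absent_slot3 {h m c : ℤ} {C : MConfig} (hU : C.InDiamond h) (hDN : ∀ Z ∈ C.lower, RuleDMu4N C Z)
    (hDP : ∀ P ∈ C.upper, RuleDMu4P C P) (hX : XPlusClosed C) (hh : h = 2 * m + 4) (hm : 1 ≤ m) (hc : 0 ≤ c)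
    {N : MCell} {φ u k : Fin 4} (h0 : N 0 = floorLetter φ c) (h1 : N 1 = nodeTwoLetter u m) (h2 : N 2 = (h, 0, 0))
    (hk : Adapted (N 3) k) (hk0 : coord (N 3) k ≠ 0) : N ∉ C.lower := fun hN => by
  have hk' : Adapted (N 0) (φ + 2) := by rw [h0]; exact (floorLetter_node φ c).1
  have hk'0 : coord (N 0) (φ + 2) = 0 := by rw [h0]; exact (floorLetter_node φ c).2
  have hne : coord (N 3) k ≠ coord (N 0) (φ + 2) := by rw [hk'0]; exact hk0
  have nob : ∀ P ∈ C.upper, ∀ r : Fin 4, (P 0).1 < (N 0).1 → N 0 = ray (P 0) r ((N 0).1 - (P 0).1) → r = φ :=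
    fun P hP r hlt e => below_floorLetter (hU.2 P hP 0) hc (by omega) (h0.symm.trans e)
  rcases hDN N hN 3 0 (by decide) k (φ + 2) hk hk' hne with
    ⟨r, -, P, hP, hZP⟩ | ⟨r, hr, P, hP, hZP⟩ | ⟨a, a', -, ha', P, hP, -, -, -, hc1, hc2⟩
  · exact twinForkFamily_absent hU hDN hDP hX hh hm hc ((hZP.1 0 (by decide)).trans h0) ((hZP.1 1 (by decide)).trans h1)
      ((hZP.1 2 (by decide)).trans h2) hP
  · exact absurd ((nob P hP r hZP.2.1 hZP.2.2).trans (fin4_add_two_add_two φ).symm) hr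
  · have hφ := nob P hP a' hc1 hc2
    rcases ha' with e | ⟨-, hne2⟩
    · exact absurd (e.symm.trans hφ) (fin4_ne_add_two φ).symm
    · exact (hne2 (hφ.trans (fin4_add_two_add_two φ).symm)).elim

/-- **TP13.** `P{c·ℓ_φ, 2I + m·ℓ_u, y_1, y'_{d'}} ∉ C.upper`, `y_1 = (h−4)I + 2ℓ_v`, `y'_{d'} = (h−2−2d')I + (1+d')ℓ_{v'}`, `1 ≤ d' ≤ m`, `c ≥ 0` (`h = 2m+4`) … (memo §1) -/
theorem ceilPairOne_P_absent {h m c d' : ℤ} {C : MConfig} (hU : C.InDiamond h) (hDN : ∀ Z ∈ C.lower, RuleDMu4N C Z)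
    (hDP : ∀ P ∈ C.upper, RuleDMu4P C P) (hX : XPlusClosed C) (hGu : PermClosed C.upper) (hh : h = 2 * m + 4) (hm : 1 ≤ m) (hc : 0 ≤ c)
    (hd1 : 1 ≤ d') (hdm : d' ≤ m) {P : MCell} {φ u v v' : Fin 4} (h0 : P 0 = floorLetter φ c) (h1 : P 1 = nodeTwoLetter u m)
    (h2 : P 2 = ceilLetter h v 1) (h3 : P 3 = ceilLetter h v' d') : P ∉ C.upper := fun hP => by
  have hna : ¬ isApex (P 2) := by rw [h2]; exact ceilLetter_not_isApex v (by norm_num)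
  have hk : Adapted (P 2) (v + 2) := by rw [h2]; exact (ceilLetter_node h v 1).1
  have hkh : coord (P 2) (v + 2) ≠ h := by rw [h2, (ceilLetter_node h v 1).2]; omega
  obtain ⟨N, hN, hNP⟩ := upLine_of_ruleDMu4P hU hP (hDP P hP) (g := 3) (j := 2) (by decide)
    (by rw [h3]; exact onCeiling_ceilLetter (by omega) v') hna hk hkh
  have he0 : 0 < (N 2).1 - (P 2).1 := by have := hNP.2.1; omega
  have e : N 2 = ray (ceilLetter h v 1) (v + 2) ((N 2).1 - (P 2).1) := by rw [← h2]; exact hNP.2.2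
  obtain ⟨-, hle, hN2⟩ := above_ceilLetter_offRay (by norm_num) (hU.1 N hN 2) he0 e
  have hN0 : N 0 = floorLetter φ c := (hNP.1 0 (by decide)).symm.trans h0
  have hN1 : N 1 = nodeTwoLetter u m := (hNP.1 1 (by decide)).symm.trans h1
  have hN3 : N 3 = ceilLetter h v' d' := (hNP.1 3 (by decide)).symm.trans h3
  rcases (show (N 2).1 - (P 2).1 = 1 ∨ (N 2).1 - (P 2).1 = 2 by omega) with he1 | he2
  · rw [he1, show (1 - 1 : ℤ) = 0 by norm_num, ceilLetter_zero] at hN2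
    exact ceilLetter_N_absent hU hDN hDP hX hGu hh hm hc (d := d') (by omega) hdm hN0 hN1 hN2 hN3 hN
  · rw [he2, show (1 - 2 : ℤ) = -1 by norm_num, ceilLetter_neg_one] at hN2
    exact twinFloor_N_absent_slot3 hU hDN hDP hX hh hm hc hN0 hN1 hN2 (k := v' + 2)
      (by rw [hN3]; exact (ceilLetter_node h v' d').1) (by rw [hN3, (ceilLetter_node h v' d').2]; omega) hN

/-- **TP13F.**  `P{c·ℓ_φ, 2I + m·ℓ_u, y_1, (m+2)·ℓ_ψ} ∉ C.upper` (`c ≥ 1`, `h = 2m+4`) [◇_h, RULE D, X⁺; no symmetry]: above `y_1` sit `cu_v` (TN6) and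
`hI` (TN0). -/
theorem ceilPairOneFull_P_absent {h m c : ℤ} {C : MConfig} (hU : C.InDiamond h) (hDN : ∀ Z ∈ C.lower, RuleDMu4N C Z)
    (hDP : ∀ P ∈ C.upper, RuleDMu4P C P) (hX : XPlusClosed C) (hh : h = 2 * m + 4) (hm : 1 ≤ m) (hc : 1 ≤ c)
    {P : MCell} {φ u v ψ : Fin 4} (h0 : P 0 = floorLetter φ c) (h1 : P 1 = nodeTwoLetter u m) (h2 : P 2 = ceilLetter h v 1)
    (h3 : P 3 = floorLetter ψ (m + 2)) : P ∉ C.upper := fun hP => by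
  have hna : ¬ isApex (P 2) := by rw [h2]; exact ceilLetter_not_isApex v (by norm_num)
  have hk : Adapted (P 2) (v + 2) := by rw [h2]; exact (ceilLetter_node h v 1).1
  have hkh : coord (P 2) (v + 2) ≠ h := by rw [h2, (ceilLetter_node h v 1).2]; omega
  obtain ⟨N, hN, hNP⟩ := upLine_of_ruleDMu4P hU hP (hDP P hP) (g := 3) (j := 2) (by decide)
    (by rw [h3]; exact onCeiling_fullLetter hh (by omega) ψ) hna hk hkh
  have he0 : 0 < (N 2).1 - (P 2).1 := by have := hNP.2.1; omega
  have e : N 2 = ray (ceilLetter h v 1) (v + 2) ((N 2).1 - (P 2).1) := by rw [← h2]; exact hNP.2.2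
  obtain ⟨-, hle, hN2⟩ := above_ceilLetter_offRay (by norm_num) (hU.1 N hN 2) he0 e
  have hN0 : N 0 = floorLetter φ c := (hNP.1 0 (by decide)).symm.trans h0
  have hN1 : N 1 = nodeTwoLetter u m := (hNP.1 1 (by decide)).symm.trans h1
  have hN3 : N 3 = floorLetter ψ (m + 2) := (hNP.1 3 (by decide)).symm.trans h3
  rcases (show (N 2).1 - (P 2).1 = 1 ∨ (N 2).1 - (P 2).1 = 2 by omega) with he1 | he2
  · rw [he1, show (1 - 1 : ℤ) = 0 by norm_num, ceilLetter_zero] at hN2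
    exact fullFloor_N_absent hU hDN hDP hX hh hm hc hN0 hN1 hN2 hN3 hN
  · rw [he2, show (1 - 2 : ℤ) = -1 by norm_num, ceilLetter_neg_one] at hN2
    exact twinTower_N_absent hU hDN hDP hX hh hm (by omega) (by omega : (0 : ℤ) ≤ m + 2) (Or.inl hc) hN0 hN1 hN2 hN3 hN

/-- **TN12.** `N{c·ℓ_φ, 2I + m·ℓ_u, y_1, y'_{d'}} ∉ C.lower`, `1 ≤ d' ≤ m`, `c ≥ 1` (`h = 2m+4`) [◇_h, RULE D, X⁺, `PermClosed C.upper`]: RULE D on the floor node … (memo §1) -/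
theorem ceilPairOne_N_absent {h m c d' : ℤ} {C : MConfig} (hU : C.InDiamond h) (hDN : ∀ Z ∈ C.lower, RuleDMu4N C Z)
    (hDP : ∀ P ∈ C.upper, RuleDMu4P C P) (hX : XPlusClosed C) (hGu : PermClosed C.upper) (hh : h = 2 * m + 4) (hm : 1 ≤ m) (hc : 1 ≤ c)
    (hd1 : 1 ≤ d') (hdm : d' ≤ m) {N : MCell} {φ u v v' : Fin 4} (h0 : N 0 = floorLetter φ c) (h1 : N 1 = nodeTwoLetter u m)
    (h2 : N 2 = ceilLetter h v 1) (h3 : N 3 = ceilLetter h v' d') : N ∉ C.lower := fun hN => by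
  have hk : Adapted (N 0) (φ + 2) := by rw [h0]; exact (floorLetter_node φ c).1
  have hk0 : coord (N 0) (φ + 2) = 0 := by rw [h0]; exact (floorLetter_node φ c).2
  have hk' : Adapted (N 3) (v' + 2) := by rw [h3]; exact (ceilLetter_node h v' d').1
  have hk'c : coord (N 3) (v' + 2) = h - 2 - 2 * d' := by rw [h3]; exact (ceilLetter_node h v' d').2
  have hne : coord (N 0) (φ + 2) ≠ coord (N 3) (v' + 2) := by rw [hk0, hk'c]; omega
  have nob : ∀ P ∈ C.upper, ∀ r : Fin 4, (P 0).1 < (N 0).1 → N 0 = ray (P 0) r ((N 0).1 - (P 0).1) → r = φ :=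
    fun P hP r hlt e => below_floorLetter (hU.2 P hP 0) (by omega) (by omega) (h0.symm.trans e)
  rcases hDN N hN 0 3 (by decide) (φ + 2) (v' + 2) hk hk' hne with
    ⟨r, hr, P, hP, hZP⟩ | ⟨r, hr, P, hP, hZP⟩ | ⟨a, a', ha, -, P, hP, -, hb1, hb2, -, -⟩
  · exact absurd ((nob P hP r hZP.2.1 hZP.2.2).trans (fin4_add_two_add_two φ).symm) hr
  · have hd0 : 0 < (N 3).1 - (P 3).1 := by have := hZP.2.1; omega
    have e : ceilLetter h v' d' = ray (P 3) r ((N 3).1 - (P 3).1) := by rw [← h3]; exact hZP.2.2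
    have hr' : r ≠ v' := fun e' => hr (by rw [e', fin4_add_two_add_two])
    obtain ⟨hP3, hle⟩ := below_ceilLetter_offRay (by omega) (hU.2 P hP 3) hd0 hr' e
    have hP0 : P 0 = floorLetter φ c := (hZP.1 0 (by decide)).trans h0
    have hP1 : P 1 = nodeTwoLetter u m := (hZP.1 1 (by decide)).trans h1
    have hP2 : P 2 = ceilLetter h v 1 := (hZP.1 2 (by decide)).trans h2
    by_cases htop : d' + ((N 3).1 - (P 3).1) ≤ m
    · exact ceilPairOne_P_absent hU hDN hDP hX hGu hh hm (by omega) (d' := d' + ((N 3).1 - (P 3).1)) (by omega) htop hP0 hP1 hP2 hP3 hP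
    · have hdf : d' + ((N 3).1 - (P 3).1) = m + 1 := by omega
      rw [hdf, ceilLetter_full hh] at hP3
      exact ceilPairOneFull_P_absent hU hDN hDP hX hh hm hc hP0 hP1 hP2 hP3 hP
  · have hφ := nob P hP a hb1 hb2
    rcases ha with e | ⟨-, hne2⟩
    · exact absurd (e.symm.trans hφ) (fin4_ne_add_two φ).symm
    · exact (hne2 (hφ.trans (fin4_add_two_add_two φ).symm)).elim

/-- **TP14.** `P{c·ℓ_φ, 2I + m·ℓ_u, y_2, y'_{d'}} ∉ C.upper`, `y_2 = (h−6)I + 3ℓ_v`, `2 ≤ d' ≤ m`, `c ≥ 1` (`h = 2m+4`) [◇_h, RULE D, X⁺, `PermClosed C.upper`]: … (memo §1) -/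
theorem ceilPairTwo_P_absent {h m c d' : ℤ} {C : MConfig} (hU : C.InDiamond h) (hDN : ∀ Z ∈ C.lower, RuleDMu4N C Z)
    (hDP : ∀ P ∈ C.upper, RuleDMu4P C P) (hX : XPlusClosed C) (hGu : PermClosed C.upper) (hh : h = 2 * m + 4) (hm : 1 ≤ m) (hc : 1 ≤ c)
    (hd2 : 2 ≤ d') (hdm : d' ≤ m) {P : MCell} {φ u v v' : Fin 4} (h0 : P 0 = floorLetter φ c) (h1 : P 1 = nodeTwoLetter u m)
    (h2 : P 2 = ceilLetter h v 2) (h3 : P 3 = ceilLetter h v' d') : P ∉ C.upper := fun hP => by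
  have hna : ¬ isApex (P 2) := by rw [h2]; exact ceilLetter_not_isApex v (by norm_num)
  have hk : Adapted (P 2) (v + 2) := by rw [h2]; exact (ceilLetter_node h v 2).1
  have hkh : coord (P 2) (v + 2) ≠ h := by rw [h2, (ceilLetter_node h v 2).2]; omega
  obtain ⟨N, hN, hNP⟩ := upLine_of_ruleDMu4P hU hP (hDP P hP) (g := 3) (j := 2) (by decide)
    (by rw [h3]; exact onCeiling_ceilLetter (by omega) v') hna hk hkh
  have he0 : 0 < (N 2).1 - (P 2).1 := by have := hNP.2.1; omega
  have e : N 2 = ray (ceilLetter h v 2) (v + 2) ((N 2).1 - (P 2).1) := by rw [← h2]; exact hNP.2.2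
  obtain ⟨-, hle, hN2⟩ := above_ceilLetter_offRay (by norm_num) (hU.1 N hN 2) he0 e
  have hN0 : N 0 = floorLetter φ c := (hNP.1 0 (by decide)).symm.trans h0
  have hN1 : N 1 = nodeTwoLetter u m := (hNP.1 1 (by decide)).symm.trans h1
  have hN3 : N 3 = ceilLetter h v' d' := (hNP.1 3 (by decide)).symm.trans h3
  rcases (show (N 2).1 - (P 2).1 = 1 ∨ (N 2).1 - (P 2).1 = 2 ∨ (N 2).1 - (P 2).1 = 3 by omega) with he1 | he2 | he3
  · rw [he1, show (2 - 1 : ℤ) = 1 by norm_num] at hN2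
    exact ceilPairOne_N_absent hU hDN hDP hX hGu hh hm hc (d' := d') (by omega) hdm hN0 hN1 hN2 hN3 hN
  · rw [he2, show (2 - 2 : ℤ) = 0 by norm_num, ceilLetter_zero] at hN2
    exact ceilLetter_N_absent hU hDN hDP hX hGu hh hm (by omega) (d := d') (by omega) hdm hN0 hN1 hN2 hN3 hN
  · rw [he3, show (2 - 3 : ℤ) = -1 by norm_num, ceilLetter_neg_one] at hN2
    exact twinFloor_N_absent_slot3 hU hDN hDP hX hh hm (by omega) hN0 hN1 hN2 (k := v' + 2)
      (by rw [hN3]; exact (ceilLetter_node h v' d').1) (by rw [hN3, (ceilLetter_node h v' d').2]; omega) hN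

/-! ### §12b packaged, and ◇₈ census representatives (all peel round 2) -/

theorem ceilPairOne_P_absent_static {h m c d' : ℤ} {C : MConfig} (hU : C.InDiamond h) (hG : C.G1Closed) (hS : C.StaticH1)
    (hh : h = 2 * m + 4) (hm : 1 ≤ m) (hc : 0 ≤ c) (hd1 : 1 ≤ d') (hdm : d' ≤ m) {P : MCell} {φ u v v' : Fin 4}
    (h0 : P 0 = floorLetter φ c) (h1 : P 1 = nodeTwoLetter u m) (h2 : P 2 = ceilLetter h v 1) (h3 : P 3 = ceilLetter h v' d') :
    P ∉ C.upper :=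
  ceilPairOne_P_absent hU hS.1.1 hS.1.2 hS.2.1 hG.2.1 hh hm hc hd1 hdm h0 h1 h2 h3

theorem ceilPairOneFull_P_absent_static {h m c : ℤ} {C : MConfig} (hU : C.InDiamond h) (hS : C.StaticH1) (hh : h = 2 * m + 4)
    (hm : 1 ≤ m) (hc : 1 ≤ c) {P : MCell} {φ u v ψ : Fin 4} (h0 : P 0 = floorLetter φ c) (h1 : P 1 = nodeTwoLetter u m)
    (h2 : P 2 = ceilLetter h v 1) (h3 : P 3 = floorLetter ψ (m + 2)) : P ∉ C.upper :=
  ceilPairOneFull_P_absent hU hS.1.1 hS.1.2 hS.2.1 hh hm hc h0 h1 h2 h3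

theorem ceilPairOne_N_absent_static {h m c d' : ℤ} {C : MConfig} (hU : C.InDiamond h) (hG : C.G1Closed) (hS : C.StaticH1)
    (hh : h = 2 * m + 4) (hm : 1 ≤ m) (hc : 1 ≤ c) (hd1 : 1 ≤ d') (hdm : d' ≤ m) {N : MCell} {φ u v v' : Fin 4}
    (h0 : N 0 = floorLetter φ c) (h1 : N 1 = nodeTwoLetter u m) (h2 : N 2 = ceilLetter h v 1) (h3 : N 3 = ceilLetter h v' d') :
    N ∉ C.lower :=
  ceilPairOne_N_absent hU hS.1.1 hS.1.2 hS.2.1 hG.2.1 hh hm hc hd1 hdm h0 h1 h2 h3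

theorem ceilPairTwo_P_absent_static {h m c d' : ℤ} {C : MConfig} (hU : C.InDiamond h) (hG : C.G1Closed) (hS : C.StaticH1)
    (hh : h = 2 * m + 4) (hm : 1 ≤ m) (hc : 1 ≤ c) (hd2 : 2 ≤ d') (hdm : d' ≤ m) {P : MCell} {φ u v v' : Fin 4}
    (h0 : P 0 = floorLetter φ c) (h1 : P 1 = nodeTwoLetter u m) (h2 : P 2 = ceilLetter h v 2) (h3 : P 3 = ceilLetter h v' d') :
    P ∉ C.upper :=
  ceilPairTwo_P_absent hU hS.1.1 hS.1.2 hS.2.1 hG.2.1 hh hm hc hd2 hdm h0 h1 h2 h3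

/-- ◇₈ `P[l-1|2I+2l-1|4I+2l-1|4I+2l-1]` (census var 29760, ROUND 2, `B:DP`): TP13 with `d' = 1`, all phases `−1`. -/
def repTP13 : MCell := ![(1, -1, 0), (4, -2, 0), (6, -2, 0), (6, -2, 0)]
theorem repTP13_absent {C : MConfig} (hU : C.InDiamond 8) (hG : C.G1Closed) (hS : C.StaticH1) : repTP13 ∉ C.upper :=
  ceilPairOne_P_absent_static hU hG hS (m := 2) (c := 1) (d' := 1) (by norm_num) (by norm_num) (by norm_num) (by norm_num) (by norm_num)
    (φ := 2) (u := 2) (v := 2) (v' := 2) (by simp [repTP13, ray]) (by simp [repTP13, ray]) (by simp [repTP13, ray]) (by simp [repTP13, ray])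

/-- ◇₈ `P[O|2I+2l-1|4I+2l-1|4I+2li]` (census var 7412, ROUND 2, `B:DP`): TP13 with `c = 0` and two phases. -/
def repTP13b : MCell := ![(0, 0, 0), (4, -2, 0), (6, -2, 0), (6, 0, -2)]
theorem repTP13b_absent {C : MConfig} (hU : C.InDiamond 8) (hG : C.G1Closed) (hS : C.StaticH1) : repTP13b ∉ C.upper :=
  ceilPairOne_P_absent_static hU hG hS (m := 2) (c := 0) (d' := 1) (by norm_num) (by norm_num) (by norm_num) (by norm_num) (by norm_num)
    (φ := 0) (u := 2) (v := 2) (v' := 1) (by simp [repTP13b, ray]) (by simp [repTP13b, ray]) (by simp [repTP13b, ray]) (by simp [repTP13b, ray])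

/-- ◇₈ `P[l-1|4l-1|2I+2l-1|4I+2l-1]` (census var 28498, ROUND 2, `B:DP`): TP13F. -/
def repTP13F : MCell := ![(1, -1, 0), (4, -2, 0), (6, -2, 0), (4, -4, 0)]
theorem repTP13F_absent {C : MConfig} (hU : C.InDiamond 8) (hS : C.StaticH1) : repTP13F ∉ C.upper :=
  ceilPairOneFull_P_absent_static hU hS (m := 2) (c := 1) (by norm_num) (by norm_num) (by norm_num) (φ := 2) (u := 2) (v := 2) (ψ := 2)
    (by simp [repTP13F, ray]) (by simp [repTP13F, ray]) (by simp [repTP13F, ray]) (by simp [repTP13F, ray])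

/-- ◇₈ `N[l-1|2I+2l-1|2I+3l-1|4I+2l-1]` (census var 29543, ROUND 2, `B:DN`): TN12 with `d' = 2` (`y'_2 = 2I + 3ℓ`). -/
def repTN12 : MCell := ![(1, -1, 0), (4, -2, 0), (6, -2, 0), (5, -3, 0)]
theorem repTN12_absent {C : MConfig} (hU : C.InDiamond 8) (hG : C.G1Closed) (hS : C.StaticH1) : repTN12 ∉ C.lower :=
  ceilPairOne_N_absent_static hU hG hS (m := 2) (c := 1) (d' := 2) (by norm_num) (by norm_num) (by norm_num) (by norm_num) (by norm_num)
    (φ := 2) (u := 2) (v := 2) (v' := 2) (by simp [repTN12, ray]) (by simp [repTN12, ray]) (by simp [repTN12, ray]) (by simp [repTN12, ray])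

/-- ◇₈ `P[l-1|2I+2l-1|2I+3l-1|2I+3l-1]` (census var 29528, ROUND 2, `B:DP`): TP14 with `d' = 2`. -/
def repTP14 : MCell := ![(1, -1, 0), (4, -2, 0), (5, -3, 0), (5, -3, 0)]
theorem repTP14_absent {C : MConfig} (hU : C.InDiamond 8) (hG : C.G1Closed) (hS : C.StaticH1) : repTP14 ∉ C.upper :=
  ceilPairTwo_P_absent_static hU hG hS (m := 2) (c := 1) (d' := 2) (by norm_num) (by norm_num) (by norm_num) (by norm_num) (by norm_num)
    (φ := 2) (u := 2) (v := 2) (v' := 2) (by simp [repTP14, ray]) (by simp [repTP14, ray]) (by simp [repTP14, ray]) (by simp [repTP14, ray])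

/-! ## §13 THE `y_1`-FRAME: one ceiling-line letter and one letter one or two nodes below the ceiling over the twin-fork base (control g20, v1.5) (memo §1, §3) -/

theorem subSubLetter_node (m : ℤ) (v : Fin 4) (k : ℤ) :
    Adapted (subSubLetter m v k) (v + 2) ∧ coord (subSubLetter m v k) (v + 2) = 2 * k :=
  ⟨(adapted_ray_apex _ v _).2, coord_ray_apex_antip _ v _⟩

theorem subSubLetter_zero (m : ℤ) (v : Fin 4) : subSubLetter m v 0 = floorLetter v m := by
  show ray ((2 * 0, 0, 0) : BPoint) v (m - 0) = ray ((0, 0, 0) : BPoint) v m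
  rw [mul_zero, sub_zero]

theorem floorLetter_ne_origin (φ : Fin 4) {c : ℤ} (hc : c ≠ 0) : floorLetter φ c ≠ (0, 0, 0) := fun e => by
  have e1 := congrArg Prod.fst e
  simp [ray] at e1
  exact hc e1

/-- below `t_k` (`k ≤ m − 1`, so charged) off its ray: exactly the `t_{k'}`, `0 ≤ k' < k` (the top `h − 4` is preserved). -/
theorem below_subSubLetter_offRay {h m k e : ℤ} {z : BPoint} {v r : Fin 4} (hk : k ≤ m - 1) (hz : InDiamond h z) (he : 0 < e)
    (hr : r ≠ v) (heq : subSubLetter m v k = ray z r e) : ∃ k', 0 ≤ k' ∧ k' < k ∧ z = subSubLetter m v k' := by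
  refine ⟨k - e, ?_, by omega, ?_⟩ <;> obtain ⟨α, a, b⟩ := z <;> obtain ⟨hax, h1, -, -⟩ := hz <;>
    simp only [AxisPt, absCharge, chargeOf, ray, Prod.mk.injEq] at hax h1 heq ⊢ <;>
    fin_cases v <;> fin_cases r <;> simp at hax h1 heq hr ⊢ <;>
    (simp only [abs_eq_max_neg, max_def] at h1; split_ifs at h1 <;> omega)

/-- TP13F with the floor letter and the full letter exchanged (slots 0 ↔ 3; `PermClosed C.upper`). -/
theorem ceilPairOneFull_P_absent_swap {h m c : ℤ} {C : MConfig} (hU : C.InDiamond h) (hDN : ∀ Z ∈ C.lower, RuleDMu4N C Z)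
    (hDP : ∀ P ∈ C.upper, RuleDMu4P C P) (hX : XPlusClosed C) (hGu : PermClosed C.upper) (hh : h = 2 * m + 4) (hm : 1 ≤ m) (hc : 1 ≤ c)
    {P : MCell} {φ u v ψ : Fin 4} (h0 : P 0 = floorLetter φ (m + 2)) (h1 : P 1 = nodeTwoLetter u m) (h2 : P 2 = ceilLetter h v 1)
    (h3 : P 3 = floorLetter ψ c) : P ∉ C.upper := fun hP =>
  ceilPairOneFull_P_absent hU hDN hDP hX hh hm hc (P := P.perm (Equiv.swap 0 3)) (φ := ψ) (u := u) (v := v) (ψ := φ)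
    (by show P (Equiv.swap (0 : Fin 4) 3 0) = _; simpa using h3)
    (by show P (Equiv.swap (0 : Fin 4) 3 1) = _; simpa [Equiv.swap_apply_of_ne_of_ne] using h1)
    (by show P (Equiv.swap (0 : Fin 4) 3 2) = _; simpa [Equiv.swap_apply_of_ne_of_ne] using h2)
    (by show P (Equiv.swap (0 : Fin 4) 3 3) = _; simpa using h0)
    (hGu _ P hP)

/-- TP8 with the two floor letters exchanged (slots 0 ↔ 3; `PermClosed C.upper`). -/
theorem subFull_P_absent_swap {h m c : ℤ} {C : MConfig} (hU : C.InDiamond h) (hDN : ∀ Z ∈ C.lower, RuleDMu4N C Z)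
    (hDP : ∀ P ∈ C.upper, RuleDMu4P C P) (hX : XPlusClosed C) (hGu : PermClosed C.upper) (hh : h = 2 * m + 4) (hm : 1 ≤ m) (hc : 1 ≤ c)
    {P : MCell} {φ u χ ψ : Fin 4} (h0 : P 0 = floorLetter φ (m + 1)) (h1 : P 1 = nodeTwoLetter u m) (h2 : P 2 = ceilingUnit h χ)
    (h3 : P 3 = floorLetter ψ c) : P ∉ C.upper := fun hP =>
  subFull_P_absent hU hDN hDP hX hh hm hc (P := P.perm (Equiv.swap 0 3)) (φ := ψ) (u := u) (χ := χ) (ψ := φ)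
    (by show P (Equiv.swap (0 : Fin 4) 3 0) = _; simpa using h3)
    (by show P (Equiv.swap (0 : Fin 4) 3 1) = _; simpa [Equiv.swap_apply_of_ne_of_ne] using h1)
    (by show P (Equiv.swap (0 : Fin 4) 3 2) = _; simpa [Equiv.swap_apply_of_ne_of_ne] using h2)
    (by show P (Equiv.swap (0 : Fin 4) 3 3) = _; simpa using h0)
    (hGu _ P hP)

/-- TP3 with the free letter `x` and the full letter exchanged (slots 0 ↔ 3; `PermClosed C.upper`). -/
theorem twinFloor_full_absent_swap {h m : ℤ} {C : MConfig} (hU : C.InDiamond h) (hDN : ∀ Z ∈ C.lower, RuleDMu4N C Z)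
    (hDP : ∀ P ∈ C.upper, RuleDMu4P C P) (hX : XPlusClosed C) (hGu : PermClosed C.upper) (hh : h = 2 * m + 4) (hm : 1 ≤ m)
    {P : MCell} {φ u χ : Fin 4} (h0 : P 0 = floorLetter φ (m + 2)) (h1 : P 1 = nodeTwoLetter u m) (h2 : P 2 = ceilingUnit h χ)
    (hx : P 3 ≠ (0, 0, 0)) : P ∉ C.upper := fun hP =>
  twinFloor_full_absent hU hDN hDP hX hGu hh hm (P := P.perm (Equiv.swap 0 3)) (u := u) (χ := χ) (ψ := φ)
    (by show P (Equiv.swap (0 : Fin 4) 3 0) ≠ _; simpa using hx)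
    (by show P (Equiv.swap (0 : Fin 4) 3 1) = _; simpa [Equiv.swap_apply_of_ne_of_ne] using h1)
    (by show P (Equiv.swap (0 : Fin 4) 3 2) = _; simpa [Equiv.swap_apply_of_ne_of_ne] using h2)
    (by show P (Equiv.swap (0 : Fin 4) 3 3) = _; simpa using h0)
    (hGu _ P hP)

/-- **TP15.** `P{c·ℓ_φ, 2I + m·ℓ_u, y_1, s_k} ∉ C.upper`, `1 ≤ k ≤ m`, `c ≥ 1` (`h = 2m+4`) [◇_h, RULE D, X⁺, `PermClosed C.upper`]: the up-line of `s_k` pinned by … (memo §1) -/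
theorem ceilOneSub_P_absent {h m c k : ℤ} {C : MConfig} (hU : C.InDiamond h) (hDN : ∀ Z ∈ C.lower, RuleDMu4N C Z)
    (hDP : ∀ P ∈ C.upper, RuleDMu4P C P) (hX : XPlusClosed C) (hGu : PermClosed C.upper) (hh : h = 2 * m + 4) (hm : 1 ≤ m) (hc : 1 ≤ c)
    (hk1 : 1 ≤ k) (hkm : k ≤ m) {P : MCell} {φ u v w : Fin 4} (h0 : P 0 = floorLetter φ c) (h1 : P 1 = nodeTwoLetter u m)
    (h2 : P 2 = ceilLetter h v 1) (h3 : P 3 = subCeilLetter m w k) : P ∉ C.upper := fun hP => by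
  have hna : ¬ isApex (P 3) := by rw [h3]; exact subCeilLetter_not_isApex w (by omega)
  have hk : Adapted (P 3) w := by rw [h3]; exact (subCeilLetter_top m w k).1
  have hkh : coord (P 3) w ≠ h := by rw [h3, (subCeilLetter_top m w k).2]; omega
  obtain ⟨N, hN, hNP⟩ := upLine_of_ruleDMu4P hU hP (hDP P hP) (g := 2) (j := 3) (by decide)
    (by rw [h2]; exact onCeiling_ceilLetter (by norm_num) v) hna hk hkh
  have he0 : 0 < (N 3).1 - (P 3).1 := by have := hNP.2.1; omega
  have e : N 3 = ray (subCeilLetter m w k) w ((N 3).1 - (P 3).1) := by rw [← h3]; exact hNP.2.2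
  have he1 := above_subCeilLetter hh (by omega) he0 (hU.1 N hN 3) e
  have hN3 : N 3 = ceilLetter h w (m + 1 - k) := by rw [e, he1]; exact subCeilLetter_up hh w k
  exact ceilPairOne_N_absent hU hDN hDP hX hGu hh hm hc (d' := m + 1 - k) (by omega) (by omega) ((hNP.1 0 (by decide)).symm.trans h0)
    ((hNP.1 1 (by decide)).symm.trans h1) ((hNP.1 2 (by decide)).symm.trans h2) hN3 hN

/-- **TP16.** `P{c·ℓ_φ, 2I + m·ℓ_u, s_m, y_d} ∉ C.upper` (`s_m = (h−4)I + ℓ_w` on slot 2, `y_d` on slot 3), `1 ≤ d ≤ m`, `c ≥ 1` (`h = 2m+4`) [◇_h, RULE D, X⁺, … (memo §1) -/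
theorem subTopCeil_P_absent {h m c d : ℤ} {C : MConfig} (hU : C.InDiamond h) (hDN : ∀ Z ∈ C.lower, RuleDMu4N C Z)
    (hDP : ∀ P ∈ C.upper, RuleDMu4P C P) (hX : XPlusClosed C) (hGu : PermClosed C.upper) (hh : h = 2 * m + 4) (hm : 1 ≤ m) (hc : 1 ≤ c)
    (hd1 : 1 ≤ d) (hdm : d ≤ m) {P : MCell} {φ u w v : Fin 4} (h0 : P 0 = floorLetter φ c) (h1 : P 1 = nodeTwoLetter u m)
    (h2 : P 2 = subCeilLetter m w m) (h3 : P 3 = ceilLetter h v d) : P ∉ C.upper := fun hP => by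
  have hna : ¬ isApex (P 2) := by rw [h2]; exact subCeilLetter_not_isApex w (by omega)
  have hk : Adapted (P 2) w := by rw [h2]; exact (subCeilLetter_top m w m).1
  have hkh : coord (P 2) w ≠ h := by rw [h2, (subCeilLetter_top m w m).2]; omega
  obtain ⟨N, hN, hNP⟩ := upLine_of_ruleDMu4P hU hP (hDP P hP) (g := 3) (j := 2) (by decide)
    (by rw [h3]; exact onCeiling_ceilLetter (by omega) v) hna hk hkh
  have he0 : 0 < (N 2).1 - (P 2).1 := by have := hNP.2.1; omega
  have e : N 2 = ray (subCeilLetter m w m) w ((N 2).1 - (P 2).1) := by rw [← h2]; exact hNP.2.2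
  have he1 := above_subCeilLetter hh (by omega) he0 (hU.1 N hN 2) e
  have hN2 : N 2 = ceilLetter h w 1 := by rw [e, he1, subCeilLetter_up hh w m, show (m + 1 - m : ℤ) = 1 by ring]
  exact ceilPairOne_N_absent hU hDN hDP hX hGu hh hm hc hd1 hdm ((hNP.1 0 (by decide)).symm.trans h0)
    ((hNP.1 1 (by decide)).symm.trans h1) hN2 ((hNP.1 3 (by decide)).symm.trans h3) hN

/-- **TN13.** `N{(m+2)·ℓ_φ, 2I + m·ℓ_u, y_1, s_k} ∉ C.lower`, `1 ≤ k ≤ m` (`h = 2m+4`) [◇_h, RULE D, X⁺, `PermClosed C.upper`]: the floor node `0` × the node `2k` … (memo §1) -/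
theorem fullCeilOneSub_N_absent {h m k : ℤ} {C : MConfig} (hU : C.InDiamond h) (hDN : ∀ Z ∈ C.lower, RuleDMu4N C Z)
    (hDP : ∀ P ∈ C.upper, RuleDMu4P C P) (hX : XPlusClosed C) (hGu : PermClosed C.upper) (hh : h = 2 * m + 4) (hm : 1 ≤ m)
    (hk1 : 1 ≤ k) (hkm : k ≤ m) {N : MCell} {φ u v w : Fin 4} (h0 : N 0 = floorLetter φ (m + 2)) (h1 : N 1 = nodeTwoLetter u m)
    (h2 : N 2 = ceilLetter h v 1) (h3 : N 3 = subCeilLetter m w k) : N ∉ C.lower := fun hN => by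
  have hk : Adapted (N 0) (φ + 2) := by rw [h0]; exact (floorLetter_node φ (m + 2)).1
  have hk0 : coord (N 0) (φ + 2) = 0 := by rw [h0]; exact (floorLetter_node φ (m + 2)).2
  have hk' : Adapted (N 3) (w + 2) := by rw [h3]; exact (subCeilLetter_node m w k).1
  have hk'c : coord (N 3) (w + 2) = 2 * k := by rw [h3]; exact (subCeilLetter_node m w k).2
  have hne : coord (N 0) (φ + 2) ≠ coord (N 3) (w + 2) := by rw [hk0, hk'c]; omega
  have nob : ∀ P ∈ C.upper, ∀ r : Fin 4, (P 0).1 < (N 0).1 → N 0 = ray (P 0) r ((N 0).1 - (P 0).1) → r = φ :=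
    fun P hP r hlt e => below_floorLetter (hU.2 P hP 0) (by omega) (by omega) (h0.symm.trans e)
  rcases hDN N hN 0 3 (by decide) (φ + 2) (w + 2) hk hk' hne with
    ⟨r, hr, P, hP, hZP⟩ | ⟨r, hr, P, hP, hZP⟩ | ⟨a, a', ha, -, P, hP, -, hb1, hb2, -, -⟩
  · exact absurd ((nob P hP r hZP.2.1 hZP.2.2).trans (fin4_add_two_add_two φ).symm) hr
  · have hd0 : 0 < (N 3).1 - (P 3).1 := by have := hZP.2.1; omega
    have e : subCeilLetter m w k = ray (P 3) r ((N 3).1 - (P 3).1) := by rw [← h3]; exact hZP.2.2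
    have hr' : r ≠ w := fun e' => hr (by rw [e', fin4_add_two_add_two])
    have hP0 : P 0 = floorLetter φ (m + 2) := (hZP.1 0 (by decide)).trans h0
    have hP1 : P 1 = nodeTwoLetter u m := (hZP.1 1 (by decide)).trans h1
    have hP2 : P 2 = ceilLetter h v 1 := (hZP.1 2 (by decide)).trans h2
    obtain ⟨k', hk'0, hk'k, hz⟩ := below_subCeilLetter_offRay hkm (hU.2 P hP 3) hd0 hr' e
    rcases (show k' = 0 ∨ 1 ≤ k' by omega) with hz0 | hz1
    · subst hz0
      rw [subCeilLetter_zero] at hz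
      exact ceilPairOneFull_P_absent_swap hU hDN hDP hX hGu hh hm (c := m + 1) (by omega) hP0 hP1 hP2 hz hP
    · exact ceilOneSub_P_absent hU hDN hDP hX hGu hh hm (c := m + 2) (by omega) hz1 (by omega) hP0 hP1 hP2 hz hP
  · have hφ := nob P hP a hb1 hb2
    rcases ha with e | ⟨-, hne2⟩
    · exact absurd (e.symm.trans hφ) (fin4_ne_add_two φ).symm
    · exact (hne2 (hφ.trans (fin4_add_two_add_two φ).symm)).elim

/-- **TP17a.** `P{(m+2)·ℓ_φ, 2I + m·ℓ_u, y_1, t_k} ∉ C.upper`, `1 ≤ k ≤ m − 1` (`h = 2m+4`) [◇_h, RULE D, X⁺, `PermClosed C.upper`]: the up-line of `t_k` pinned by … (memo §1) -/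
theorem fullCeilOneSubSub_P_absent {h m k : ℤ} {C : MConfig} (hU : C.InDiamond h) (hDN : ∀ Z ∈ C.lower, RuleDMu4N C Z)
    (hDP : ∀ P ∈ C.upper, RuleDMu4P C P) (hX : XPlusClosed C) (hGu : PermClosed C.upper) (hh : h = 2 * m + 4) (hm : 1 ≤ m)
    (hk1 : 1 ≤ k) (hkm : k ≤ m - 1) {P : MCell} {φ u v w : Fin 4} (h0 : P 0 = floorLetter φ (m + 2)) (h1 : P 1 = nodeTwoLetter u m)
    (h2 : P 2 = ceilLetter h v 1) (h3 : P 3 = subSubLetter m w k) : P ∉ C.upper := fun hP => by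
  have hna : ¬ isApex (P 3) := by rw [h3]; exact subSubLetter_not_isApex w (by omega)
  have hk : Adapted (P 3) w := by rw [h3]; exact (subSubLetter_top m w k).1
  have hkh : coord (P 3) w ≠ h := by rw [h3, (subSubLetter_top m w k).2]; omega
  obtain ⟨N, hN, hNP⟩ := upLine_of_ruleDMu4P hU hP (hDP P hP) (g := 2) (j := 3) (by decide)
    (by rw [h2]; exact onCeiling_ceilLetter (by norm_num) v) hna hk hkh
  have he0 : 0 < (N 3).1 - (P 3).1 := by have := hNP.2.1; omega
  have e : N 3 = ray (subSubLetter m w k) w ((N 3).1 - (P 3).1) := by rw [← h3]; exact hNP.2.2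
  have hN0 : N 0 = floorLetter φ (m + 2) := (hNP.1 0 (by decide)).symm.trans h0
  have hN1 : N 1 = nodeTwoLetter u m := (hNP.1 1 (by decide)).symm.trans h1
  have hN2 : N 2 = ceilLetter h v 1 := (hNP.1 2 (by decide)).symm.trans h2
  rcases above_subSubLetter hh (by omega) he0 (hU.1 N hN 3) e with he1 | he2
  · have hN3 : N 3 = subCeilLetter m w k := by rw [e, he1]; exact subSubLetter_up1 m w k
    exact fullCeilOneSub_N_absent hU hDN hDP hX hGu hh hm hk1 (by omega) hN0 hN1 hN2 hN3 hN
  · have hN3 : N 3 = ceilLetter h w (m + 1 - k) := by rw [e, he2]; exact subSubLetter_up2 hh w k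
    exact ceilPairOne_N_absent hU hDN hDP hX hGu hh hm (c := m + 2) (by omega) (d' := m + 1 - k) (by omega) (by omega) hN0 hN1 hN2 hN3 hN

/-- **TN14.** `N{(m+2)·ℓ_φ, 2I + m·ℓ_u, y_1, t_k} ∉ C.lower`, `1 ≤ k ≤ m − 1` (`h = 2m+4`) [◇_h, RULE D, X⁺, `PermClosed C.upper`]: the floor node `0` × the node … (memo §1) -/
theorem fullCeilOneSubSub_N_absent {h m k : ℤ} {C : MConfig} (hU : C.InDiamond h) (hDN : ∀ Z ∈ C.lower, RuleDMu4N C Z)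
    (hDP : ∀ P ∈ C.upper, RuleDMu4P C P) (hX : XPlusClosed C) (hGu : PermClosed C.upper) (hh : h = 2 * m + 4) (hm : 1 ≤ m)
    (hk1 : 1 ≤ k) (hkm : k ≤ m - 1) {N : MCell} {φ u v w : Fin 4} (h0 : N 0 = floorLetter φ (m + 2)) (h1 : N 1 = nodeTwoLetter u m)
    (h2 : N 2 = ceilLetter h v 1) (h3 : N 3 = subSubLetter m w k) : N ∉ C.lower := fun hN => by
  have hk : Adapted (N 0) (φ + 2) := by rw [h0]; exact (floorLetter_node φ (m + 2)).1
  have hk0 : coord (N 0) (φ + 2) = 0 := by rw [h0]; exact (floorLetter_node φ (m + 2)).2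
  have hk' : Adapted (N 3) (w + 2) := by rw [h3]; exact (subSubLetter_node m w k).1
  have hk'c : coord (N 3) (w + 2) = 2 * k := by rw [h3]; exact (subSubLetter_node m w k).2
  have hne : coord (N 0) (φ + 2) ≠ coord (N 3) (w + 2) := by rw [hk0, hk'c]; omega
  have nob : ∀ P ∈ C.upper, ∀ r : Fin 4, (P 0).1 < (N 0).1 → N 0 = ray (P 0) r ((N 0).1 - (P 0).1) → r = φ :=
    fun P hP r hlt e => below_floorLetter (hU.2 P hP 0) (by omega) (by omega) (h0.symm.trans e)
  rcases hDN N hN 0 3 (by decide) (φ + 2) (w + 2) hk hk' hne with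
    ⟨r, hr, P, hP, hZP⟩ | ⟨r, hr, P, hP, hZP⟩ | ⟨a, a', ha, -, P, hP, -, hb1, hb2, -, -⟩
  · exact absurd ((nob P hP r hZP.2.1 hZP.2.2).trans (fin4_add_two_add_two φ).symm) hr
  · have hd0 : 0 < (N 3).1 - (P 3).1 := by have := hZP.2.1; omega
    have e : subSubLetter m w k = ray (P 3) r ((N 3).1 - (P 3).1) := by rw [← h3]; exact hZP.2.2
    have hr' : r ≠ w := fun e' => hr (by rw [e', fin4_add_two_add_two])
    have hP0 : P 0 = floorLetter φ (m + 2) := (hZP.1 0 (by decide)).trans h0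
    have hP1 : P 1 = nodeTwoLetter u m := (hZP.1 1 (by decide)).trans h1
    have hP2 : P 2 = ceilLetter h v 1 := (hZP.1 2 (by decide)).trans h2
    obtain ⟨k', hk'0, hk'k, hz⟩ := below_subSubLetter_offRay hkm (hU.2 P hP 3) hd0 hr' e
    rcases (show k' = 0 ∨ 1 ≤ k' by omega) with hz0 | hz1
    · subst hz0
      rw [subSubLetter_zero] at hz
      exact ceilPairOneFull_P_absent_swap hU hDN hDP hX hGu hh hm (c := m) (by omega) hP0 hP1 hP2 hz hP
    · exact fullCeilOneSubSub_P_absent hU hDN hDP hX hGu hh hm hz1 (by omega) hP0 hP1 hP2 hz hP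
  · have hφ := nob P hP a hb1 hb2
    rcases ha with e | ⟨-, hne2⟩
    · exact absurd (e.symm.trans hφ) (fin4_ne_add_two φ).symm
    · exact (hne2 (hφ.trans (fin4_add_two_add_two φ).symm)).elim

/-- **TP17b.** `P{(m+1)·ℓ_φ, 2I + m·ℓ_u, y_1, t_k} ∉ C.upper`, `1 ≤ k ≤ m − 1` (`h = 2m+4`) [◇_h, RULE D, X⁺, `PermClosed C.upper`]: the up-line of the floor … (memo §1) -/
theorem subFullCeilOneSubSub_P_absent {h m k : ℤ} {C : MConfig} (hU : C.InDiamond h) (hDN : ∀ Z ∈ C.lower, RuleDMu4N C Z)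
    (hDP : ∀ P ∈ C.upper, RuleDMu4P C P) (hX : XPlusClosed C) (hGu : PermClosed C.upper) (hh : h = 2 * m + 4) (hm : 1 ≤ m)
    (hk1 : 1 ≤ k) (hkm : k ≤ m - 1) {P : MCell} {φ u v w : Fin 4} (h0 : P 0 = floorLetter φ (m + 1)) (h1 : P 1 = nodeTwoLetter u m)
    (h2 : P 2 = ceilLetter h v 1) (h3 : P 3 = subSubLetter m w k) : P ∉ C.upper := fun hP => by
  have hna : ¬ isApex (P 0) := by rw [h0]; exact floorLetter_not_isApex φ (by omega)
  have hk : Adapted (P 0) φ := by rw [h0]; exact (floorLetter_top φ (m + 1)).1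
  have hkh : coord (P 0) φ ≠ h := by rw [h0, (floorLetter_top φ (m + 1)).2]; omega
  obtain ⟨N, hN, hNP⟩ := upLine_of_ruleDMu4P hU hP (hDP P hP) (g := 2) (j := 0) (by decide)
    (by rw [h2]; exact onCeiling_ceilLetter (by norm_num) v) hna hk hkh
  have he0 : 0 < (N 0).1 - (P 0).1 := by have := hNP.2.1; omega
  have e : N 0 = ray (floorLetter φ (m + 1)) φ ((N 0).1 - (P 0).1) := by rw [← h0]; exact hNP.2.2
  have he1 := above_subFullLetter hh (by omega) he0 (hU.1 N hN 0) e
  have hN0 : N 0 = floorLetter φ (m + 1 + 1) := by rw [e, he1]; exact (ray_add _ φ (m + 1) 1).symm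
  rw [show m + 1 + 1 = m + 2 by ring] at hN0
  exact fullCeilOneSubSub_N_absent hU hDN hDP hX hGu hh hm hk1 hkm hN0 ((hNP.1 1 (by decide)).symm.trans h1)
    ((hNP.1 2 (by decide)).symm.trans h2) ((hNP.1 3 (by decide)).symm.trans h3) hN

/-- **TN15.** `N{c·ℓ_φ, 2I + m·ℓ_u, cu_χ, t_k} ∉ C.lower`, `c ∈ {m+1, m+2}`, `1 ≤ k ≤ m − 1` (`h = 2m+4`) [◇_h, RULE D, X⁺, `PermClosed C.upper`]: the floor node … (memo §1) -/
theorem twinFrameSubSub_N_absent {h m c k : ℤ} {C : MConfig} (hU : C.InDiamond h) (hDN : ∀ Z ∈ C.lower, RuleDMu4N C Z)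
    (hDP : ∀ P ∈ C.upper, RuleDMu4P C P) (hX : XPlusClosed C) (hGu : PermClosed C.upper) (hh : h = 2 * m + 4) (hm : 1 ≤ m)
    (hc : c = m + 1 ∨ c = m + 2) (hk1 : 1 ≤ k) (hkm : k ≤ m - 1) {N : MCell} {φ u χ w : Fin 4} (h0 : N 0 = floorLetter φ c)
    (h1 : N 1 = nodeTwoLetter u m) (h2 : N 2 = ceilingUnit h χ) (h3 : N 3 = subSubLetter m w k) : N ∉ C.lower := fun hN => by
  have hk : Adapted (N 0) (φ + 2) := by rw [h0]; exact (floorLetter_node φ c).1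
  have hk0 : coord (N 0) (φ + 2) = 0 := by rw [h0]; exact (floorLetter_node φ c).2
  have hk' : Adapted (N 3) (w + 2) := by rw [h3]; exact (subSubLetter_node m w k).1
  have hk'c : coord (N 3) (w + 2) = 2 * k := by rw [h3]; exact (subSubLetter_node m w k).2
  have hne : coord (N 0) (φ + 2) ≠ coord (N 3) (w + 2) := by rw [hk0, hk'c]; omega
  have nob : ∀ P ∈ C.upper, ∀ r : Fin 4, (P 0).1 < (N 0).1 → N 0 = ray (P 0) r ((N 0).1 - (P 0).1) → r = φ :=
    fun P hP r hlt e => below_floorLetter (hU.2 P hP 0) (by omega) (by omega) (h0.symm.trans e)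
  rcases hDN N hN 0 3 (by decide) (φ + 2) (w + 2) hk hk' hne with
    ⟨r, hr, P, hP, hZP⟩ | ⟨r, hr, P, hP, hZP⟩ | ⟨a, a', ha, -, P, hP, -, hb1, hb2, -, -⟩
  · exact absurd ((nob P hP r hZP.2.1 hZP.2.2).trans (fin4_add_two_add_two φ).symm) hr
  · have hd0 : 0 < (N 3).1 - (P 3).1 := by have := hZP.2.1; omega
    have e : subSubLetter m w k = ray (P 3) r ((N 3).1 - (P 3).1) := by rw [← h3]; exact hZP.2.2
    have hr' : r ≠ w := fun e' => hr (by rw [e', fin4_add_two_add_two])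
    have hP0 : P 0 = floorLetter φ c := (hZP.1 0 (by decide)).trans h0
    have hP1 : P 1 = nodeTwoLetter u m := (hZP.1 1 (by decide)).trans h1
    have hP2 : P 2 = ceilingUnit h χ := (hZP.1 2 (by decide)).trans h2
    obtain ⟨k', hk'0, hk'k, hz⟩ := below_subSubLetter_offRay hkm (hU.2 P hP 3) hd0 hr' e
    rcases (show k' = 0 ∨ 1 ≤ k' by omega) with hz0 | hz1
    · subst hz0
      rw [subSubLetter_zero] at hz
      rcases hc with hc1 | hc2
      · rw [hc1] at hP0
        exact subFull_P_absent_swap hU hDN hDP hX hGu hh hm (c := m) (by omega) hP0 hP1 hP2 hz hP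
      · rw [hc2] at hP0
        exact twinFloor_full_absent_swap hU hDN hDP hX hGu hh hm hP0 hP1 hP2 (by rw [hz]; exact floorLetter_ne_origin w (by omega)) hP
    · exact subSub_P_absent hU hDN hDP hX hGu hh hm (by omega) hz1 (by omega) hP0 hP1 hP2 hz hP
  · have hφ := nob P hP a hb1 hb2
    rcases ha with e | ⟨-, hne2⟩
    · exact absurd (e.symm.trans hφ) (fin4_ne_add_two φ).symm
    · exact (hne2 (hφ.trans (fin4_add_two_add_two φ).symm)).elim

/-! ### §13b ◇₈ census representatives (all peel round 2) -/

/-- ◇₈ `P[l-1|2I+2l-1|2I+2l-1|4I+2l-1]` (census var 29200, ROUND 2, `B:DP`): TP15 with `k = 1` (`s_1 = 2I + mℓ` a second time). -/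
def repTP15 : MCell := ![(1, -1, 0), (4, -2, 0), (6, -2, 0), (4, -2, 0)]
theorem repTP15_absent {C : MConfig} (hU : C.InDiamond 8) (hG : C.G1Closed) (hS : C.StaticH1) : repTP15 ∉ C.upper :=
  ceilOneSub_P_absent hU hS.1.1 hS.1.2 hS.2.1 hG.2.1 (m := 2) (c := 1) (k := 1) (by norm_num) (by norm_num) (by norm_num) (by norm_num) (by norm_num)
    (φ := 2) (u := 2) (v := 2) (w := 2) (by simp [repTP15, ray]) (by simp [repTP15, ray]) (by simp [repTP15, ray]) (by simp [repTP15, ray])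

/-- ◇₈ `P[l-1|2I+2l-1|2I+3l-1|4I+l-1]` (census var 29530, ROUND 2, `B:DP`): TP16 with `d = 2` (`s_m = 4I + ℓ`, `y_2 = 2I + 3ℓ`). -/
def repTP16 : MCell := ![(1, -1, 0), (4, -2, 0), (5, -1, 0), (5, -3, 0)]
theorem repTP16_absent {C : MConfig} (hU : C.InDiamond 8) (hG : C.G1Closed) (hS : C.StaticH1) : repTP16 ∉ C.upper :=
  subTopCeil_P_absent hU hS.1.1 hS.1.2 hS.2.1 hG.2.1 (m := 2) (c := 1) (d := 2) (by norm_num) (by norm_num) (by norm_num) (by norm_num) (by norm_num)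
    (φ := 2) (u := 2) (w := 2) (v := 2) (by simp [repTP16, ray]) (by simp [repTP16, ray]) (by simp [repTP16, ray]) (by simp [repTP16, ray])

/-- ◇₈ `N[4l-1|2I+2l-1|2I+2l-1|4I+2l-1]` (census var 84641, ROUND 2, `B:DN`): TN13 with `k = 1`. -/
def repTN13 : MCell := ![(4, -4, 0), (4, -2, 0), (6, -2, 0), (4, -2, 0)]
theorem repTN13_absent {C : MConfig} (hU : C.InDiamond 8) (hG : C.G1Closed) (hS : C.StaticH1) : repTN13 ∉ C.lower :=
  fullCeilOneSub_N_absent hU hS.1.1 hS.1.2 hS.2.1 hG.2.1 (m := 2) (k := 1) (by norm_num) (by norm_num) (by norm_num) (by norm_num)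
    (φ := 2) (u := 2) (v := 2) (w := 2) (by simp [repTN13, ray]) (by simp [repTN13, ray]) (by simp [repTN13, ray]) (by simp [repTN13, ray])

/-- ◇₈ `P[2I+l-1|4l-1|2I+2l-1|4I+2l-1]` (census var 76634, ROUND 2, `B:DP`): TP17a with `k = 1` (`t_1 = 2I + ℓ`). -/
def repTP17a : MCell := ![(4, -4, 0), (4, -2, 0), (6, -2, 0), (3, -1, 0)]
theorem repTP17a_absent {C : MConfig} (hU : C.InDiamond 8) (hG : C.G1Closed) (hS : C.StaticH1) : repTP17a ∉ C.upper :=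
  fullCeilOneSubSub_P_absent hU hS.1.1 hS.1.2 hS.2.1 hG.2.1 (m := 2) (k := 1) (by norm_num) (by norm_num) (by norm_num) (by norm_num)
    (φ := 2) (u := 2) (v := 2) (w := 2) (by simp [repTP17a, ray]) (by simp [repTP17a, ray]) (by simp [repTP17a, ray]) (by simp [repTP17a, ray])

/-- ◇₈ `N[2I+l-1|4l-1|2I+2l-1|4I+2l-1]` (census var 76633, ROUND 2, `B:DN`): TN14 with `k = 1`. -/
theorem repTN14_absent {C : MConfig} (hU : C.InDiamond 8) (hG : C.G1Closed) (hS : C.StaticH1) : repTP17a ∉ C.lower :=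
  fullCeilOneSubSub_N_absent hU hS.1.1 hS.1.2 hS.2.1 hG.2.1 (m := 2) (k := 1) (by norm_num) (by norm_num) (by norm_num) (by norm_num)
    (φ := 2) (u := 2) (v := 2) (w := 2) (by simp [repTP17a, ray]) (by simp [repTP17a, ray]) (by simp [repTP17a, ray]) (by simp [repTP17a, ray])

/-- ◇₈ `P[3l-1|2I+l-1|2I+2l-1|4I+2l-1]` (census var 62378, ROUND 2, `B:DP`): TP17b with `k = 1`. -/
def repTP17b : MCell := ![(3, -3, 0), (4, -2, 0), (6, -2, 0), (3, -1, 0)]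
theorem repTP17b_absent {C : MConfig} (hU : C.InDiamond 8) (hG : C.G1Closed) (hS : C.StaticH1) : repTP17b ∉ C.upper :=
  subFullCeilOneSubSub_P_absent hU hS.1.1 hS.1.2 hS.2.1 hG.2.1 (m := 2) (k := 1) (by norm_num) (by norm_num) (by norm_num) (by norm_num)
    (φ := 2) (u := 2) (v := 2) (w := 2) (by simp [repTP17b, ray]) (by simp [repTP17b, ray]) (by simp [repTP17b, ray]) (by simp [repTP17b, ray])

/-- ◇₈ `N[3l-1|2I+l-1|2I+2l-1|6I+l-1]` (census var 62387, ROUND 2, `B:DN`): TN15 with `c = m+1 = 3`, `k = 1`. -/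
def repTN15 : MCell := ![(3, -3, 0), (4, -2, 0), (7, -1, 0), (3, -1, 0)]
theorem repTN15_absent {C : MConfig} (hU : C.InDiamond 8) (hG : C.G1Closed) (hS : C.StaticH1) : repTN15 ∉ C.lower :=
  twinFrameSubSub_N_absent hU hS.1.1 hS.1.2 hS.2.1 hG.2.1 (m := 2) (c := 3) (k := 1) (by norm_num) (by norm_num) (by norm_num) (by norm_num) (by norm_num)
    (φ := 2) (u := 2) (χ := 2) (w := 2) (by simp [repTN15, ray]) (by simp [repTN15, ray]) (by simp [repTN15, ray]) (by simp [repTN15, ray])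

/-! ## §14 THE A2I⁻ INTERFACE AT THE ORIGIN (first and only use of `A2IMinusClosed`) and the `cu`–`s_m` base of the round-2 residue
`a2i_origin_interface`: at `Z ∈ E₋` with `Z_a = O`, `Z_b = ℓ_φ` and the partner `q = Z(b ↦ O) ∈ E₊`, the A2I⁻ clause of the instance
`(Z; σ = b, u = φ; q; f′ = a, v = φ, N′ = Z ∘ (a b))` has every escape closed in ◇_h except the polluter species (3b), which IS the cell
`Z(a ↦ ℓ_φ, b ↦ O) ∈ E₊`.  Consequences B4, TP18, TN17, TP20, TN16 (uses A2I⁻) and TP19, TN18, TP21 (law-free); memo §1, §3 (xii). -/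

theorem fst_nonneg_of_inDiamond {h : ℤ} {z : BPoint} (hz : InDiamond h z) : 0 ≤ z.1 := by
  have h1 : absCharge z ≤ z.1 := hz.2.1
  have h2 : 0 ≤ absCharge z := abs_nonneg _
  omega

/-- a letter of ◇_h is never spacelike-separated from the origin. -/
theorem not_spacelike_of_inDiamond {h : ℤ} {z : BPoint} (hz : InDiamond h z) : ¬ Spacelike (bsub z (0, 0, 0)) := by
  obtain ⟨α, a, b⟩ := z
  obtain ⟨hax, h1, -, -⟩ := hz
  simp only [AxisPt, absCharge, chargeOf, Prod.mk.injEq] at hax h1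
  have key : a ^ 2 + b ^ 2 ≤ α ^ 2 := by
    rcases hax with ⟨rfl, rfl⟩ | ⟨-, rfl⟩ | ⟨rfl, -⟩
    · simp only [sub_self, abs_zero] at h1; nlinarith
    · simp only [sub_zero] at h1
      obtain ⟨l, r⟩ := abs_le.mp h1
      nlinarith [mul_nonneg (sub_nonneg.mpr r) (show (0:ℤ) ≤ α + a by linarith)]
    · simp only [zero_sub, abs_neg] at h1
      obtain ⟨l, r⟩ := abs_le.mp h1
      nlinarith [mul_nonneg (sub_nonneg.mpr r) (show (0:ℤ) ≤ α + b by linarith)]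
  simp only [Spacelike, bsub, sub_zero, not_lt]
  exact key

/-- **THE A2I⁻ INTERFACE AT THE ORIGIN** (KERNEL, every `h`) [◇_h, A2I⁻, `S₄` on E₋]. -/
theorem a2i_origin_interface {h : ℤ} {C : MConfig} (hU : C.InDiamond h) (hA : A2IMinusClosed C) (hGl : PermClosed C.lower)
    {Z : MCell} (hZ : Z ∈ C.lower) {a b : Fin 4} (hab : a ≠ b) {φ : Fin 4} (ha : Z a = (0, 0, 0)) (hb : Z b = floorUnit φ)
    {q : MCell} (hq : q ∈ C.upper) (hqZ : MAgree q Z b) (hqb : q b = (0, 0, 0)) :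
    ∃ P ∈ C.upper, MAgree2 P Z a b ∧ P a = floorUnit φ ∧ P b = (0, 0, 0) := by
  by_contra hno
  have hN' : Z.perm (Equiv.swap a b) ∈ C.lower := hGl (Equiv.swap a b) Z hZ
  have eNa : Z.perm (Equiv.swap a b) a = floorUnit φ := by show Z (Equiv.swap a b a) = _; rw [Equiv.swap_apply_left, hb]
  have eNb : Z.perm (Equiv.swap a b) b = (0, 0, 0) := by show Z (Equiv.swap a b b) = _; rw [Equiv.swap_apply_right, ha]
  have hqa : q a = (0, 0, 0) := (hqZ a hab).trans ha
  have hZb1 : (Z b).1 = 1 := by rw [hb, floorUnit_fst]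
  have hqb1 : (q b).1 = 0 := by rw [hqb]
  have hZa1 : (Z a).1 = 0 := by rw [ha]
  have hqa1 : (q a).1 = 0 := by rw [hqa]
  have nob : ∀ P ∈ C.upper, ∀ w : Fin 4, UPartner Z P b w → w = φ ∧ P b = (0, 0, 0) := fun P hP w hZP => by
    have hd : 0 < (Z b).1 - (P b).1 := by have := hZP.2.1; omega
    have e : floorUnit φ = ray (P b) w ((Z b).1 - (P b).1) := by rw [← hb]; exact hZP.2.2
    exact below_floorUnit (hU.2 P hP b) hd e
  refine hA Z hZ q hq _ hN' b φ a φ ⟨by rw [hb]; exact floorUnit_not_isApex φ, ?_, ?_, fun _ => ?_, hab, ?_, ?_, ?_, ?_, ?_, ?_⟩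
  · rw [hb]; fin_cases φ <;> simp [EncDir, cabs, ray]
  · exact ⟨hqZ, by omega, by rw [hZb1, hqb1, hb, hqb]; norm_num⟩
  · rw [hZb1, hqb1, hb]; fin_cases φ <;> simp [cabs, ray]
  · refine ⟨fun g hg => ?_, by rw [eNa, floorUnit_fst, hqa1]; norm_num, by rw [eNa, floorUnit_fst, hqa1, hqa]; norm_num⟩
    by_cases hgb : g = b
    · rw [hgb, hqb, eNb]
    · show q g = Z (Equiv.swap a b g)
      rw [Equiv.swap_apply_of_ne_of_ne hg hgb]; exact hqZ g hgb
  · exact fun P hP w hw hZP => hw (nob P hP w hZP).1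
  · exact fun P hP hZP => by rw [(nob P hP φ hZP).2, hqb]
  · exact fun P hP hqP => by
      have h1 := hqP.2.1; have h2 := fst_nonneg_of_inDiamond (hU.2 P hP b); rw [hqb1] at h1; exact absurd h1 (by omega)
  · exact fun P hP hnb _ => by
      have h1 := hnb.1; have h2 := fst_nonneg_of_inDiamond (hU.2 P hP a); rw [hZa1] at h1; exact absurd h1 (by omega)
  · intro P hP hPg hul
    refine ⟨fun h3b => ?_, fun h3d => not_spacelike_of_inDiamond (hU.2 P hP a) (by rw [ha] at h3d; exact h3d.2)⟩
    have hNa1 : (Z.perm (Equiv.swap a b) a).1 = 1 := by rw [eNa, floorUnit_fst]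
    have hPa1 : (P a).1 = 1 := by have := h3b.1; have := h3b.2.1; omega
    have hPa : P a = floorUnit φ := by
      have e := h3b.2.2; rw [hPa1, hZa1, ha] at e; rw [e]; norm_num
    have hPb1 : (P b).1 = 0 := by have := hul.1; have := fst_nonneg_of_inDiamond (hU.2 P hP b); omega
    have hPb : P b = (0, 0, 0) := by
      have e := hul.2; rw [hqb1, hPb1, show ((0:ℤ) - 0) = 0 by norm_num, ray_zero] at e; rw [← e, hqb]
    exact hno ⟨P, hP, fun g hga hgb => hPg g hgb hga, hPa, hPb⟩

/-- **B4** `N{O, ℓ_φ, cu_χ, cu_χ'} ∉ C.lower` [◇_h, RULE D, X⁺, `S₄` both levels, `Δ` on E₊, A2I⁻]: `q = N(1 ↦ O)` (RULE D at `O` × the top of `ℓ_φ`),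
then the interface gives B2 after (0 1).  Census: the 10 `[Am]`-dependent round-1 orbits (kind `P:Xp`) of every diamond. -/
theorem loneUnit_pair_N_absent {h : ℤ} {C : MConfig} (hU : C.InDiamond h) (hDN : ∀ Z ∈ C.lower, RuleDMu4N C Z)
    (hDP : ∀ P ∈ C.upper, RuleDMu4P C P) (hX : XPlusClosed C) (hA : A2IMinusClosed C) (hGl : PermClosed C.lower)
    (hGu : PermClosed C.upper) (hΔu : DeltaClosed C.upper) {N : MCell} {φ χ χ' : Fin 4}
    (h0 : N 0 = (0, 0, 0)) (h1 : N 1 = floorUnit φ) (h2 : N 2 = ceilingUnit h χ) (h3 : N 3 = ceilingUnit h χ') : N ∉ C.lower := fun hN => by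
  have h0' : N 0 = floorLetter φ 0 := h0.trans (ray_zero _ φ).symm
  obtain ⟨q, hq, hqN, hq1⟩ := descent_of_floorNode_floorUnit hU (hDN N hN) (b := 0) (c := 1) (by decide) le_rfl h0' h1
  obtain ⟨P, hP, hPN, hP0, hP1⟩ := a2i_origin_interface hU hA hGl hN (a := 0) (b := 1) (by decide) h0 h1 hq hqN hq1
  exact loneUnit_pair_absent hU hDN hDP hX hΔu (P := P.perm (Equiv.swap 0 1)) (φ := φ) (χ := χ) (χ' := χ')
    (by show P (Equiv.swap (0 : Fin 4) 1 0) = _; simpa using hP1)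
    (by show P (Equiv.swap (0 : Fin 4) 1 1) = _; simpa using hP0)
    (by show P (Equiv.swap (0 : Fin 4) 1 2) = _; simpa [Equiv.swap_apply_of_ne_of_ne] using (hPN 2 (by decide) (by decide)).trans h2)
    (by show P (Equiv.swap (0 : Fin 4) 1 3) = _; simpa [Equiv.swap_apply_of_ne_of_ne] using (hPN 3 (by decide) (by decide)).trans h3)
    (hGu _ P hP)

/-- the up-line of `y_1` pinned by a unit ceiling letter: `cu_v` or `hI` in slot 2. -/
theorem upLine_ceilOne {h : ℤ} {C : MConfig} (hU : C.InDiamond h) {P : MCell} (hP : P ∈ C.upper) (hD : RuleDMu4P C P) {v χ : Fin 4}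
    (h2 : P 2 = ceilLetter h v 1) (h3 : P 3 = ceilingUnit h χ) :
    ∃ N ∈ C.lower, MAgree N P 2 ∧ (N 2 = ceilingUnit h v ∨ N 2 = (h, 0, 0)) := by
  have hna : ¬ isApex (P 2) := by rw [h2]; exact ceilLetter_not_isApex v (by norm_num)
  have hk : Adapted (P 2) (v + 2) := by rw [h2]; exact (ceilLetter_node h v 1).1
  have hkh : coord (P 2) (v + 2) ≠ h := by rw [h2, (ceilLetter_node h v 1).2]; omega
  obtain ⟨N, hN, hNP⟩ := upLine_of_ruleDMu4P hU hP hD (g := 3) (j := 2) (by decide) (by rw [h3]; exact onCeiling_ceilingUnit h χ) hna hk hkh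
  have he0 : 0 < (N 2).1 - (P 2).1 := by have := hNP.2.1; omega
  have e : N 2 = ray (ceilLetter h v 1) (v + 2) ((N 2).1 - (P 2).1) := by rw [← h2]; exact hNP.2.2
  obtain ⟨-, hle, hN2⟩ := above_ceilLetter_offRay (by norm_num) (hU.1 N hN 2) he0 e
  refine ⟨N, hN, fun g hg => (hNP.1 g hg).symm, ?_⟩
  rcases (show (N 2).1 - (P 2).1 = 1 ∨ (N 2).1 - (P 2).1 = 2 by omega) with he1 | he2
  · left; rw [hN2, he1, show (1 - 1 : ℤ) = 0 by norm_num, ceilLetter_zero]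
  · right; rw [hN2, he2, show (1 - 2 : ℤ) = -1 by norm_num, ceilLetter_neg_one]

/-- the up-line of `s_m` (`h = 2m+4`) pinned by a unit ceiling letter: `y_1` in slot 2. -/
theorem upLine_subTop {h m : ℤ} {C : MConfig} (hU : C.InDiamond h) (hh : h = 2 * m + 4) {P : MCell} (hP : P ∈ C.upper)
    (hD : RuleDMu4P C P) {v χ : Fin 4} (h2 : P 2 = subCeilLetter m v m) (h3 : P 3 = ceilingUnit h χ) :
    ∃ N ∈ C.lower, MAgree N P 2 ∧ N 2 = ceilLetter h v 1 := by
  have hna : ¬ isApex (P 2) := by rw [h2]; exact subCeilLetter_not_isApex v (by omega)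
  have hk : Adapted (P 2) v := by rw [h2]; exact (subCeilLetter_top m v m).1
  have hkh : coord (P 2) v ≠ h := by rw [h2, (subCeilLetter_top m v m).2]; omega
  obtain ⟨N, hN, hNP⟩ := upLine_of_ruleDMu4P hU hP hD (g := 3) (j := 2) (by decide) (by rw [h3]; exact onCeiling_ceilingUnit h χ) hna hk hkh
  have he0 : 0 < (N 2).1 - (P 2).1 := by have := hNP.2.1; omega
  have e : N 2 = ray (subCeilLetter m v m) v ((N 2).1 - (P 2).1) := by rw [← h2]; exact hNP.2.2
  have he1 := above_subCeilLetter hh (by omega) he0 (hU.1 N hN 2) e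
  exact ⟨N, hN, fun g hg => (hNP.1 g hg).symm, by rw [e, he1, subCeilLetter_up hh v m, show (m + 1 - m : ℤ) = 1 by ring]⟩

/-- RULE D at an N-cell next to a unit floor letter `Z_b = ℓ_φ`: a slot whose letter has a frame coordinate `≠ 0` is settled below off that node. -/
theorem settled_of_floorUnit {h : ℤ} {C : MConfig} (hU : C.InDiamond h) {Z : MCell} (hD : RuleDMu4N C Z) {b c : Fin 4} (hbc : b ≠ c)
    {φ k : Fin 4} (hb : Z b = floorUnit φ) (hk : Adapted (Z c) k) (hne : coord (Z c) k ≠ 0) :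
    ∃ r, r ≠ k + 2 ∧ ∃ P ∈ C.upper, UPartner Z P c r := by
  have hkb : Adapted (Z b) (φ + 2) := by rw [hb]; exact (floorUnit_node φ).1
  have hk0 : coord (Z b) (φ + 2) = 0 := by rw [hb]; exact (floorUnit_node φ).2
  have nob : ∀ P ∈ C.upper, ∀ r : Fin 4, ∀ d : ℤ, 0 < d → Z b = ray (P b) r d → r = φ := fun P hP r d hd e =>
    (below_floorUnit (hU.2 P hP b) hd (hb.symm.trans e)).1
  rcases hD b c hbc (φ + 2) k hkb hk (by rw [hk0]; exact hne.symm) with ⟨r, hr, P, hP, hZP⟩ | hs | ⟨a, a', ha, -, P, hP, -, hb1, hb2, -, -⟩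
  · exact absurd ((nob P hP r _ (by have := hZP.2.1; omega) hZP.2.2).trans (fin4_add_two_add_two φ).symm) hr
  · exact hs
  · have ha' : a = φ + 2 := by
      rcases ha with e | ⟨hap, _⟩
      · exact e
      · exact absurd hap (by rw [hb]; exact floorUnit_not_isApex φ)
    have := nob P hP a _ (by omega) hb2
    rw [ha'] at this
    exact absurd this.symm (fin4_ne_add_two φ)

/-- **TP18** `P{O, ℓ_φ, y_1, cu_χ} ∉ C.upper` (`y_1 = (h−4)I + 2ℓ_v`) [as B4]: above `y_1` sit `cu_v` (B4) and `hI` (B1 after (2 3)).  Census: 16 orbits per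
diamond, peel round 2 (`B:DP`). -/
theorem loneUnitCeilOne_P_absent {h : ℤ} {C : MConfig} (hU : C.InDiamond h) (hDN : ∀ Z ∈ C.lower, RuleDMu4N C Z)
    (hDP : ∀ P ∈ C.upper, RuleDMu4P C P) (hX : XPlusClosed C) (hA : A2IMinusClosed C) (hGl : PermClosed C.lower)
    (hGu : PermClosed C.upper) (hΔu : DeltaClosed C.upper) {P : MCell} {φ v χ : Fin 4}
    (h0 : P 0 = (0, 0, 0)) (h1 : P 1 = floorUnit φ) (h2 : P 2 = ceilLetter h v 1) (h3 : P 3 = ceilingUnit h χ) : P ∉ C.upper := fun hP => by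
  obtain ⟨N, hN, hNP, hN2 | hN2⟩ := upLine_ceilOne hU hP (hDP P hP) h2 h3
  · exact loneUnit_pair_N_absent hU hDN hDP hX hA hGl hGu hΔu ((hNP 0 (by decide)).trans h0) ((hNP 1 (by decide)).trans h1) hN2
      ((hNP 3 (by decide)).trans h3) hN
  · exact loneUnit_apex_absent hU hDN hDP hX hΔu (N := N.perm (Equiv.swap 2 3)) (φ := φ) (χ := χ)
      (by show N (Equiv.swap (2 : Fin 4) 3 0) = _; simpa [Equiv.swap_apply_of_ne_of_ne] using (hNP 0 (by decide)).trans h0)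
      (by show N (Equiv.swap (2 : Fin 4) 3 1) = _; simpa [Equiv.swap_apply_of_ne_of_ne] using (hNP 1 (by decide)).trans h1)
      (by show N (Equiv.swap (2 : Fin 4) 3 2) = _; simpa using (hNP 3 (by decide)).trans h3)
      (by show N (Equiv.swap (2 : Fin 4) 3 3) = _; simpa using hN2) (hGl _ N hN)

/-- **TP19** `P{ℓ_φ, ℓ_ψ, y_1, cu_χ} ∉ C.upper` for `φ ≠ ψ` [◇_h, RULE D, X⁺, `S₄` both levels, `Δ` on E₊; NO A2I⁻]: above `y_1` sit `cu_v` (B3) and `hI` (the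
g18 ceiling fork after (2 3)).  Census: 24 orbits per diamond, peel round 2 (`B:DP`); the 16 equal-phase orbits are kind `P:Xp`, rounds 2–4, NOT claimed. -/
theorem unitPairCeilOne_P_absent {h : ℤ} {C : MConfig} (hU : C.InDiamond h) (hDN : ∀ Z ∈ C.lower, RuleDMu4N C Z)
    (hDP : ∀ P ∈ C.upper, RuleDMu4P C P) (hX : XPlusClosed C) (hGl : PermClosed C.lower) (hGu : PermClosed C.upper)
    (hΔu : DeltaClosed C.upper) {P : MCell} {φ ψ v χ : Fin 4} (hφψ : φ ≠ ψ)
    (h0 : P 0 = floorUnit φ) (h1 : P 1 = floorUnit ψ) (h2 : P 2 = ceilLetter h v 1) (h3 : P 3 = ceilingUnit h χ) : P ∉ C.upper := fun hP => by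
  obtain ⟨N, hN, hNP, hN2 | hN2⟩ := upLine_ceilOne hU hP (hDP P hP) h2 h3
  · exact unitPair_pair_absent hU hDN hDP hX hΔu ((hNP 0 (by decide)).trans h0) ((hNP 1 (by decide)).trans h1) hN2
      ((hNP 3 (by decide)).trans h3) hN
  · exact ceilingForkFamily_absent hU hDN hDP hX hGu hΔu hφψ (Z := N.perm (Equiv.swap 2 3))
      (by show N (Equiv.swap (2 : Fin 4) 3 0) = _; simpa [Equiv.swap_apply_of_ne_of_ne] using (hNP 0 (by decide)).trans h0)
      (by show N (Equiv.swap (2 : Fin 4) 3 1) = _; simpa [Equiv.swap_apply_of_ne_of_ne] using (hNP 1 (by decide)).trans h1)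
      (by show N (Equiv.swap (2 : Fin 4) 3 2) = _; simpa using (hNP 3 (by decide)).trans h3)
      (by show N (Equiv.swap (2 : Fin 4) 3 3) = _; simpa using hN2) (hGl _ N hN)

/-- **TN17** `N{ℓ_φ, ℓ_ψ, y_1, cu_χ} ∉ C.lower` [as B4]: the unit-pair descent `N(1 ↦ O)` is TP18 after (0 1).  Census: 40 orbits per diamond, round 2 (`B:DN`). -/
theorem unitPairCeilOne_N_absent {h : ℤ} {C : MConfig} (hU : C.InDiamond h) (hDN : ∀ Z ∈ C.lower, RuleDMu4N C Z)
    (hDP : ∀ P ∈ C.upper, RuleDMu4P C P) (hX : XPlusClosed C) (hA : A2IMinusClosed C) (hGl : PermClosed C.lower)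
    (hGu : PermClosed C.upper) (hΔu : DeltaClosed C.upper) {N : MCell} {φ ψ v χ : Fin 4}
    (h0 : N 0 = floorUnit φ) (h1 : N 1 = floorUnit ψ) (h2 : N 2 = ceilLetter h v 1) (h3 : N 3 = ceilingUnit h χ) : N ∉ C.lower := fun hN => by
  obtain ⟨P, hP, hPN, hP1⟩ := descent_of_floorUnitPair hU (hDN N hN) (b := 0) (c := 1) (by decide) h0 h1
  exact loneUnitCeilOne_P_absent hU hDN hDP hX hA hGl hGu hΔu (P := P.perm (Equiv.swap 0 1)) (φ := φ) (v := v) (χ := χ)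
    (by show P (Equiv.swap (0 : Fin 4) 1 0) = _; simpa using hP1)
    (by show P (Equiv.swap (0 : Fin 4) 1 1) = _; simpa using (hPN 0 (by decide)).trans h0)
    (by show P (Equiv.swap (0 : Fin 4) 1 2) = _; simpa [Equiv.swap_apply_of_ne_of_ne] using (hPN 2 (by decide)).trans h2)
    (by show P (Equiv.swap (0 : Fin 4) 1 3) = _; simpa [Equiv.swap_apply_of_ne_of_ne] using (hPN 3 (by decide)).trans h3)
    (hGu _ P hP)

/-- **TP20** `P{ℓ_φ, ℓ_ψ, s_m, cu_χ} ∉ C.upper` (`s_m = (h−4)I + ℓ_v`, `h = 2m+4`) [as B4]: the up-line of `s_m` is `y_1` — TN17.  Census: 40 orbits per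
diamond, peel round 2 (`B:DP`). -/
theorem unitPairSubTop_P_absent {h m : ℤ} {C : MConfig} (hU : C.InDiamond h) (hDN : ∀ Z ∈ C.lower, RuleDMu4N C Z)
    (hDP : ∀ P ∈ C.upper, RuleDMu4P C P) (hX : XPlusClosed C) (hA : A2IMinusClosed C) (hGl : PermClosed C.lower)
    (hGu : PermClosed C.upper) (hΔu : DeltaClosed C.upper) (hh : h = 2 * m + 4) {P : MCell} {φ ψ v χ : Fin 4}
    (h0 : P 0 = floorUnit φ) (h1 : P 1 = floorUnit ψ) (h2 : P 2 = subCeilLetter m v m) (h3 : P 3 = ceilingUnit h χ) : P ∉ C.upper :=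
  fun hP => by
  obtain ⟨N, hN, hNP, hN2⟩ := upLine_subTop hU hh hP (hDP P hP) h2 h3
  exact unitPairCeilOne_N_absent hU hDN hDP hX hA hGl hGu hΔu ((hNP 0 (by decide)).trans h0) ((hNP 1 (by decide)).trans h1) hN2
    ((hNP 3 (by decide)).trans h3) hN

/-- below the apex `2I` in ◇_h sit only the unit floor letters: `2I = ℓ_{r+2} + n_r`. -/
theorem below_apexTwo {h d : ℤ} {z : BPoint} {r : Fin 4} (hz : InDiamond h z) (hd : 0 < d) (he : ((2, 0, 0) : BPoint) = ray z r d) :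
    d = 1 ∧ z = floorUnit (r + 2) := by
  obtain ⟨α, a, b⟩ := z
  obtain ⟨hax, h1, -, -⟩ := hz
  simp only [AxisPt, absCharge, chargeOf, ray, Prod.mk.injEq] at hax h1 he ⊢
  fin_cases r <;> simp at hax h1 he ⊢ <;> (simp only [abs_eq_max_neg, max_def] at h1; split_ifs at h1 <;> omega)

/-- **TN18** `N{ℓ_φ, 2I, y_1, cu_χ} ∉ C.lower` [as TP19; NO A2I⁻]: RULE D on the floor node `0` × the apex `2I` (frame `{φ, φ+2}`): `2I` is served from
`ℓ_ψ`, `ψ ≠ φ` — TP19.  Census: 16 orbits per diamond, peel round 2 (`B:DN`). -/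
theorem apexTwoCeilOne_N_absent {h : ℤ} {C : MConfig} (hU : C.InDiamond h) (hDN : ∀ Z ∈ C.lower, RuleDMu4N C Z)
    (hDP : ∀ P ∈ C.upper, RuleDMu4P C P) (hX : XPlusClosed C) (hGl : PermClosed C.lower) (hGu : PermClosed C.upper)
    (hΔu : DeltaClosed C.upper) {N : MCell} {φ v χ : Fin 4}
    (h0 : N 0 = floorUnit φ) (h1 : N 1 = (2, 0, 0)) (h2 : N 2 = ceilLetter h v 1) (h3 : N 3 = ceilingUnit h χ) : N ∉ C.lower := fun hN => by
  obtain ⟨r, hr, P, hP, hZP⟩ := settled_of_floorUnit hU (hDN N hN) (b := 0) (c := 1) (by decide) (k := φ) h0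
    (by rw [h1]; exact adapted_of_isApex ⟨rfl, rfl⟩ φ) (by rw [h1]; fin_cases φ <;> simp [coord])
  have hd : 0 < (N 1).1 - (P 1).1 := by have := hZP.2.1; omega
  have e : ((2, 0, 0) : BPoint) = ray (P 1) r ((N 1).1 - (P 1).1) := by rw [← h1]; exact hZP.2.2
  obtain ⟨-, hP1⟩ := below_apexTwo (hU.2 P hP 1) hd e
  have hψ : φ ≠ r + 2 := fun e2 => hr (by rw [e2, fin4_add_two_add_two])
  exact unitPairCeilOne_P_absent hU hDN hDP hX hGl hGu hΔu hψ ((hZP.1 0 (by decide)).trans h0) hP1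
    ((hZP.1 2 (by decide)).trans h2) ((hZP.1 3 (by decide)).trans h3) hP

/-- **TP21** `P{ℓ_φ, 2I, s_m, cu_χ} ∉ C.upper` (`h = 2m+4`) [as TP19; NO A2I⁻]: the up-line of `s_m` is `y_1` — TN18.  Census: 16 orbits per diamond,
peel round 2 (`B:DP`). -/
theorem unitApexTwoSubTop_P_absent {h m : ℤ} {C : MConfig} (hU : C.InDiamond h) (hDN : ∀ Z ∈ C.lower, RuleDMu4N C Z)
    (hDP : ∀ P ∈ C.upper, RuleDMu4P C P) (hX : XPlusClosed C) (hGl : PermClosed C.lower) (hGu : PermClosed C.upper)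
    (hΔu : DeltaClosed C.upper) (hh : h = 2 * m + 4) {P : MCell} {φ v χ : Fin 4}
    (h0 : P 0 = floorUnit φ) (h1 : P 1 = (2, 0, 0)) (h2 : P 2 = subCeilLetter m v m) (h3 : P 3 = ceilingUnit h χ) : P ∉ C.upper :=
  fun hP => by
  obtain ⟨N, hN, hNP, hN2⟩ := upLine_subTop hU hh hP (hDP P hP) h2 h3
  exact apexTwoCeilOne_N_absent hU hDN hDP hX hGl hGu hΔu ((hNP 0 (by decide)).trans h0) ((hNP 1 (by decide)).trans h1) hN2
    ((hNP 3 (by decide)).trans h3) hN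

/-- below `2I + ℓ_u` along a ray other than its node direction `u + 2`: `2I` (depth 1) or `ℓ_{u+2}` (depth 2). -/
theorem below_nodeTwoOne_offNode {h d : ℤ} {z : BPoint} {u r : Fin 4} (hz : InDiamond h z) (hd : 0 < d) (hr : r ≠ u + 2)
    (he : nodeTwoLetter u 1 = ray z r d) : (d = 1 ∧ z = (2, 0, 0)) ∨ (d = 2 ∧ z = floorUnit (u + 2)) := by
  obtain ⟨α, a, b⟩ := z
  obtain ⟨hax, h1, -, -⟩ := hz
  simp only [AxisPt, absCharge, chargeOf, ray, Prod.mk.injEq] at hax h1 he ⊢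
  fin_cases u <;> fin_cases r <;> simp at hax h1 he hr ⊢ <;> (simp only [abs_eq_max_neg, max_def] at h1; split_ifs at h1 <;> omega)

/-- **TN16** `N{ℓ_φ, 2I + ℓ_u, s_m, cu_χ} ∉ C.lower` (`h = 2m+4`) [as B4] — the residue class R003 of v1.5: RULE D on the floor node `0` × the TOP `4`
of `2I + ℓ_u`: `2I + ℓ_u` is served off `u + 2`, from `2I` (TP21) or `ℓ_{u+2}` (TP20).  Census: 64 orbits per diamond, peel round 2 (`B:DN`). -/
theorem unitNodeTwoSubTop_N_absent {h m : ℤ} {C : MConfig} (hU : C.InDiamond h) (hDN : ∀ Z ∈ C.lower, RuleDMu4N C Z)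
    (hDP : ∀ P ∈ C.upper, RuleDMu4P C P) (hX : XPlusClosed C) (hA : A2IMinusClosed C) (hGl : PermClosed C.lower)
    (hGu : PermClosed C.upper) (hΔu : DeltaClosed C.upper) (hh : h = 2 * m + 4) {N : MCell} {φ u v χ : Fin 4}
    (h0 : N 0 = floorUnit φ) (h1 : N 1 = nodeTwoLetter u 1) (h2 : N 2 = subCeilLetter m v m) (h3 : N 3 = ceilingUnit h χ) :
    N ∉ C.lower := fun hN => by
  obtain ⟨r, hr, P, hP, hZP⟩ := settled_of_floorUnit hU (hDN N hN) (b := 0) (c := 1) (by decide) (k := u) h0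
    (by rw [h1]; exact (nodeTwoLetter_top u 1).1) (by rw [h1, (nodeTwoLetter_top u 1).2]; norm_num)
  have hd : 0 < (N 1).1 - (P 1).1 := by have := hZP.2.1; omega
  have e : nodeTwoLetter u 1 = ray (P 1) r ((N 1).1 - (P 1).1) := by rw [← h1]; exact hZP.2.2
  have hP0 : P 0 = floorUnit φ := (hZP.1 0 (by decide)).trans h0
  have hP2 : P 2 = subCeilLetter m v m := (hZP.1 2 (by decide)).trans h2
  have hP3 : P 3 = ceilingUnit h χ := (hZP.1 3 (by decide)).trans h3
  rcases below_nodeTwoOne_offNode (hU.2 P hP 1) hd hr e with ⟨-, hP1⟩ | ⟨-, hP1⟩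
  · exact unitApexTwoSubTop_P_absent hU hDN hDP hX hGl hGu hΔu hh hP0 hP1 hP2 hP3 hP
  · exact unitPairSubTop_P_absent hU hDN hDP hX hA hGl hGu hΔu hh hP0 hP1 hP2 hP3 hP

/-! ### §14b ◇₈ representatives (`m = 2`: `s_m = 4I + ℓ`, `y_1 = 4I + 2ℓ`, `cu = 6I + ℓ`) -/

/-- ◇₈ `N[O|l-1|6I+l-1|6I+l-1]` (census var 2375, ROUND 1, `P:Xp` via an `[Am]` clause): B4. -/
def repB4 : MCell := ![(0, 0, 0), (1, -1, 0), (7, -1, 0), (7, -1, 0)]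
theorem repB4_absent {C : MConfig} (hU : C.InDiamond 8) (hG : C.G1Closed) (hS : C.StaticH1) : repB4 ∉ C.lower :=
  loneUnit_pair_N_absent hU hS.1.1 hS.1.2 hS.2.1 hS.2.2 hG.1 hG.2.1 hG.2.2.2 (φ := 2) (χ := 2) (χ' := 2)
    (by simp [repB4]) (by simp [repB4, ray]) (by simp [repB4, ray]) (by simp [repB4, ray])

/-- ◇₈ `P[l-1|li|4I+2l-1|6I+l-1]` (census var 11812, ROUND 2, `B:DP`): TP19 (`φ ≠ ψ`, law-free). -/
def repTP19 : MCell := ![(1, -1, 0), (1, 0, -1), (6, -2, 0), (7, -1, 0)]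
theorem repTP19_absent {C : MConfig} (hU : C.InDiamond 8) (hG : C.G1Closed) (hS : C.StaticH1) : repTP19 ∉ C.upper :=
  unitPairCeilOne_P_absent hU hS.1.1 hS.1.2 hS.2.1 hG.1 hG.2.1 hG.2.2.2 (φ := 2) (ψ := 1) (v := 2) (χ := 2) (by decide)
    (by simp [repTP19, ray]) (by simp [repTP19, ray]) (by simp [repTP19, ray]) (by simp [repTP19, ray])

/-- ◇₈ `N[l-1|2I+l-1|4I+l-1|6I+l-1]` (census var 22347, ROUND 2, `B:DN`; residue class R003 of v1.5): TN16 — through TP21, TN18, TP19 and TP20, TN17, TP18, B4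
(the other five representatives: vars 2306 TP18, 10089 TN17, 17341 TN18, 9908 TP20, 17160 TP21; memo §1). -/
def repTN16 : MCell := ![(1, -1, 0), (3, -1, 0), (5, -1, 0), (7, -1, 0)]
theorem repTN16_absent {C : MConfig} (hU : C.InDiamond 8) (hG : C.G1Closed) (hS : C.StaticH1) : repTN16 ∉ C.lower :=
  unitNodeTwoSubTop_N_absent hU hS.1.1 hS.1.2 hS.2.1 hS.2.2 hG.1 hG.2.1 hG.2.2.2 (m := 2) (by norm_num)
    (φ := 2) (u := 2) (v := 2) (χ := 2) (by simp [repTN16, ray]) (by simp [repTN16, ray]) (by simp [repTN16, ray]) (by simp [repTN16, ray])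

end Summit.HodgeConjecture.HodgeConjecture.Cruxes.BlochSeedDiscOne.CeilingPair
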